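-- cmk2-p1 g17: self-contained T2 path-(beta) assembly chain v5, rc 0 (see KERNEL-STATUS §17)
import Summits.BirchSwinnertonDyer.BirchSwinnertonDyer.Theorems.CMKolyvaginAtInertTwoCebotarevBinderPairDeeperAtTwo
import Summits.BirchSwinnertonDyer.BirchSwinnertonDyer.Theorems.CMKolyvaginAtInertTwoCebotarevBinderTransferAtTwo
import Summits.BirchSwinnertonDyer.BirchSwinnertonDyer.Theorems.CMKolyvaginAtInertTwoLiftGroupsAllAtTwo
import Summits.BirchSwinnertonDyer.BirchSwinnertonDyer.Theorems.CMKolyvaginAtInertTwoAdaptiveDataTelescopeStep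
import Summits.BirchSwinnertonDyer.BirchSwinnertonDyer.Theorems.CMKolyvaginAtInertTwoPairOfRatCarrierAtTwo
import Summits.BirchSwinnertonDyer.BirchSwinnertonDyer.Theorems.GenusKolyvaginAtTwoVisiblePairAtTwoDefs
import Summits.BirchSwinnertonDyer.BirchSwinnertonDyer.Theorems.CMKolyvaginAtInertTwoPairHCTVOfMembersKillAtTwo
import Summits.BirchSwinnertonDyer.BirchSwinnertonDyer.Theorems.CMKolyvaginAtInertTwoPairTransportPairingAtTwo
import Summits.BirchSwinnertonDyer.BirchSwinnertonDyer.Theorems.GenusKolyvaginAtTwoVisiblePairAtTwoCasselsTateValue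
import Summits.BirchSwinnertonDyer.BirchSwinnertonDyer.Theorems.GenusKolyvaginAtTwoVisiblePairAtTwoCasselsTateValueTwin
import Summits.BirchSwinnertonDyer.BirchSwinnertonDyer.Theorems.GenusKolyvaginAtTwoVisiblePairAtTwoCasselsTateHlocCanonical
import Summits.BirchSwinnertonDyer.BirchSwinnertonDyer.Theorems.GenusKolyvaginAtTwoVisiblePairAtTwoCasselsTateShaThree
import Summits.BirchSwinnertonDyer.BirchSwinnertonDyer.Theorems.GenusKolyvaginAtTwoEquivariantKolyvaginExactAtTwoKolyvaginPrimeDictionary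
import Summits.BirchSwinnertonDyer.BirchSwinnertonDyer.Theorems.GenusKolyvaginAtTwoEquivariantKolyvaginExactAtTwoTwistLocalConditions
import Summits.BirchSwinnertonDyer.BirchSwinnertonDyer.Theorems.GenusKolyvaginAtTwoEquivariantKolyvaginExactAtTwoTwinGrossPrimes
import Summits.BirchSwinnertonDyer.BirchSwinnertonDyer.Theorems.KolyvaginRoadThreeMethod2LocalInputsLineTrans
import Summits.BirchSwinnertonDyer.BirchSwinnertonDyer.Theorems.CMKolyvaginAtInertTwoFullOrderPairCebotarevSocketsAtTwo
import Summits.BirchSwinnertonDyer.BirchSwinnertonDyer.Theorems.CMKolyvaginAtInertTwoPairDataInputsAtTwo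
import Literature.NumberTheory.EllipticCurves.ArtinFormalismQuadraticLocalProofs
import Literature.NumberTheory.EllipticCurves.SelmerCorankControlRatProofs
import Literature.NumberTheory.EllipticCurves.LFunctionPrimeCoeff
import Literature.NumberTheory.GaloisCohomology.PoitouTateNumberField
import Literature.NumberTheory.EllipticCurves.CasselsTateAlternating
import Literature.NumberTheory.EllipticCurves.HeegnerPointsKolyvaginSplitDescentData
import Literature.NumberTheory.EllipticCurves.HeegnerPointsKolyvaginSplitDescentPairProofs
import HarnessLib
import Literature.NumberTheory.EllipticCurves.BSDSelmerProofs
import Literature.NumberTheory.EllipticCurves.CasselsTateLevelAssembly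
import Summits.BirchSwinnertonDyer.BirchSwinnertonDyer.Theorems.GenusKolyvaginAtTwoVisiblePairAtTwoCasselsTateKernel
import Literature.NumberTheory.EllipticCurves.SelmerFiniteProofs
import Summits.BirchSwinnertonDyer.BirchSwinnertonDyer.Theorems.GenusKolyvaginAtTwoCasselsTatePTcRealReadout
import Summits.BirchSwinnertonDyer.BirchSwinnertonDyer.Theorems.CMKolyvaginAtInertTwoPairMemberCanonicalAtTwo
import Literature.NumberTheory.EllipticCurves.WeilPairingProofs

-- single-conjunct summit: `Summit.BirchSwinnertonDyer.BirchSwinnertonDyer.…` repeats the name by design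
set_option linter.dupNamespace false
set_option autoImplicit false

open scoped Classical

namespace Summit.BirchSwinnertonDyer.BirchSwinnertonDyer.Theorems.KolyvaginAdaptiveData

open Literature.NumberTheory.EllipticCurves Literature.NumberTheory.EllipticCurves.KolyvaginDescent
open KolyvaginAdaptiveTwo (exists_split_not_mem_sup)

variable {V : Type*} [AddCommGroup V] {Pl : Type*}

/-! ## Plumbing: thin wrappers over the `SplitDataM.expo` API -/

/-- `p^{expo s} • s = 0`. [folklore] -/
private theorem pow_expo_zsmul (S : SplitDataM V Pl) (s : V) : ((S.p : ℤ) ^ S.expo s) • s = 0 :=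
  (S.expo_spec s).1

/-- `p^{expo s - 1} • s ≠ 0` when `expo s ≠ 0`. [folklore] -/
private theorem pow_expo_sub_one_zsmul_ne_zero (S : SplitDataM V Pl) {s : V} (h : S.expo s ≠ 0) :
    ((S.p : ℤ) ^ (S.expo s - 1)) • s ≠ 0 :=
  (S.expo_spec s).2 _ (Nat.sub_one_lt h)

/-- `expo s ≠ 0` for `s ≠ 0`. [folklore] -/
private theorem expo_ne_zero_of_ne_zero (S : SplitDataM V Pl) {s : V} (hs : s ≠ 0) : S.expo s ≠ 0 :=
  fun h ↦ hs ((S.expo_le_M_and_eq_zero_iff s).2.mp h)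

/-! ## One Kolyvagin prime, `hCTV` on `W` only -/

/-- **THE ADAPTIVE STEP of McCallum's Thm. 5.4 over `SplitDataM`, with the Cassels–Tate value formula
`hCTV` asked only for BOTH arguments in the isotropic subgroup `W`** (`p^j c(ℓm) ∈ W`, `t ∈ W`
displayed). Same state, same output as `adaptive_step` (chain `n`, used exponent `Sg`, pools
`Act`/`Pas` in `W`, (IND), (19)/(23), invariant (I); a Kolyvagin prime `ℓ ∤ n` from the order-form
binder `hCeb₂`, `#Act = p^{expo z} · #Z'`, (I) for `ℓ n` with `Sg + expo z`). The one use of `hCTV`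
has `t := z ∈ Act ≤ W` and `p^i c(ℓ n) ∈ Z' ⊔ Pas ≤ W`.
[cite: McCallumLMS1991, §5 Thm. 5.4 (proof, (16)–(23)), Prop. 4.7, Lemma 5.3, Cor. 3.2 (PDF pp. 283–290)] -/
theorem adaptive_step_memW (S : SplitDataM V Pl) (W : AddSubgroup V) {R : Type*} [AddCommGroup R]
    (P : S.Sel →+ S.Sel →+ R)
    (hCTV : ∀ ℓ m : ℕ, S.Kol ℓ → KolSupp S.Kol (ℓ * m) → ¬ ℓ ∣ m →
      ∀ (j N a b : ℕ) (t : V) (ht : t ∈ S.Sel) (hz : ((S.p : ℤ) ^ j) • S.c (ℓ * m) ∈ S.Sel),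
      ((S.p : ℤ) ^ j) • S.c (ℓ * m) ∈ W → t ∈ W →
      ((S.p : ℤ) ^ N) • t = 0 → t ∈ S.eig (S.ε * (-1) ^ (ℓ * m).primeFactors.card) →
      (∀ q ∈ m.primeFactors, t ∈ S.A q) → S.M - S.M₀ ≤ j → N + S.M₀ ≤ S.M → N ≤ j → a + b + 1 = N →
      ((S.p : ℤ) ^ (a + (j - N))) • S.c m ∉ S.A ℓ → ((S.p : ℤ) ^ b) • t ∉ S.A ℓ →
      P ⟨_, hz⟩ ⟨t, ht⟩ ≠ 0)
    (Δ : AddSubgroup V)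
    (hΔpure : ∀ d ∈ Δ, ∀ e : ℤ, (e = 1 ∨ e = -1) → d ∈ S.eig e → d = 0)
    (hCeb₂ : ∀ (T : Finset V) (g₁ g₂ : V) (ν : ℤ) (I : ℕ), (ν = 1 ∨ ν = -1) → g₁ ∈ S.eig ν →
      g₂ ∈ S.eig (-ν) → (∀ t ∈ T, ∃ e : ℤ, (e = 1 ∨ e = -1) ∧ t ∈ S.eig e) →
      (g₁ ≠ 0 → ((S.p : ℤ) ^ (S.expo g₁ - 1)) • g₁ ∉ Δ ⊔ AddSubgroup.closure (T : Set V)) →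
      (1 ≤ I → ∀ d ∈ Δ, ∀ u ∈ AddSubgroup.closure (T : Set V), u ∈ S.eig (-ν) →
        ∀ v ∈ AddSubgroup.closure (T : Set V), v ∈ S.eig ν → (S.p : ℤ) • v = 0 →
        ((S.p : ℤ) ^ (I - 1)) • g₂ ≠ d + u + v) →
      ∀ b : ℕ, ∃ ℓ, b < ℓ ∧ S.Kol ℓ ∧
        (∀ t ∈ AddSubgroup.closure (T : Set V), t ∈ S.A ℓ) ∧
        (∀ j < S.expo g₁, ((S.p : ℤ) ^ j) • g₁ ∉ S.A ℓ) ∧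
        (∀ i < I, ((S.p : ℤ) ^ i) • g₂ ∉ S.A ℓ))
    (hWSel : W ≤ S.Sel)
    (hiso : ∀ u, ∀ hu : u ∈ W, ∀ v, ∀ hv : v ∈ W, ∀ (hu' : u ∈ S.Sel) (hv' : v ∈ S.Sel),
      P ⟨u, hu'⟩ ⟨v, hv'⟩ = 0)
    (hroom : ∀ z ∈ W, S.expo z + S.M₀ ≤ S.M)
    (Act Pas : AddSubgroup V) [Finite Act] [Finite Pas] (hAct : Act ≤ W) (hPas : Pas ≤ W)
    (hdisj : Disjoint Act (Pas ⊔ Δ)) {n : ℕ} (hn : KolSupp S.Kol n) (Sg : ℕ)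
    (hActν : ∀ z ∈ Act, z ∈ S.eig (S.ε * (-1) ^ (n.primeFactors.card + 1)))
    (hPasν : ∀ u ∈ Pas, u ∈ S.eig (S.ε * (-1) ^ n.primeFactors.card))
    (hA : ∀ q ∈ n.primeFactors, ∀ z ∈ Act ⊔ Pas, z ∈ S.A q)
    (hI : ∀ i : ℕ, ((S.p : ℤ) ^ i) • S.c n ∈ Act ⊔ Pas → (S.M - S.M₀) + Sg ≤ i) :
    ∃ (ℓ : ℕ) (Z' : AddSubgroup V) (e : ℕ), S.Kol ℓ ∧ KolSupp S.Kol (ℓ * n) ∧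
      (ℓ * n).primeFactors.card = n.primeFactors.card + 1 ∧ Z' ≤ Act ∧
      Nat.card Act = S.p ^ e * Nat.card Z' ∧ (Act ≠ ⊥ → e ≠ 0) ∧
      (∀ q ∈ (ℓ * n).primeFactors, ∀ z ∈ Z' ⊔ Pas, z ∈ S.A q) ∧
      ∀ i : ℕ, ((S.p : ℤ) ^ i) • S.c (ℓ * n) ∈ Z' ⊔ Pas → (S.M - S.M₀) + (Sg + e) ≤ i := by
  have hp := S.hp
  set r := n.primeFactors.card with hr
  set ν : ℤ := S.ε * (-1) ^ (r + 1) with hν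
  have hν1 : ν = 1 ∨ ν = -1 := S.sign_pow_cases (r + 1)
  have hnegν : -ν = S.ε * (-1) ^ r := by rw [hν, pow_succ]; ring
  have hν1' : -ν = 1 ∨ -ν = -1 := by rcases hν1 with h | h <;> simp [h]
  have hτc : S.c n ∈ S.eig (-ν) := by rw [hnegν]; exact S.c_eig n hn
  have hPasν' : ∀ u ∈ Pas, u ∈ S.eig (-ν) := by rw [hnegν]; exact hPasν
  set I := S.M - S.M₀ + Sg with hIdef
  -- (F1): the bottom `p^{I-1} c(n)` avoids `Pas ⊔ Δ`
  have hF1 : 1 ≤ I → ((S.p : ℤ) ^ (I - 1)) • S.c n ∉ Pas ⊔ Δ := fun h1 ↦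
    pow_zsmul_not_mem_sup_of_invariant S hΔpure hν1 hPasν' hτc hI h1
  -- ### the generator `z` (McCallum's `c_{k+1}`, of maximal order in `Act`) and the new pool `Z'`
  have hgen : ∃ z ∈ Act, ∃ Z' : AddSubgroup V, Z' ≤ Act ∧ AddSubgroup.zmultiples z ⊓ Z' = ⊥ ∧
      AddSubgroup.zmultiples z ⊔ Z' = Act ∧ (Act ≠ ⊥ → z ≠ 0) ∧
      (1 ≤ I → ((S.p : ℤ) ^ (I - 1)) • S.c n ∉ Z' ⊔ (Pas ⊔ Δ)) ∧
      ∀ m : ℤ, m • z ≠ 0 → m • z ∉ Z' ⊔ (Pas ⊔ Δ) := by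
    by_cases hbot : Act = ⊥
    · -- dummy step: `g₁ = 0`, `Z' = ⊥ = Act`
      refine ⟨0, zero_mem _, ⊥, bot_le, by simp, ?_, fun h ↦ (h hbot).elim, fun h1 ↦ ?_,
        fun m hm ↦ (hm (zsmul_zero m)).elim⟩
      · rw [AddSubgroup.zmultiples_zero_eq_bot, bot_sup_eq, hbot]
      · rw [bot_sup_eq]
        exact hF1 h1
    · -- real step: `I ≥ 1` since `Act` has a non-zero element (`expo ≥ 1`, room `expo + M₀ ≤ M`)
      obtain ⟨⟨z₀, hz₀⟩, hz₀ne⟩ := AddSubgroup.ne_bot_iff_exists_ne_zero.mp hbot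
      have hz₀ne' : z₀ ≠ 0 := fun h ↦ hz₀ne (Subtype.ext h)
      have h1 : 1 ≤ I := by
        have he := expo_ne_zero_of_ne_zero S hz₀ne'
        have := hroom z₀ (hAct hz₀)
        omega
      obtain ⟨z, hz, hzord, Z', hZ'le, hinf, hsup, -, hβ, hmult⟩ :=
        exists_split_not_mem_sup Act (Pas ⊔ Δ) hbot hdisj (hF1 h1)
      refine ⟨z, hz, Z', hZ'le, hinf, hsup, fun _ hz0 ↦ ?_, fun _ ↦ hβ, hmult⟩
      apply hz₀ne
      have hdvd := AddMonoid.addOrder_dvd_exponent (⟨z₀, hz₀⟩ : Act)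
      rw [← hzord, hz0, addOrderOf_zero, Nat.dvd_one] at hdvd
      exact AddMonoid.addOrderOf_eq_one_iff.mp hdvd
  obtain ⟨z, hz, Z', hZ'le, hinf, hsup, hzne, hβ, hmult⟩ := hgen
  haveI : Finite Z' :=
    Finite.of_injective (AddSubgroup.inclusion hZ'le) (AddSubgroup.inclusion_injective hZ'le)
  -- ### the finite generating set `T` of the new pool `Z' ⊔ Pas`
  have hTfin : ((Z' : Set V) ∪ (Pas : Set V)).Finite := (Set.toFinite _).union (Set.toFinite _)
  set T : Finset V := hTfin.toFinset with hT
  have hTcoe : (T : Set V) = (Z' : Set V) ∪ (Pas : Set V) := hTfin.coe_toFinset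
  have hclT : AddSubgroup.closure (T : Set V) = Z' ⊔ Pas := by
    rw [hTcoe, AddSubgroup.closure_union, AddSubgroup.closure_eq, AddSubgroup.closure_eq]
  have hzν : z ∈ S.eig ν := hActν z hz
  have hTpure : ∀ t ∈ T, ∃ e : ℤ, (e = 1 ∨ e = -1) ∧ t ∈ S.eig e := by
    intro t ht
    rw [← Finset.mem_coe, hTcoe, Set.mem_union] at ht
    rcases ht with ht | ht
    · exact ⟨ν, hν1, hActν t (hZ'le ht)⟩
    · exact ⟨-ν, hν1', hPasν' t ht⟩
  have hsupeq : Δ ⊔ AddSubgroup.closure (T : Set V) = Z' ⊔ (Pas ⊔ Δ) := by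
    rw [hclT, sup_comm, sup_assoc]
  -- (22): `z` will be FULL at `λ` — its bottom avoids `Δ ⊔ ⟨T⟩`
  have hfull : z ≠ 0 → ((S.p : ℤ) ^ (S.expo z - 1)) • z ∉ Δ ⊔ AddSubgroup.closure (T : Set V) := by
    intro hz0
    rw [hsupeq]
    exact hmult _ (pow_expo_sub_one_zsmul_ne_zero S (expo_ne_zero_of_ne_zero S hz0))
  -- (21): `c(n)` of local order `≥ p^I` — its `p^{I-1}`-multiple avoids `Δ + ⟨T⟩`
  have hrel : 1 ≤ I → ∀ d ∈ Δ, ∀ u ∈ AddSubgroup.closure (T : Set V), u ∈ S.eig (-ν) →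
      ∀ v ∈ AddSubgroup.closure (T : Set V), v ∈ S.eig ν → (S.p : ℤ) • v = 0 →
      ((S.p : ℤ) ^ (I - 1)) • S.c n ≠ d + u + v := by
    intro h1 d hd u hu _ v hv _ _ heq
    apply hβ h1
    rw [heq]
    rw [hclT] at hu hv
    have hle : Z' ⊔ Pas ≤ Z' ⊔ (Pas ⊔ Δ) := sup_le_sup_left le_sup_left Z'
    exact add_mem (add_mem (AddSubgroup.mem_sup_right (AddSubgroup.mem_sup_right hd)) (hle hu))
      (hle hv)
  -- ### the Kolyvagin prime `ℓ = ℓ_{k+1}`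
  obtain ⟨ℓ, hnℓ, hℓ, hTA, hzA, hcA⟩ := hCeb₂ T z (S.c n) ν I hν1 hzν hτc hTpure hfull hrel n
  rw [hclT] at hTA
  have hℓp := S.prime_of_kol ℓ hℓ
  have hn0 : n ≠ 0 := hn.1.ne_zero
  have hndvd : ¬ ℓ ∣ n := fun h ↦ by
    have := Nat.le_of_dvd (Nat.pos_of_ne_zero hn0) h
    omega
  have hsupp : KolSupp S.Kol (ℓ * n) := S.kolSupp_mul_of_not_dvd hℓ hn hndvd
  have hcard' : (ℓ * n).primeFactors.card = r + 1 :=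
    SplitDataM.card_primeFactors_mul_of_not_dvd hℓp hn0 hndvd
  -- `#Act = ord z · #Z' = p^{expo z} · #Z'`
  have hcardAct : Nat.card Act = S.p ^ S.expo z * Nat.card Z' := by
    have h1 : (AddSubgroup.zmultiples z).relIndex (AddSubgroup.zmultiples z ⊔ Z') = Nat.card Z' := by
      rw [AddSubgroup.relIndex_sup_left, ← AddSubgroup.inf_relIndex_right, hinf,
        AddSubgroup.relIndex_bot_left]
    have h2 := AddSubgroup.relIndex_mul_relIndex ⊥ (AddSubgroup.zmultiples z)
      (AddSubgroup.zmultiples z ⊔ Z') bot_le le_sup_left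
    rw [AddSubgroup.relIndex_bot_left, AddSubgroup.relIndex_bot_left, h1, hsup, Nat.card_zmultiples,
      S.addOrderOf_eq_pow_expo z] at h2
    exact h2.symm
  have hW : Z' ⊔ Pas ≤ W := sup_le (hZ'le.trans hAct) hPas
  refine ⟨ℓ, Z', S.expo z, hℓ, hsupp, hcard', hZ'le, hcardAct,
    fun h ↦ expo_ne_zero_of_ne_zero S (hzne h), ?_, ?_⟩
  · -- (19)/(23): the pools vanish at the primes of `ℓ n`
    intro q hq w hw
    rw [Nat.primeFactors_mul hℓp.ne_zero hn0, Finset.mem_union, hℓp.primeFactors,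
      Finset.mem_singleton] at hq
    rcases hq with rfl | hq
    · exact hTA w hw
    · exact hA q hq w (sup_le_sup_right hZ'le Pas hw)
  · -- ### the invariant (I) for `ℓ n`
    intro i hi
    have hSel : ((S.p : ℤ) ^ i) • S.c (ℓ * n) ∈ S.Sel := hWSel (hW hi)
    have hAℓ : ((S.p : ℤ) ^ i) • S.c n ∈ S.A ℓ :=
      (S.c_mem_loc_iff ℓ n hℓ hsupp i).mp ((S.mem_sel_iff _).mp hSel (S.pl ℓ))
    -- Fact B: `p^i c(n)_λ = 0 ⟹ I ≤ i`
    have hB0 : I ≤ i := by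
      by_contra h
      exact hcA i (by omega) hAℓ
    by_cases hN : S.expo z = 0
    · rw [hN]
      omega
    by_contra hlt
    have hroomz := hroom z (hAct hz)
    have hNi : S.expo z ≤ i := by omega
    -- (21): `p^{i - N} c(n)_λ ≠ 0`
    have hnot : ((S.p : ℤ) ^ (0 + (i - S.expo z))) • S.c n ∉ S.A ℓ := by
      rw [zero_add]
      exact hcA _ (by omega)
    -- (22): `z` has full order at `λ`
    have hzfull : ((S.p : ℤ) ^ (S.expo z - 1)) • z ∉ S.A ℓ := hzA _ (by omega)
    have hτz : z ∈ S.eig (S.ε * (-1) ^ (ℓ * n).primeFactors.card) := by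
      rw [hcard']
      exact hzν
    have hAq : ∀ q ∈ n.primeFactors, z ∈ S.A q := fun q hq ↦ hA q hq z (AddSubgroup.mem_sup_left hz)
    have hzSel : z ∈ S.Sel := hWSel (hAct hz)
    have hne := hCTV ℓ n hℓ hsupp hndvd i (S.expo z) 0 (S.expo z - 1) z hzSel hSel (hW hi) (hAct hz)
      (pow_expo_zsmul S z) hτz hAq (by omega) hroomz hNi (by omega) hnot hzfull
    -- isotropy of `W ∋ p^i c(ℓ n), z`
    exact hne (hiso _ (hW hi) _ (hAct hz) hSel hzSel)

end Summit.BirchSwinnertonDyer.BirchSwinnertonDyer.Theorems.KolyvaginAdaptiveData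


-- single-conjunct summit: `Summit.BirchSwinnertonDyer.BirchSwinnertonDyer.…` repeats the name by design
set_option linter.dupNamespace false
set_option autoImplicit false

open scoped Classical

namespace Summit.BirchSwinnertonDyer.BirchSwinnertonDyer.Theorems.KolyvaginAdaptiveData

open Literature.NumberTheory.EllipticCurves Literature.NumberTheory.EllipticCurves.KolyvaginDescent

variable {V : Type*} [AddCommGroup V] {Pl : Type*}

/-! ## The chain with adaptive pools, `hCTV` on `W` -/

/-- **McCallum 1991, proof of Thm. 5.4 — the chain with ADAPTIVE pools over `SplitDataM`, the
Cassels–Tate value formula asked only for both arguments in the isotropic subgroup `W`.** Same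
statement as `card_mul_card_mul_pow_le` otherwise: for every state (finite pools `Act`, `Pas` in `W`
of the right signs, mutually disjoint modulo `Δ`, a chain `n`, used exponent `Sg`, (19)/(23) and the
invariant (I)) one has `#Act · #Pas · p^{Sg} ≤ p^{M₀}`. Step: `adaptive_step_memW`.
[cite: McCallumLMS1991, §5 Thm. 5.4 (proof, (16)–(23)), Cor. 5.6 (PDF pp. 288–290)] -/
theorem card_mul_card_mul_pow_le_memW (S : SplitDataM V Pl) (W : AddSubgroup V) {R : Type*}
    [AddCommGroup R] (P : S.Sel →+ S.Sel →+ R)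
    (hCTV : ∀ ℓ m : ℕ, S.Kol ℓ → KolSupp S.Kol (ℓ * m) → ¬ ℓ ∣ m →
      ∀ (j N a b : ℕ) (t : V) (ht : t ∈ S.Sel) (hz : ((S.p : ℤ) ^ j) • S.c (ℓ * m) ∈ S.Sel),
      ((S.p : ℤ) ^ j) • S.c (ℓ * m) ∈ W → t ∈ W →
      ((S.p : ℤ) ^ N) • t = 0 → t ∈ S.eig (S.ε * (-1) ^ (ℓ * m).primeFactors.card) →
      (∀ q ∈ m.primeFactors, t ∈ S.A q) → S.M - S.M₀ ≤ j → N + S.M₀ ≤ S.M → N ≤ j → a + b + 1 = N →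
      ((S.p : ℤ) ^ (a + (j - N))) • S.c m ∉ S.A ℓ → ((S.p : ℤ) ^ b) • t ∉ S.A ℓ →
      P ⟨_, hz⟩ ⟨t, ht⟩ ≠ 0)
    (Δ : AddSubgroup V)
    (hΔpure : ∀ d ∈ Δ, ∀ e : ℤ, (e = 1 ∨ e = -1) → d ∈ S.eig e → d = 0)
    (hCeb₂ : ∀ (T : Finset V) (g₁ g₂ : V) (ν : ℤ) (I : ℕ), (ν = 1 ∨ ν = -1) → g₁ ∈ S.eig ν →
      g₂ ∈ S.eig (-ν) → (∀ t ∈ T, ∃ e : ℤ, (e = 1 ∨ e = -1) ∧ t ∈ S.eig e) →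
      (g₁ ≠ 0 → ((S.p : ℤ) ^ (S.expo g₁ - 1)) • g₁ ∉ Δ ⊔ AddSubgroup.closure (T : Set V)) →
      (1 ≤ I → ∀ d ∈ Δ, ∀ u ∈ AddSubgroup.closure (T : Set V), u ∈ S.eig (-ν) →
        ∀ v ∈ AddSubgroup.closure (T : Set V), v ∈ S.eig ν → (S.p : ℤ) • v = 0 →
        ((S.p : ℤ) ^ (I - 1)) • g₂ ≠ d + u + v) →
      ∀ b : ℕ, ∃ ℓ, b < ℓ ∧ S.Kol ℓ ∧
        (∀ t ∈ AddSubgroup.closure (T : Set V), t ∈ S.A ℓ) ∧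
        (∀ j < S.expo g₁, ((S.p : ℤ) ^ j) • g₁ ∉ S.A ℓ) ∧
        (∀ i < I, ((S.p : ℤ) ^ i) • g₂ ∉ S.A ℓ))
    (hWSel : W ≤ S.Sel)
    (hiso : ∀ u, ∀ hu : u ∈ W, ∀ v, ∀ hv : v ∈ W, ∀ (hu' : u ∈ S.Sel) (hv' : v ∈ S.Sel),
      P ⟨u, hu'⟩ ⟨v, hv'⟩ = 0)
    (hroom : ∀ z ∈ W, S.expo z + S.M₀ ≤ S.M) :
    ∀ (m : ℕ) (Act Pas : AddSubgroup V) [Finite Act] [Finite Pas], Act ≤ W → Pas ≤ W →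
      Disjoint Act (Pas ⊔ Δ) → Disjoint Pas (Act ⊔ Δ) →
      ∀ n : ℕ, KolSupp S.Kol n → ∀ Sg : ℕ,
      (∀ z ∈ Act, z ∈ S.eig (S.ε * (-1) ^ (n.primeFactors.card + 1))) →
      (∀ u ∈ Pas, u ∈ S.eig (S.ε * (-1) ^ n.primeFactors.card)) →
      (∀ q ∈ n.primeFactors, ∀ z ∈ Act ⊔ Pas, z ∈ S.A q) →
      (∀ i : ℕ, ((S.p : ℤ) ^ i) • S.c n ∈ Act ⊔ Pas → (S.M - S.M₀) + Sg ≤ i) →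
      2 * (Nat.card Act + Nat.card Pas) + (if Act = ⊥ then 1 else 0) ≤ m →
      Nat.card Act * Nat.card Pas * S.p ^ Sg ≤ S.p ^ S.M₀ := by
  have hp := S.hp
  intro m
  induction m with
  | zero =>
    intro Act Pas _ _ _ _ _ _ n _ Sg _ _ _ _ hm
    have : 0 < Nat.card Act := Nat.card_pos
    omega
  | succ m ih =>
    intro Act Pas _ _ hAct hPas hd1 hd2 n hn Sg hActν hPasν hA hI hm
    by_cases hend : Act = ⊥ ∧ Pas = ⊥
    · -- END: both pools exhausted; (I) at `i = M` gives `Sg ≤ M₀`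
      obtain ⟨hA0, hP0⟩ := hend
      have hSg : S.M - S.M₀ + Sg ≤ S.M := hI S.M (by rw [S.torsion]; exact zero_mem _)
      have hcA : Nat.card Act = 1 := by rw [hA0]; exact AddSubgroup.card_bot
      have hcP : Nat.card Pas = 1 := by rw [hP0]; exact AddSubgroup.card_bot
      rw [hcA, hcP, one_mul, one_mul]
      exact Nat.pow_le_pow_right hp.pos (by omega)
    · -- one Kolyvagin prime (`adaptive_step`), then recurse with the roles of the pools swapped
      obtain ⟨ℓ, Z', e, -, hsupp, hcard', hZ'le, hcardAct, hene, hA', hI'⟩ :=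
        adaptive_step_memW S W P hCTV Δ hΔpure hCeb₂ hWSel hiso hroom Act Pas hAct hPas hd1 hn Sg
          hActν hPasν hA hI
      haveI : Finite Z' :=
        Finite.of_injective (AddSubgroup.inclusion hZ'le) (AddSubgroup.inclusion_injective hZ'le)
      -- the new state `(Pas, Z')` at `ℓ n` with `Sg + e`
      have hd1' : Disjoint Pas (Z' ⊔ Δ) := hd2.mono_right (sup_le_sup_right hZ'le Δ)
      have hd2' : Disjoint Z' (Pas ⊔ Δ) := hd1.mono_left hZ'le
      have hActν' : ∀ z ∈ Pas, z ∈ S.eig (S.ε * (-1) ^ ((ℓ * n).primeFactors.card + 1)) := by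
        intro z hz
        have : S.ε * (-1) ^ ((ℓ * n).primeFactors.card + 1) = S.ε * (-1) ^ n.primeFactors.card := by
          rw [hcard']
          ring
        rw [this]
        exact hPasν z hz
      have hPasν' : ∀ u ∈ Z', u ∈ S.eig (S.ε * (-1) ^ (ℓ * n).primeFactors.card) := by
        intro u hu
        rw [hcard']
        exact hActν u (hZ'le hu)
      have hAI : ∀ q ∈ (ℓ * n).primeFactors, ∀ z ∈ Pas ⊔ Z', z ∈ S.A q := by
        intro q hq z hz
        rw [sup_comm] at hz
        exact hA' q hq z hz
      have hII : ∀ i : ℕ, ((S.p : ℤ) ^ i) • S.c (ℓ * n) ∈ Pas ⊔ Z' →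
          (S.M - S.M₀) + (Sg + e) ≤ i := by
        intro i hi
        rw [sup_comm] at hi
        exact hI' i hi
      -- the measure drops
      have hcZ' : 0 < Nat.card Z' := Nat.card_pos
      have hmeas : 2 * (Nat.card Pas + Nat.card Z') + (if Pas = ⊥ then 1 else 0) ≤ m := by
        by_cases hA0 : Act = ⊥
        · -- dummy step: the roles swap, `[Act = ⊥]` drops
          have hP0 : Pas ≠ ⊥ := fun h ↦ hend ⟨hA0, h⟩
          have hcA : Nat.card Act = 1 := by rw [hA0]; exact AddSubgroup.card_bot
          have hZ'bot : Z' = ⊥ := by rw [← le_bot_iff, ← hA0]; exact hZ'le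
          have hcZ : Nat.card Z' = 1 := by rw [hZ'bot]; exact AddSubgroup.card_bot
          rw [if_pos hA0] at hm
          rw [if_neg hP0]
          omega
        · -- real step: `#Z' ≤ #Act / p`
          have he : e ≠ 0 := hene hA0
          have h2 : 2 * Nat.card Z' ≤ Nat.card Act := by
            rw [hcardAct]
            exact Nat.mul_le_mul_right _ (Nat.succ_le_of_lt (Nat.one_lt_pow he hp.one_lt))
          rw [if_neg hA0] at hm
          split_ifs <;> omega
      have hrec := ih Pas Z' hPas (hZ'le.trans hAct) hd1' hd2' (ℓ * n) hsupp (Sg + e) hActν' hPasν'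
        hAI hII hmeas
      calc Nat.card Act * Nat.card Pas * S.p ^ Sg
          = Nat.card Pas * Nat.card Z' * S.p ^ (Sg + e) := by rw [hcardAct, pow_add]; ring
        _ ≤ S.p ^ S.M₀ := hrec

/-! ## T4 with the kill clause: `#Zp · #Zm ≤ p^{M₀}` -/

/-- **T4 — McCallum 1991 Thm. 5.4 "≤" / Cor. 5.6 in telescope form over the data carrier `SplitDataM`,
ADAPTIVE version, with the Cassels–Tate value formula `hCTV` asked ONLY for arguments in the isotropic
subgroup `Zp ⊔ Zm`** (displayed binders `p^j c(ℓm) ∈ Zp ⊔ Zm`, `t ∈ Zp ⊔ Zm`). Otherwise verbatim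
`card_mul_card_le_of_casselsTate_adaptive`: `Zp ≤ Sel ∩ V^{ε}`, `Zm ≤ Sel ∩ V^{−ε}` finite isotropic
lift groups, `ℤx ⊓ (Zp ⊔ Zm) = ⊥`, (IND) `(Zp ⊔ Δ) ⊓ Zm = ⊥`, room `expo z + M₀ ≤ M`, `Δ` pure-free,
`hCeb₂` the order-form Čebotarev binder; then `#Zp · #Zm ≤ p^{M₀}`. In the `p = 2` pair assembly the
lift groups are killed by `2^k` (`k` the exponent of `Ш(E^{ε}/ℚ)[2^∞] ⊕ Sel(E^{−ε}/ℚ)`), which is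
what the member formulas over `ℚ` need (`2^L • t = 0`, `L ≥ k`).
[cite: McCallumLMS1991, §1 Theorem; §5 Thm. 5.4 (proof, (16)–(23)), Cor. 5.6; Prop. 3.1 / Cor. 3.2, Prop. 4.7, Lemma 5.3 (PDF pp. 280, 283–290)] -/
theorem card_mul_card_le_of_casselsTate_adaptive_memW (S : SplitDataM V Pl) (Zp Zm : AddSubgroup V)
    [Finite Zp] [Finite Zm] {R : Type*} [AddCommGroup R] (P : S.Sel →+ S.Sel →+ R)
    (hCTV : ∀ ℓ m : ℕ, S.Kol ℓ → KolSupp S.Kol (ℓ * m) → ¬ ℓ ∣ m →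
      ∀ (j N a b : ℕ) (t : V) (ht : t ∈ S.Sel) (hz : ((S.p : ℤ) ^ j) • S.c (ℓ * m) ∈ S.Sel),
      ((S.p : ℤ) ^ j) • S.c (ℓ * m) ∈ Zp ⊔ Zm → t ∈ Zp ⊔ Zm →
      ((S.p : ℤ) ^ N) • t = 0 → t ∈ S.eig (S.ε * (-1) ^ (ℓ * m).primeFactors.card) →
      (∀ q ∈ m.primeFactors, t ∈ S.A q) → S.M - S.M₀ ≤ j → N + S.M₀ ≤ S.M → N ≤ j → a + b + 1 = N →
      ((S.p : ℤ) ^ (a + (j - N))) • S.c m ∉ S.A ℓ → ((S.p : ℤ) ^ b) • t ∉ S.A ℓ →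
      P ⟨_, hz⟩ ⟨t, ht⟩ ≠ 0)
    (Δ : AddSubgroup V)
    (hΔpure : ∀ d ∈ Δ, ∀ e : ℤ, (e = 1 ∨ e = -1) → d ∈ S.eig e → d = 0)
    (hCeb₂ : ∀ (T : Finset V) (g₁ g₂ : V) (ν : ℤ) (I : ℕ), (ν = 1 ∨ ν = -1) → g₁ ∈ S.eig ν →
      g₂ ∈ S.eig (-ν) → (∀ t ∈ T, ∃ e : ℤ, (e = 1 ∨ e = -1) ∧ t ∈ S.eig e) →
      (g₁ ≠ 0 → ((S.p : ℤ) ^ (S.expo g₁ - 1)) • g₁ ∉ Δ ⊔ AddSubgroup.closure (T : Set V)) →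
      (1 ≤ I → ∀ d ∈ Δ, ∀ u ∈ AddSubgroup.closure (T : Set V), u ∈ S.eig (-ν) →
        ∀ v ∈ AddSubgroup.closure (T : Set V), v ∈ S.eig ν → (S.p : ℤ) • v = 0 →
        ((S.p : ℤ) ^ (I - 1)) • g₂ ≠ d + u + v) →
      ∀ b : ℕ, ∃ ℓ, b < ℓ ∧ S.Kol ℓ ∧
        (∀ t ∈ AddSubgroup.closure (T : Set V), t ∈ S.A ℓ) ∧
        (∀ j < S.expo g₁, ((S.p : ℤ) ^ j) • g₁ ∉ S.A ℓ) ∧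
        (∀ i < I, ((S.p : ℤ) ^ i) • g₂ ∉ S.A ℓ))
    (hZp : ∀ z ∈ Zp, z ∈ S.Sel ∧ z ∈ S.eig S.ε) (hZm : ∀ z ∈ Zm, z ∈ S.Sel ∧ z ∈ S.eig (-S.ε))
    (hiso : ∀ u, ∀ hu : u ∈ Zp ⊔ Zm, ∀ v, ∀ hv : v ∈ Zp ⊔ Zm, ∀ (hu' : u ∈ S.Sel) (hv' : v ∈ S.Sel),
      P ⟨u, hu'⟩ ⟨v, hv'⟩ = 0)
    (hind : AddSubgroup.zmultiples S.x ⊓ (Zp ⊔ Zm) = ⊥)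
    (hIND : (Zp ⊔ Δ) ⊓ Zm = ⊥)
    (hroom : ∀ z ∈ Zp ⊔ Zm, S.expo z + S.M₀ ≤ S.M) :
    Nat.card Zp * Nat.card Zm ≤ S.p ^ S.M₀ := by
  have hp := S.hp
  have hWSel : Zp ⊔ Zm ≤ S.Sel := sup_le (fun z hz ↦ (hZp z hz).1) (fun z hz ↦ (hZm z hz).1)
  -- (IND) in the two forms the induction carries (`Δ ∩ V^{ε} = 0`)
  have hd1 : Disjoint Zm (Zp ⊔ Δ) := by rw [disjoint_iff, inf_comm]; exact hIND
  have hd2 : Disjoint Zp (Zm ⊔ Δ) := by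
    refine AddSubgroup.disjoint_def.mpr fun {a} haP haMD ↦ ?_
    obtain ⟨b, hb, d, hd, hbd⟩ := AddSubgroup.mem_sup.mp haMD
    have hb' : b ∈ (Zp ⊔ Δ) ⊓ Zm := by
      refine ⟨?_, hb⟩
      have : b = a - d := by rw [← hbd]; abel
      rw [this]
      exact (Zp ⊔ Δ).sub_mem (AddSubgroup.mem_sup_left haP) (AddSubgroup.mem_sup_right hd)
    rw [hIND, AddSubgroup.mem_bot] at hb'
    rw [hb', zero_add] at hbd
    subst hbd
    exact hΔpure d hd S.ε S.hε (hZp d haP).2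
  -- ### initial state: `n = 1`, `Sg = 0`, `Act = Zm` (sign `-ε`), `Pas = Zp` (sign `ε`)
  have hActν : ∀ z ∈ Zm, z ∈ S.eig (S.ε * (-1) ^ ((1 : ℕ).primeFactors.card + 1)) := by
    intro z hz
    rw [Nat.primeFactors_one, Finset.card_empty, zero_add, pow_one, mul_neg_one]
    exact (hZm z hz).2
  have hPasν : ∀ u ∈ Zp, u ∈ S.eig (S.ε * (-1) ^ (1 : ℕ).primeFactors.card) := by
    intro u hu
    rw [Nat.primeFactors_one, Finset.card_empty, pow_zero, mul_one]
    exact (hZp u hu).2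
  have hA : ∀ q ∈ (1 : ℕ).primeFactors, ∀ z ∈ Zm ⊔ Zp, z ∈ S.A q := by
    intro q hq
    simp at hq
  -- (I) at `n = 1`: `p^{i + M₀} x ∈ Zp ⊔ Zm ⟹ p^{i + M₀} x = 0 ⟹ M ≤ i + M₀` (independence of `ℤx`)
  have hI : ∀ i : ℕ, ((S.p : ℤ) ^ i) • S.c 1 ∈ Zm ⊔ Zp → (S.M - S.M₀) + 0 ≤ i := by
    intro i hi
    rw [S.c_one, smul_smul, ← pow_add, sup_comm] at hi
    have hmem : ((S.p : ℤ) ^ (i + S.M₀)) • S.x ∈ AddSubgroup.zmultiples S.x ⊓ (Zp ⊔ Zm) :=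
      ⟨AddSubgroup.zsmul_mem _ (AddSubgroup.mem_zmultiples S.x) _, hi⟩
    rw [hind, AddSubgroup.mem_bot, S.expo_x_and_zsmul_x_eq_zero_iff.2.2, ← Nat.cast_pow, ← Nat.cast_pow,
      Int.natCast_dvd_natCast, Nat.pow_dvd_pow_iff_le_right hp.one_lt] at hmem
    omega
  have key := card_mul_card_mul_pow_le_memW S (Zp ⊔ Zm) P hCTV Δ hΔpure hCeb₂ hWSel hiso hroom _ Zm Zp
    le_sup_right le_sup_left hd1 hd2 1 (kolSupp_one _) 0 hActν hPasν hA hI le_rfl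
  rw [pow_zero, mul_one, mul_comm] at key
  exact key

end Summit.BirchSwinnertonDyer.BirchSwinnertonDyer.Theorems.KolyvaginAdaptiveData


-- single-conjunct summit: `Summit.BirchSwinnertonDyer.BirchSwinnertonDyer.…` repeats the name by design
set_option linter.dupNamespace false
set_option autoImplicit false

noncomputable section

open scoped Classical
open WeierstrassCurve NumberField IsDedekindDomain Field
open Literature.NumberTheory.GaloisRepresentations
open Literature.NumberTheory.EllipticCurves Literature.NumberTheory.EllipticCurves.KolyvaginDescent

namespace Summit.BirchSwinnertonDyer.BirchSwinnertonDyer.Theorems.KolyvaginPairDataTwo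

open KolyvaginAdaptiveData

variable {N : ℕ} (W : WeierstrassCurve ℚ) {K : Type} [Field K] [NumberField K] (c : K ≃ₐ[ℚ] K) (M : ℕ)

-- the product-of-subtypes carrier `PairV` makes instance unification slow (`addOrderOf`, `•`)
set_option maxHeartbeats 800000 in
/-- **McCallum's inequality `#A · #S₂ ≤ 2^{2M₀}` for split descent data on any carrier mapped
injectively and compatibly into the pair, the Cassels–Tate value formula `hCTV` being asked only for
test classes `t` with `(p^k) • t = 0`** (`k` the displayed kill exponent of `A` and `S₂`). See the
module docstring. [cite: McCallumLMS1991, §5 Thm. 5.4 (proof, p. 307), Cor. 5.6] [cite: Kolyvagin1989Izv, §3] -/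
theorem card_mul_card_le_two_pow_two_mul_of_injective_of_kill
    (hC : Literature.NumberTheory.Automorphic.chebotarev_artinRep)
    [NeZero N] [W.IsElliptic] (hK : IsImaginaryQuadratic K) (hρ : W.HasSurjectiveModNGaloisRep 2)
    (hΔ : W.Δ < 0) (hΔK : ¬ IsSquare (W.baseChange K).Δ) (hc : c ≠ 1)
    {c₀ : absoluteGaloisGroup ℚ} (hc₀ : IsComplexConjugation (Rat.castHom ℝ) c₀)
    {z : absoluteGaloisGroup K}
    (hzfix : ∀ P : geomTorsion (W.baseChange K) ((2 : ℕ) : ℤ), z • P = P → P = 0)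
    (hcomm : ∀ π ∈ torsionFixing (W.baseChange K) ((2 : ℕ) : ℤ),
      ∀ P : geomTorsion (W.baseChange K) ((2 ^ (M + 1) : ℕ) : ℤ), π • z • P = z • π • P)
    {S : ℕ → Prop}
    (hS : ∀ ℓ, IsKolyvaginPrime N W K 2 ℓ → FrobEqFrobInfty W K (2 ^ (M + 1)) ℓ → S ℓ)
    {P₀ : (W.baseChange K).toAffine.Point} (hP₀ : IsHeegnerPoint N W K P₀)
    {ε : ℤ} (hε : ε = 1 ∨ ε = -1)
    -- the carrier, mapped injectively into the pair
    {V' : Type*} [AddCommGroup V'] (f : V' →+ PairV W c M ε) (hf : Function.Injective f)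
    {Pl : Type*} (Sd : SplitDataM V' Pl) (hp : Sd.p = 2)
    (heig : ∀ (e : ℤ) (v : V'), v ∈ Sd.eig e ↔ f v ∈ pairEig W c M ε e)
    (Δ' : AddSubgroup V') (hΔ' : ∀ v, v ∈ Δ' ↔ f v ∈ pairDelta W c M ε)
    (hA : ∀ ℓ, Sd.Kol ℓ → ∀ v, v ∈ Sd.A ℓ ↔ f v ∈ pairA (N := N) W c M ε ℓ)
    (hKol : ∀ ℓ, Sd.Kol ℓ ↔ IsKolyvaginPrime N W K 2 ℓ ∧ FrobEqFrobInfty W K (2 ^ (M + 1)) ℓ ∧ S ℓ)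
    (hSdε : Sd.ε = ε)
    -- the kill exponent of the lift groups (`2^k` kills `A` and `S₂` below), exposed to `hCTV`
    (k : ℕ)
    {R : Type*} [AddCommGroup R] (P : Sd.Sel →+ Sd.Sel →+ R)
    (hCTV : ∀ ℓ m : ℕ, Sd.Kol ℓ → KolSupp Sd.Kol (ℓ * m) → ¬ ℓ ∣ m →
      ∀ (j N' a b : ℕ) (t : V') (ht : t ∈ Sd.Sel) (hz : ((Sd.p : ℤ) ^ j) • Sd.c (ℓ * m) ∈ Sd.Sel),
      ((Sd.p : ℤ) ^ k) • t = 0 → ((Sd.p : ℤ) ^ N') • t = 0 → t ∈ Sd.eig (Sd.ε * (-1) ^ (ℓ * m).primeFactors.card) →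
      (∀ q ∈ m.primeFactors, t ∈ Sd.A q) → Sd.M - Sd.M₀ ≤ j → N' + Sd.M₀ ≤ Sd.M → N' ≤ j →
      a + b + 1 = N' →
      ((Sd.p : ℤ) ^ (a + (j - N'))) • Sd.c m ∉ Sd.A ℓ → ((Sd.p : ℤ) ^ b) • t ∉ Sd.A ℓ →
      P ⟨_, hz⟩ ⟨t, ht⟩ ≠ 0)
    -- the abstract `ℚ`-side data
    {S₁ : Type} [AddCommGroup S₁] [Finite S₁] {S₂ : Type} [AddCommGroup S₂] [Finite S₂]
    {A : Type} [AddCommGroup A]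
    (π : S₁ →+ A) (hπ : Function.Surjective π) (x : S₁)
    (hker : π.ker = AddSubgroup.zmultiples x) (hx : addOrderOf x = AddMonoid.exponent S₁)
    (BA : A →+ A →+ AddCircle (1 : ℚ)) (hAalt : ∀ a, BA a a = 0)
    (hAnd : ∀ a, (∀ b, BA a b = 0) → a = 0)
    (BB : S₂ →+ S₂ →+ AddCircle (1 : ℚ)) (hBalt : ∀ v, BB v v = 0)
    (hBnd : ∀ v, (∀ w, BB v w = 0) → v = 0) (hpA : ∀ a : A, 2 ^ k • a = 0)
    (hpB : ∀ v : S₂, 2 ^ k • v = 0)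
    (J₁ : S₁ →+ V') (J₂ : S₂ →+ V') (hJ₁ : Function.Injective J₁) (hJ₂ : Function.Injective J₂)
    (hJ₁ε : ∀ u, (f (J₁ u)).2 = 0) (hJ₂ε : ∀ v, (f (J₂ v)).1 = 0)
    -- compatibility
    (hxSd : Sd.x = J₁ x)
    (hSel : ∀ (u : S₁) (v : S₂), J₁ u + J₂ v ∈ Sd.Sel)
    (hP : ∀ (u u' : S₁) (v v' : S₂), BA (π u) (π u') = 0 → BB v v' = 0 →
      P ⟨J₁ u + J₂ v, hSel u v⟩ ⟨J₁ u' + J₂ v', hSel u' v'⟩ = 0)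
    (hkM : k + Sd.M₀ ≤ Sd.M) :
    Nat.card A * Nat.card S₂ ≤ 2 ^ (2 * Sd.M₀) := by
  -- ### the two injections into `H¹(K, E[2^M])`
  set r₁ : S₁ →+ galH1Torsion (W.baseChange K) ((2 ^ M : ℕ) : ℤ) :=
    (eigK W c M ε).subtype.comp ((AddMonoidHom.fst _ _).comp (f.comp J₁)) with hr₁def
  set r₂ : S₂ →+ galH1Torsion (W.baseChange K) ((2 ^ M : ℕ) : ℤ) :=
    (eigK W c M (-ε)).subtype.comp ((AddMonoidHom.snd _ _).comp (f.comp J₂)) with hr₂def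
  have hr₁a : ∀ u, r₁ u = ((f (J₁ u)).1 : galH1Torsion (W.baseChange K) ((2 ^ M : ℕ) : ℤ)) :=
    fun _ ↦ rfl
  have hr₂a : ∀ v, r₂ v = ((f (J₂ v)).2 : galH1Torsion (W.baseChange K) ((2 ^ M : ℕ) : ℤ)) :=
    fun _ ↦ rfl
  have hfJ₁ : ∀ u : S₁, (f (J₁ u)).1 = 0 → u = 0 := by
    intro u hu
    apply hJ₁
    apply hf
    rw [map_zero, map_zero]
    exact Prod.ext hu (hJ₁ε u)
  have hfJ₂ : ∀ v : S₂, (f (J₂ v)).2 = 0 → v = 0 := by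
    intro v hv
    apply hJ₂
    apply hf
    rw [map_zero, map_zero]
    exact Prod.ext (hJ₂ε v) hv
  have hr₁ : Function.Injective r₁ := by
    refine (injective_iff_map_eq_zero r₁).mpr fun u hu ↦ hfJ₁ u ?_
    rw [hr₁a] at hu
    exact Subtype.ext (by rw [hu]; rfl)
  have hr₂ : Function.Injective r₂ := by
    refine (injective_iff_map_eq_zero r₂).mpr fun v hv ↦ hfJ₂ v ?_
    rw [hr₂a] at hv
    exact Subtype.ext (by rw [hv]; rfl)
  -- ### the lift groups (T5′)
  obtain ⟨Zp, Zm, hdisj, hisoA, hcardA, hisoB, hcardB, hINDa⟩ :=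
    KolyvaginLiftGroupsTwo.exists_liftGroups Nat.prime_two π hπ x hker hx BA hAalt hAnd BB hBalt hBnd
      hpA hpB r₁ r₂ hr₁ hr₂
  set Zp' : AddSubgroup V' := Zp.map J₁ with hZp'
  set Zm' : AddSubgroup V' := Zm.map J₂ with hZm'
  haveI : Finite Zp' :=
    Finite.of_surjective (fun a : Zp ↦ (⟨J₁ a, AddSubgroup.mem_map_of_mem J₁ a.2⟩ : Zp'))
      fun y ↦ by
        obtain ⟨a, ha, hay⟩ := AddSubgroup.mem_map.mp y.2
        exact ⟨⟨a, ha⟩, Subtype.ext hay⟩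
  haveI : Finite Zm' :=
    Finite.of_surjective (fun b : Zm ↦ (⟨J₂ b, AddSubgroup.mem_map_of_mem J₂ b.2⟩ : Zm'))
      fun y ↦ by
        obtain ⟨b, hb, hby⟩ := AddSubgroup.mem_map.mp y.2
        exact ⟨⟨b, hb⟩, Subtype.ext hby⟩
  have hdec : ∀ w ∈ Zp' ⊔ Zm', ∃ a ∈ Zp, ∃ b ∈ Zm, w = J₁ a + J₂ b := by
    intro w hw
    obtain ⟨y, hy, y', hy', hsum⟩ := AddSubgroup.mem_sup.mp hw
    obtain ⟨a, ha, rfl⟩ := AddSubgroup.mem_map.mp hy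
    obtain ⟨b, hb, rfl⟩ := AddSubgroup.mem_map.mp hy'
    exact ⟨a, ha, b, hb, hsum.symm⟩
  -- `2^k` kills the lift groups
  have hkZp : ∀ a ∈ Zp, 2 ^ k • a = 0 := by
    intro a ha
    have h1 : 2 ^ k • a ∈ π.ker := by rw [AddMonoidHom.mem_ker, map_nsmul, hpA]
    rw [hker] at h1
    have h2 := hdisj.le_bot (AddSubgroup.mem_inf.mpr ⟨h1, AddSubgroup.nsmul_mem _ ha _⟩)
    rwa [AddSubgroup.mem_bot] at h2
  -- ### the telescope's hypotheses
  have hZpε : ∀ w ∈ Zp', w ∈ Sd.Sel ∧ w ∈ Sd.eig Sd.ε := by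
    intro w hw
    obtain ⟨a, -, rfl⟩ := AddSubgroup.mem_map.mp hw
    refine ⟨by simpa using hSel a 0, ?_⟩
    rw [heig, hSdε, pairEig_self, AddSubgroup.mem_prod]
    exact ⟨AddSubgroup.mem_top _, by rw [hJ₁ε]; exact zero_mem _⟩
  have hZmε : ∀ w ∈ Zm', w ∈ Sd.Sel ∧ w ∈ Sd.eig (-Sd.ε) := by
    intro w hw
    obtain ⟨b, -, rfl⟩ := AddSubgroup.mem_map.mp hw
    refine ⟨by simpa using hSel 0 b, ?_⟩
    rw [heig, hSdε, pairEig_neg W c M hε, AddSubgroup.mem_prod]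
    exact ⟨by rw [hJ₂ε]; exact zero_mem _, AddSubgroup.mem_top _⟩
  have hiso : ∀ u, ∀ hu : u ∈ Zp' ⊔ Zm', ∀ v, ∀ hv : v ∈ Zp' ⊔ Zm',
      ∀ (hu' : u ∈ Sd.Sel) (hv' : v ∈ Sd.Sel), P ⟨u, hu'⟩ ⟨v, hv'⟩ = 0 := by
    intro u hu v hv hu' hv'
    obtain ⟨a, ha, b, hb, rfl⟩ := hdec u hu
    obtain ⟨a', ha', b', hb', rfl⟩ := hdec v hv
    exact hP a a' b b' (hisoA a ha a' ha') (hisoB b hb b' hb')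
  have hind : AddSubgroup.zmultiples Sd.x ⊓ (Zp' ⊔ Zm') = ⊥ := by
    rw [hxSd, AddSubgroup.eq_bot_iff_forall]
    intro w hw
    obtain ⟨hw1, hw2⟩ := AddSubgroup.mem_inf.mp hw
    obtain ⟨n, hn⟩ := AddSubgroup.mem_zmultiples_iff.mp hw1
    obtain ⟨a, ha, b, hb, hwab⟩ := hdec w hw2
    -- `J₁ (n•x - a) = J₂ b`; apply `f` and read components
    have hJ : J₁ (n • x - a) = J₂ b := by
      rw [map_sub, map_zsmul, hn, hwab]; abel
    have hb0 : b = 0 := by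
      apply hfJ₂
      rw [← hJ]
      exact hJ₁ε _
    have ha0 : n • x - a = 0 := by
      apply hJ₁
      rw [hJ, hb0, map_zero, map_zero]
    have hax : a ∈ AddSubgroup.zmultiples x := by
      rw [sub_eq_zero] at ha0
      rw [← ha0]
      exact AddSubgroup.zsmul_mem _ (AddSubgroup.mem_zmultiples x) n
    have ha00 : a = 0 := by
      have h := hdisj.le_bot (AddSubgroup.mem_inf.mpr ⟨hax, ha⟩)
      rwa [AddSubgroup.mem_bot] at h
    rw [hwab, ha00, hb0, map_zero, map_zero, add_zero]
  have hIND : (Zp' ⊔ Δ') ⊓ Zm' = ⊥ := by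
    rw [AddSubgroup.eq_bot_iff_forall]
    intro w hw
    obtain ⟨hw1, hw2⟩ := AddSubgroup.mem_inf.mp hw
    obtain ⟨b, hb, rfl⟩ := AddSubgroup.mem_map.mp hw2
    obtain ⟨y, hy, d, hd, hsum⟩ := AddSubgroup.mem_sup.mp hw1
    obtain ⟨a, ha, rfl⟩ := AddSubgroup.mem_map.mp hy
    rw [hΔ', mem_pairDelta_iff] at hd
    -- components of `f (J₂ b) = f (J₁ a) + f d`
    have hfe : f (J₂ b) = f (J₁ a) + f d := by rw [← map_add, hsum]
    have h1 : (f d).1 = -(f (J₁ a)).1 := by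
      have h := congrArg Prod.fst hfe
      rw [hJ₂ε, Prod.fst_add] at h
      exact (neg_eq_of_add_eq_zero_right h.symm).symm
    have h2 : (f d).2 = (f (J₂ b)).2 := by
      have h := congrArg Prod.snd hfe
      rw [Prod.snd_add, hJ₁ε, zero_add] at h
      exact h.symm
    rw [h1, h2, AddSubgroup.coe_neg, neg_add_eq_zero] at hd
    have hrr : r₁ a = r₂ b := by rw [hr₁a, hr₂a]; exact hd
    rw [(hINDa a ha b hb hrr).2, map_zero]
  have hroom : ∀ w ∈ Zp' ⊔ Zm', Sd.expo w + Sd.M₀ ≤ Sd.M := by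
    intro w hw
    obtain ⟨a, ha, b, hb, rfl⟩ := hdec w hw
    have hv0 : ((Sd.p : ℤ) ^ k) • (J₁ a + J₂ b) = 0 := by
      rw [hp, ← Nat.cast_pow, natCast_zsmul, smul_add, ← map_nsmul, ← map_nsmul, hkZp a ha, hpB,
        map_zero, map_zero, add_zero]
    have hle : Sd.expo (J₁ a + J₂ b) ≤ k := (Sd.expo_le_iff _ k).mpr hv0
    omega
  have hΔpure : ∀ d ∈ Δ', ∀ e : ℤ, (e = 1 ∨ e = -1) → d ∈ Sd.eig e → d = 0 := by
    intro d hd e _ hde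
    apply hf
    rw [map_zero]
    exact eq_zero_of_mem_pairDelta_of_mem_pairEig W c M hε (f d) ((hΔ' d).mp hd) e ((heig e d).mp hde)
  -- ### the binder: depth `M+1` on the pair, reflected along `f`
  obtain ⟨m₀, hm⟩ := exists_regular_torsion_of_Δ_neg W hK hΔ hc hc₀ (M := M + 1) (Nat.le_add_left 1 M)
  have hA' : ∀ ℓ, (IsKolyvaginPrime N W K 2 ℓ ∧ FrobEqFrobInfty W K (2 ^ (M + 1)) ℓ ∧ S ℓ) →
      ∀ v, v ∈ Sd.A ℓ ↔ f v ∈ pairA (N := N) W c M ε ℓ := fun ℓ hℓ ↦ hA ℓ ((hKol ℓ).mpr hℓ)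
  have hCeb : ∀ (T : Finset V') (g₁ g₂ : V') (ν : ℤ) (I : ℕ), (ν = 1 ∨ ν = -1) → g₁ ∈ Sd.eig ν →
      g₂ ∈ Sd.eig (-ν) → (∀ t ∈ T, ∃ e : ℤ, (e = 1 ∨ e = -1) ∧ t ∈ Sd.eig e) →
      (g₁ ≠ 0 → ((Sd.p : ℤ) ^ (Sd.expo g₁ - 1)) • g₁ ∉ Δ' ⊔ AddSubgroup.closure (T : Set V')) →
      (1 ≤ I → ∀ d ∈ Δ', ∀ u ∈ AddSubgroup.closure (T : Set V'), u ∈ Sd.eig (-ν) →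
        ∀ v ∈ AddSubgroup.closure (T : Set V'), v ∈ Sd.eig ν → (Sd.p : ℤ) • v = 0 →
        ((Sd.p : ℤ) ^ (I - 1)) • g₂ ≠ d + u + v) →
      ∀ b : ℕ, ∃ ℓ, b < ℓ ∧ Sd.Kol ℓ ∧
        (∀ t ∈ AddSubgroup.closure (T : Set V'), t ∈ Sd.A ℓ) ∧
        (∀ j < Sd.expo g₁, ((Sd.p : ℤ) ^ j) • g₁ ∉ Sd.A ℓ) ∧
        (∀ i < I, ((Sd.p : ℤ) ^ i) • g₂ ∉ Sd.A ℓ) := by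
    intro T g₁ g₂ ν I hν hg₁ hg₂ hT H1 H2 b
    have he₁ : addOrderOf g₁ = 2 ^ Sd.expo g₁ := by
      have h := Sd.addOrderOf_eq_pow_expo g₁
      rwa [hp] at h
    rw [hp] at H1 H2
    obtain ⟨ℓ, hbℓ, hgood, hpool, hfull, hge⟩ :=
      binder_of_injective f hf (pairEig W c M ε) (pairDelta W c M ε) (pairA (N := N) W c M ε)
        (fun ℓ ↦ IsKolyvaginPrime N W K 2 ℓ ∧ FrobEqFrobInfty W K (2 ^ (M + 1)) ℓ ∧ S ℓ)
        Sd.eig Δ' Sd.A heig hΔ' hA'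
        (fun T' g₁' g₂' ν' I' e₁ hν' hg₁' hg₂' hT'' he₁' H1' H2' b₀ ↦
          cebotarev_binder_pair_succ W c M hC hK hρ hΔK hc hc₀ hzfix hcomm hS m₀ hm hP₀ hε T' g₁' g₂'
            ν' I' e₁ hν' hg₁' hg₂' hT'' he₁' H1' H2' b₀)
        T g₁ g₂ ν I (Sd.expo g₁) hν hg₁ hg₂ hT he₁ H1 H2 b
    refine ⟨ℓ, hbℓ, (hKol ℓ).mpr hgood, hpool, ?_, ?_⟩
    · intro j hj
      rw [hp]
      exact hfull j hj
    · intro i hi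
      rw [hp]
      exact hge i hi
  -- ### the kill clause: `p^k` kills the isotropic subgroup `Zp' ⊔ Zm'`
  have hkill : ∀ w ∈ Zp' ⊔ Zm', ((Sd.p : ℤ) ^ k) • w = 0 := by
    intro w hw
    obtain ⟨a, ha, b, hb, rfl⟩ := hdec w hw
    rw [hp, ← Nat.cast_pow, natCast_zsmul, smul_add, ← map_nsmul, ← map_nsmul, hkZp a ha, hpB,
      map_zero, map_zero, add_zero]
  have hCTV' : ∀ ℓ m : ℕ, Sd.Kol ℓ → KolSupp Sd.Kol (ℓ * m) → ¬ ℓ ∣ m →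
      ∀ (j N' a b : ℕ) (t : V') (ht : t ∈ Sd.Sel) (hz : ((Sd.p : ℤ) ^ j) • Sd.c (ℓ * m) ∈ Sd.Sel),
      ((Sd.p : ℤ) ^ j) • Sd.c (ℓ * m) ∈ Zp' ⊔ Zm' → t ∈ Zp' ⊔ Zm' →
      ((Sd.p : ℤ) ^ N') • t = 0 → t ∈ Sd.eig (Sd.ε * (-1) ^ (ℓ * m).primeFactors.card) →
      (∀ q ∈ m.primeFactors, t ∈ Sd.A q) → Sd.M - Sd.M₀ ≤ j → N' + Sd.M₀ ≤ Sd.M → N' ≤ j →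
      a + b + 1 = N' →
      ((Sd.p : ℤ) ^ (a + (j - N'))) • Sd.c m ∉ Sd.A ℓ → ((Sd.p : ℤ) ^ b) • t ∉ Sd.A ℓ →
      P ⟨_, hz⟩ ⟨t, ht⟩ ≠ 0 :=
    fun ℓ m hℓ hs hnd j N' a b t ht hz _ htW ↦ hCTV ℓ m hℓ hs hnd j N' a b t ht hz (hkill t htW)
  -- ### the telescope, squared
  have h := card_mul_card_le_of_casselsTate_adaptive_memW Sd Zp' Zm' P hCTV' Δ' hΔpure hCeb hZpε hZmε
    hiso hind hIND hroom
  rw [hp, hZp', hZm', AddSubgroup.card_map_of_injective hJ₁, AddSubgroup.card_map_of_injective hJ₂] at h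
  calc Nat.card A * Nat.card S₂ = (Nat.card Zp * Nat.card Zm) ^ 2 := by rw [mul_pow, hcardA, hcardB]
    _ ≤ (2 ^ Sd.M₀) ^ 2 := Nat.pow_le_pow_left h 2
    _ = 2 ^ (2 * Sd.M₀) := by rw [← pow_mul, mul_comm]

end Summit.BirchSwinnertonDyer.BirchSwinnertonDyer.Theorems.KolyvaginPairDataTwo

end


noncomputable section

open scoped Classical

namespace Literature.NumberTheory.EllipticCurves

namespace KolyvaginDescent

/-! ## The two-member data carrier -/

/-- **Kolyvagin's descent modulo `p^M` for a pair, the DATA** (any prime `p`, `2` allowed): the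
record `PairHypothesesM` WITHOUT its analytic axioms `duality₁`, `duality₂`, `cebotarev`. Two abelian
groups `V₁`, `V₂` killed by `p^M` (at `p = 2`: `H¹(ℚ, E^{ε}[2^M])`, `H¹(ℚ, E^{-ε}[2^M])`, `E^{ε}` the
member carrying the Heegner class); Selmer groups `Selᵢ ≤ Vᵢ` cut out by local conditions `Locᵢ v`;
Kolyvagin primes `Kol ℓ` with place `pl ℓ`, divisibility `Dv` and strict conditions `Aᵢ ℓ`;
`x ∈ Sel₁` of order `p^M`, `M₀` with `c₁ 1 = p^{M₀} x` (McCallum Lemma 5.1); classes `c₁ n` (even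
depth) / `c₂ n` (odd depth) with McCallum's Lemma 4.3 on each member (`c_mem_loc₁/₂`) and Prop. 4.4
ACROSS the members (`c_mem_loc_iff₁₂/₂₁`). [cite: Kolyvagin1989Izv, §3 (the pair (E, E^D) over ℚ at l = 2)]
[cite: McCallumLMS1991, §§3–5 (Lemma 4.3, Prop. 4.4, Lemma 5.1)] [cite: GrossLMS1991, Prop. 5.4 (2)] -/
structure PairDataM (V₁ V₂ : Type*) [AddCommGroup V₁] [AddCommGroup V₂] (Pl : Type*) where
  /-- The prime `p` (any prime). -/
  p : ℕ
  /-- `p` is prime. -/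
  hp : p.Prime
  /-- The level `M`. -/
  M : ℕ
  /-- `V₁` is killed by `p^M`. -/
  torsion₁ : ∀ v : V₁, ((p : ℤ) ^ M) • v = 0
  /-- `V₂` is killed by `p^M`. -/
  torsion₂ : ∀ v : V₂, ((p : ℤ) ^ M) • v = 0
  /-- The Selmer group of the first member. -/
  Sel₁ : AddSubgroup V₁
  /-- The Selmer group of the second member. -/
  Sel₂ : AddSubgroup V₂
  /-- Local conditions of the first member. -/
  Loc₁ : Pl → AddSubgroup V₁
  /-- Local conditions of the second member. -/
  Loc₂ : Pl → AddSubgroup V₂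
  /-- `Sel₁` is cut out by its local conditions. -/
  mem_sel_iff₁ : ∀ s, s ∈ Sel₁ ↔ ∀ v, s ∈ Loc₁ v
  /-- `Sel₂` is cut out by its local conditions. -/
  mem_sel_iff₂ : ∀ s, s ∈ Sel₂ ↔ ∀ v, s ∈ Loc₂ v
  /-- Kolyvagin primes. -/
  Kol : ℕ → Prop
  /-- Kolyvagin primes are primes. -/
  prime_of_kol : ∀ ℓ, Kol ℓ → ℓ.Prime
  /-- The place of a Kolyvagin prime. -/
  pl : ℕ → Pl
  /-- "`v` divides `n`". -/
  Dv : Pl → ℕ → Prop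
  /-- `pl ℓ` is the unique place dividing `ℓ`. -/
  dv_iff : ∀ ℓ, Kol ℓ → ∀ v, Dv v ℓ ↔ v = pl ℓ
  /-- A place dividing `ℓ ℓ'` divides `ℓ` or `ℓ'`. -/
  dv_mul : ∀ ℓ ℓ', Kol ℓ → Kol ℓ' → ∀ v, Dv v (ℓ * ℓ') → Dv v ℓ ∨ Dv v ℓ'
  /-- Strict local conditions of the first member at Kolyvagin primes. -/
  A₁ : ℕ → AddSubgroup V₁
  /-- Strict local conditions of the second member at Kolyvagin primes. -/
  A₂ : ℕ → AddSubgroup V₂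
  /-- `x = δ_M x₀` on the first member. -/
  x : V₁
  /-- `x ∈ Sel₁`. -/
  x_mem : x ∈ Sel₁
  /-- `x` has order `p^M`. -/
  x_ord : ((p : ℤ) ^ (M - 1)) • x ≠ 0
  /-- `M₀`. -/
  M₀ : ℕ
  /-- Kolyvagin's classes of even depth (first member). -/
  c₁ : ℕ → V₁
  /-- Kolyvagin's classes of odd depth (second member). -/
  c₂ : ℕ → V₂
  /-- `c_M(1) = p^{M₀} x`. -/
  c_one : c₁ 1 = ((p : ℤ) ^ M₀) • x
  /-- **Lemma 4.3**, even depth. -/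
  c_mem_loc₁ : ∀ n, KolSupp Kol n → Even n.primeFactors.card → ∀ v, ¬ Dv v n → c₁ n ∈ Loc₁ v
  /-- **Lemma 4.3**, odd depth. -/
  c_mem_loc₂ : ∀ n, KolSupp Kol n → Odd n.primeFactors.card → ∀ v, ¬ Dv v n → c₂ n ∈ Loc₂ v
  /-- **Prop. 4.4** from even depth `m` to odd depth `ℓm`. -/
  c_mem_loc_iff₁₂ : ∀ ℓ m, Kol ℓ → KolSupp Kol (ℓ * m) → Even m.primeFactors.card → ∀ a : ℕ,
    (((p : ℤ) ^ a) • c₂ (ℓ * m) ∈ Loc₂ (pl ℓ)) ↔ ((p : ℤ) ^ a) • c₁ m ∈ A₁ ℓ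
  /-- **Prop. 4.4** from odd depth `m` to even depth `ℓm`. -/
  c_mem_loc_iff₂₁ : ∀ ℓ m, Kol ℓ → KolSupp Kol (ℓ * m) → Odd m.primeFactors.card → ∀ a : ℕ,
    (((p : ℤ) ^ a) • c₁ (ℓ * m) ∈ Loc₁ (pl ℓ)) ↔ ((p : ℤ) ^ a) • c₂ m ∈ A₂ ℓ

namespace PairDataM

variable {V₁ V₂ : Type*} [AddCommGroup V₁] [AddCommGroup V₂] {Pl : Type*}
variable (S : PairDataM V₁ V₂ Pl)

/-! ### The sign-indexed parts of the product -/

/-- The parts of the product indexed by a sign: `V₁ × 0` at `1`, `0 × V₂` at `−1`, `⊥` at every other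
integer (at `2`: the two members `H¹(ℚ, E^{±ε}[2^M])` of Kolyvagin's pair).
[cite: Kolyvagin1989Izv, §3 (the pair (E, E^D) over ℚ)] -/
def eig (V₁ V₂ : Type*) [AddCommGroup V₁] [AddCommGroup V₂] (ν : ℤ) : AddSubgroup (V₁ × V₂) :=
  if ν = 1 then (⊤ : AddSubgroup V₁).prod ⊥
  else if ν = -1 then (⊥ : AddSubgroup V₁).prod ⊤ else ⊥

/-- `v ∈ eig 1 ↔ v.2 = 0`. [cite: Kolyvagin1989Izv, §3 (the pair (E, E^D) over ℚ)] -/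
theorem mem_eig_one {v : V₁ × V₂} : v ∈ eig V₁ V₂ 1 ↔ v.2 = 0 := by
  simp [eig, AddSubgroup.mem_prod]

/-- `v ∈ eig (−1) ↔ v.1 = 0`. [cite: Kolyvagin1989Izv, §3 (the pair (E, E^D) over ℚ)] -/
theorem mem_eig_neg_one {v : V₁ × V₂} : v ∈ eig V₁ V₂ (-1) ↔ v.1 = 0 := by
  simp [eig, AddSubgroup.mem_prod]

/-- `eig ν = ⊥` at an integer `ν ≠ ±1`. [cite: Kolyvagin1989Izv, §3 (the pair (E, E^D) over ℚ)] -/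
theorem eig_of_ne {ν : ℤ} (h₁ : ν ≠ 1) (h₂ : ν ≠ -1) : eig V₁ V₂ ν = ⊥ := by
  rw [eig, if_neg h₁, if_neg h₂]

/-! ### Parity bookkeeping -/

/-- The class at even depth is `(c₁ n, 0)`. [cite: GrossLMS1991, Prop. 5.4 (2)] -/
theorem pairClass_of_even {n : ℕ} (h : Even n.primeFactors.card) :
    pairClass S.c₁ S.c₂ n = (S.c₁ n, 0) := by
  simp [pairClass, h]

/-- The class at odd depth is `(0, c₂ n)`. [cite: GrossLMS1991, Prop. 5.4 (2)] -/
theorem pairClass_of_odd {n : ℕ} (h : Odd n.primeFactors.card) :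
    pairClass S.c₁ S.c₂ n = (0, S.c₂ n) := by
  have h' : ¬ Even n.primeFactors.card := Nat.not_even_iff_odd.mpr h
  simp [pairClass, h']

/-- For `ℓm` a square-free product of Kolyvagin primes with `ℓ` one of them: `m` is such a product
and `r(ℓm) = r(m) + 1`. [cite: GrossLMS1991, §3 (3.1)–(3.2)] -/
theorem kolSupp_of_mul {ℓ m : ℕ} (hℓ : S.Kol ℓ) (hn : KolSupp S.Kol (ℓ * m)) :
    KolSupp S.Kol m ∧ m.primeFactors.card + 1 = (ℓ * m).primeFactors.card := by
  have hℓp := S.prime_of_kol ℓ hℓ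
  have hmem : ℓ ∈ (ℓ * m).primeFactors :=
    Nat.mem_primeFactors.mpr ⟨hℓp, dvd_mul_right ℓ m, hn.ne_zero⟩
  obtain ⟨hsupp, -, -, -, -, -, -, hcard⟩ := kolSupp_div hn hmem
  rw [Nat.mul_div_cancel_left m hℓp.pos] at hsupp hcard
  exact ⟨hsupp, hcard⟩

/-! ### The split data on the product -/

/-- **The pair data ARE split descent data on `V = V₁ × V₂`** (data carrier `SplitDataM`, no analytic
axiom): parts `eig` (`V₁ × 0`, `0 × V₂`, `⊥` elsewhere), `Sel = Sel₁ × Sel₂`, `Loc v = Loc₁ v × Loc₂ v`,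
`A ℓ = A₁ ℓ × A₂ ℓ`, `ε = 1`, `x = (x, 0)`, `c = pairClass c₁ c₂`; the tags of `x` and of `c(n)`
(Gross Prop. 5.4 (2): sign `(−1)^{r(n)}`) hold BY CONSTRUCTION, Lemma 4.3 and Prop. 4.4 are the
members' fields read through the parity of the depth. At `p = 2`: Kolyvagin's frame (Izv. 1989, §3)
for the pair `(E, E^D)` over `ℚ`, as consumed by the adaptive telescope over `SplitDataM`.
[cite: Kolyvagin1989Izv, §3] [cite: McCallumLMS1991, §§4–5 (Lemma 4.3, Prop. 4.4, Lemma 5.1)] [cite: GrossLMS1991, Prop. 5.4 (2)] -/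
def toSplitData : SplitDataM (V₁ × V₂) Pl where
  p := S.p
  hp := S.hp
  M := S.M
  torsion v := Prod.ext (S.torsion₁ v.1) (S.torsion₂ v.2)
  eig := eig V₁ V₂
  eig_disjoint v h₁ h₂ := Prod.ext (mem_eig_neg_one.mp h₂) (mem_eig_one.mp h₁)
  Sel := S.Sel₁.prod S.Sel₂
  sel_split s hs := by
    rw [AddSubgroup.mem_prod] at hs
    refine ⟨(s.1, 0), (0, s.2), ⟨?_, mem_eig_one.mpr rfl⟩, ⟨?_, mem_eig_neg_one.mpr rfl⟩,
      Prod.ext (by simp) (by simp)⟩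
    · exact AddSubgroup.mem_prod.mpr ⟨hs.1, S.Sel₂.zero_mem⟩
    · exact AddSubgroup.mem_prod.mpr ⟨S.Sel₁.zero_mem, hs.2⟩
  Loc v := (S.Loc₁ v).prod (S.Loc₂ v)
  mem_sel_iff s := by
    simp only [AddSubgroup.mem_prod, S.mem_sel_iff₁, S.mem_sel_iff₂]
    exact ⟨fun h v ↦ ⟨h.1 v, h.2 v⟩, fun h ↦ ⟨fun v ↦ (h v).1, fun v ↦ (h v).2⟩⟩
  Kol := S.Kol
  prime_of_kol := S.prime_of_kol
  pl := S.pl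
  Dv := S.Dv
  dv_iff := S.dv_iff
  dv_mul := S.dv_mul
  A ℓ := (S.A₁ ℓ).prod (S.A₂ ℓ)
  x := (S.x, 0)
  x_mem := AddSubgroup.mem_prod.mpr ⟨S.x_mem, S.Sel₂.zero_mem⟩
  x_ord h := S.x_ord (by simpa using congrArg Prod.fst h)
  M₀ := S.M₀
  ε := 1
  hε := Or.inl rfl
  x_eig := mem_eig_one.mpr rfl
  c := pairClass S.c₁ S.c₂
  c_one := by
    have h0 : Even (1 : ℕ).primeFactors.card := by simp
    rw [S.pairClass_of_even h0, S.c_one]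
    exact Prod.ext (by simp) (by simp)
  c_eig n _ := by
    rcases Nat.even_or_odd n.primeFactors.card with h | h
    · rw [S.pairClass_of_even h, h.neg_one_pow, one_mul]
      exact mem_eig_one.mpr rfl
    · rw [S.pairClass_of_odd h, h.neg_one_pow, mul_neg_one]
      exact mem_eig_neg_one.mpr rfl
  c_mem_loc n hn v hv := by
    rcases Nat.even_or_odd n.primeFactors.card with h | h
    · rw [S.pairClass_of_even h]
      exact AddSubgroup.mem_prod.mpr ⟨S.c_mem_loc₁ n hn h v hv, (S.Loc₂ v).zero_mem⟩
    · rw [S.pairClass_of_odd h]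
      exact AddSubgroup.mem_prod.mpr ⟨(S.Loc₁ v).zero_mem, S.c_mem_loc₂ n hn h v hv⟩
  c_mem_loc_iff ℓ m hℓ hn a := by
    obtain ⟨-, hcard⟩ := S.kolSupp_of_mul hℓ hn
    rcases Nat.even_or_odd m.primeFactors.card with h | h
    · have h' : Odd (ℓ * m).primeFactors.card := by rw [← hcard]; exact h.add_one
      rw [S.pairClass_of_even h, S.pairClass_of_odd h']
      simp only [Prod.smul_mk, smul_zero, AddSubgroup.mem_prod, AddSubgroup.zero_mem, true_and,
        and_true]
      exact S.c_mem_loc_iff₁₂ ℓ m hℓ hn h a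
    · have h' : Even (ℓ * m).primeFactors.card := by rw [← hcard]; exact h.add_one
      rw [S.pairClass_of_odd h, S.pairClass_of_even h']
      simp only [Prod.smul_mk, smul_zero, AddSubgroup.mem_prod, AddSubgroup.zero_mem, true_and,
        and_true]
      exact S.c_mem_loc_iff₂₁ ℓ m hℓ hn h a

/-! ### Unfolding lemmas -/

/-- `toSplitData.p = p`. [cite: McCallumLMS1991, §5] -/
@[simp] theorem toSplitData_p : S.toSplitData.p = S.p := rfl

/-- `toSplitData.M = M`. [cite: McCallumLMS1991, §5] -/
@[simp] theorem toSplitData_M : S.toSplitData.M = S.M := rfl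

/-- `toSplitData.M₀ = M₀`. [cite: McCallumLMS1991, Lemma 5.1] -/
@[simp] theorem toSplitData_M₀ : S.toSplitData.M₀ = S.M₀ := rfl

/-- `toSplitData.ε = 1` (the Heegner class sits on the first member). [cite: Kolyvagin1989Izv, §3] -/
@[simp] theorem toSplitData_ε : S.toSplitData.ε = 1 := rfl

/-- `toSplitData.x = (x, 0)`. [cite: McCallumLMS1991, Lemma 5.1] -/
@[simp] theorem toSplitData_x : S.toSplitData.x = (S.x, 0) := rfl

/-- `toSplitData.Kol = Kol`. [cite: McCallumLMS1991, §3] -/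
theorem toSplitData_kol_iff (ℓ : ℕ) : S.toSplitData.Kol ℓ ↔ S.Kol ℓ := Iff.rfl

/-- `toSplitData.pl = pl`. [cite: McCallumLMS1991, §3] -/
@[simp] theorem toSplitData_pl (ℓ : ℕ) : S.toSplitData.pl ℓ = S.pl ℓ := rfl

/-- `toSplitData.c = pairClass c₁ c₂`. [cite: GrossLMS1991, Prop. 5.4 (2)] -/
theorem toSplitData_c (n : ℕ) : S.toSplitData.c n = pairClass S.c₁ S.c₂ n := rfl

/-- The class of the product at even depth: `(c₁ n, 0)`. [cite: GrossLMS1991, Prop. 5.4 (2)] -/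
theorem toSplitData_c_of_even {n : ℕ} (h : Even n.primeFactors.card) :
    S.toSplitData.c n = (S.c₁ n, 0) :=
  S.pairClass_of_even h

/-- The class of the product at odd depth: `(0, c₂ n)`. [cite: GrossLMS1991, Prop. 5.4 (2)] -/
theorem toSplitData_c_of_odd {n : ℕ} (h : Odd n.primeFactors.card) :
    S.toSplitData.c n = (0, S.c₂ n) :=
  S.pairClass_of_odd h

/-- `v ∈ toSplitData.Sel ↔ v.1 ∈ Sel₁ ∧ v.2 ∈ Sel₂`. [cite: McCallumLMS1991, §4 (Selmer group)] -/
theorem mem_toSplitData_sel_iff (v : V₁ × V₂) : v ∈ S.toSplitData.Sel ↔ v.1 ∈ S.Sel₁ ∧ v.2 ∈ S.Sel₂ :=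
  AddSubgroup.mem_prod

/-- `v ∈ toSplitData.A ℓ ↔ v.1 ∈ A₁ ℓ ∧ v.2 ∈ A₂ ℓ`. [cite: McCallumLMS1991, §5 (19)] -/
theorem mem_toSplitData_A_iff (ℓ : ℕ) (v : V₁ × V₂) :
    v ∈ S.toSplitData.A ℓ ↔ v.1 ∈ S.A₁ ℓ ∧ v.2 ∈ S.A₂ ℓ :=
  AddSubgroup.mem_prod

/-- `v ∈ toSplitData.Loc w ↔ v.1 ∈ Loc₁ w ∧ v.2 ∈ Loc₂ w`. [cite: McCallumLMS1991, §4 (Selmer group)] -/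
theorem mem_toSplitData_loc_iff (w : Pl) (v : V₁ × V₂) :
    v ∈ S.toSplitData.Loc w ↔ v.1 ∈ S.Loc₁ w ∧ v.2 ∈ S.Loc₂ w :=
  AddSubgroup.mem_prod

/-- `toSplitData.eig = eig` (the parts of the product). [cite: Kolyvagin1989Izv, §3] -/
theorem toSplitData_eig (ν : ℤ) : S.toSplitData.eig ν = eig V₁ V₂ ν := rfl

/-- `v ∈ toSplitData.eig 1 ↔ v.2 = 0`. [cite: Kolyvagin1989Izv, §3] -/
theorem mem_toSplitData_eig_one_iff (v : V₁ × V₂) : v ∈ S.toSplitData.eig 1 ↔ v.2 = 0 :=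
  mem_eig_one

/-- `v ∈ toSplitData.eig (−1) ↔ v.1 = 0`. [cite: Kolyvagin1989Izv, §3] -/
theorem mem_toSplitData_eig_neg_one_iff (v : V₁ × V₂) : v ∈ S.toSplitData.eig (-1) ↔ v.1 = 0 :=
  mem_eig_neg_one

end PairDataM

/-! ## The forgetful map from the full pair hypotheses -/

namespace PairHypothesesM

variable {V₁ V₂ : Type*} [AddCommGroup V₁] [AddCommGroup V₂] {Pl : Type*} (S : PairHypothesesM V₁ V₂ Pl)

/-- The data underlying Kolyvagin's pair descent hypotheses (forget `duality₁`, `duality₂`,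
`cebotarev`). [cite: McCallumLMS1991, §§3–5] -/
def toData : PairDataM V₁ V₂ Pl where
  p := S.p
  hp := S.hp
  M := S.M
  torsion₁ := S.torsion₁
  torsion₂ := S.torsion₂
  Sel₁ := S.Sel₁
  Sel₂ := S.Sel₂
  Loc₁ := S.Loc₁
  Loc₂ := S.Loc₂
  mem_sel_iff₁ := S.mem_sel_iff₁
  mem_sel_iff₂ := S.mem_sel_iff₂
  Kol := S.Kol
  prime_of_kol := S.prime_of_kol
  pl := S.pl
  Dv := S.Dv
  dv_iff := S.dv_iff
  dv_mul := S.dv_mul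
  A₁ := S.A₁
  A₂ := S.A₂
  x := S.x
  x_mem := S.x_mem
  x_ord := S.x_ord
  M₀ := S.M₀
  c₁ := S.c₁
  c₂ := S.c₂
  c_one := S.c_one
  c_mem_loc₁ := S.c_mem_loc₁
  c_mem_loc₂ := S.c_mem_loc₂
  c_mem_loc_iff₁₂ := S.c_mem_loc_iff₁₂
  c_mem_loc_iff₂₁ := S.c_mem_loc_iff₂₁

end PairHypothesesM

end KolyvaginDescent

end Literature.NumberTheory.EllipticCurves

end


-- single-conjunct summit: `Summit.BirchSwinnertonDyer.BirchSwinnertonDyer.…` repeats the name by design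
set_option linter.dupNamespace false
set_option autoImplicit false

noncomputable section

open scoped Classical
open WeierstrassCurve NumberField Field
open Literature.NumberTheory.GaloisRepresentations
open Literature.NumberTheory.EllipticCurves Literature.NumberTheory.EllipticCurves.KolyvaginDescent
open Summit.BirchSwinnertonDyer.BirchSwinnertonDyer.Theorems.GenusExact.EigenClassesFinite
open Summit.BirchSwinnertonDyer.BirchSwinnertonDyer.Theorems.GenusExact.VisiblePairAtTwo (twin lvl)

namespace Summit.BirchSwinnertonDyer.BirchSwinnertonDyer.Theorems.KolyvaginPairDataTwo

variable (W : WeierstrassCurve ℚ) (K : Type) [Field K] [NumberField K]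
  (h2 : Module.finrank ℚ K = 2) {θ : K} (hθ : θ ∉ Set.range (algebraMap ℚ K))
  (hd : θ ^ 2 = algebraMap ℚ K ((NumberField.discr K : ℤ) : ℚ)) (M : ℕ)

/-! ## `heig`: the parts of `D.toSplitData` are the preimages of the eigen-pair's parts -/

/-- **`heig` for the `ℚ`-pair carrier.** For `D : PairDataM (H¹(ℚ, E[2^M])) (H¹(ℚ, E^{(d_K)}[2^M])) Pl`, any
additive `f` into `PairV W σ₀ M 1` with `(f v).1 = res v.1`, `(f v).2 = ψ (res v.2)` (as produced by
`exists_pairOfRat`) and `E(K)[2^M] = 0`: `v ∈ D.toSplitData.eig e ↔ f v ∈ pairEig W σ₀ M 1 e` for EVERY `e : ℤ`.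
[cite: Kolyvagin1989Izv, §3] [cite: GrossLMS1991, §5 (5.1)] -/
theorem mem_toSplitData_eig_iff_mem_pairEig
    (hL : ∀ P : (W.baseChange K).toAffine.Point, ((2 ^ M : ℕ) : ℤ) • P = 0 → P = 0)
    {Pl : Type*} (D : PairDataM (galH1Torsion W (lvl M)) (galH1Torsion (twin W K) (lvl M)) Pl)
    (f : galH1Torsion W (lvl M) × galH1Torsion (twin W K) (lvl M) →+ PairV W (sigmaQ K h2 hθ hd) M 1)
    (hf : Function.Injective f)
    (hf₁ : ∀ v, ((f v).1 : galH1Torsion (W.baseChange K) ((2 ^ M : ℕ) : ℤ)) = resTorsion W K (lvl M) v.1)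
    (hf₂ : ∀ v, ((f v).2 : galH1Torsion (W.baseChange K) ((2 ^ M : ℕ) : ℤ)) =
      hPsiKT W K hθ hd (lvl M) (resTorsion (twin W K) K (lvl M) v.2))
    (e : ℤ) (v : galH1Torsion W (lvl M) × galH1Torsion (twin W K) (lvl M)) :
    v ∈ D.toSplitData.eig e ↔ f v ∈ pairEig W (sigmaQ K h2 hθ hd) M 1 e := by
  by_cases he1 : e = 1
  · subst he1
    rw [PairDataM.mem_toSplitData_eig_one_iff, pairEig_self, AddSubgroup.mem_prod]
    simp only [AddSubgroup.mem_top, true_and, AddSubgroup.mem_bot]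
    constructor
    · intro hv
      apply Subtype.ext
      rw [hf₂, hv, map_zero, map_zero]
      rfl
    · intro hv
      have h := hf₂ v
      rw [hv] at h
      have h0 : hPsiKT W K hθ hd (lvl M) (resTorsion (twin W K) K (lvl M) v.2) = 0 := h.symm
      rw [map_eq_zero_iff _ (hPsiKT W K hθ hd (lvl M)).injective] at h0
      exact resTorsion_twist_injective_of_noTorsion W K h2 hθ hd (lvl M) hL (by rw [h0, map_zero])
  by_cases he2 : e = -1
  · subst he2
    rw [PairDataM.mem_toSplitData_eig_neg_one_iff, pairEig_neg W (sigmaQ K h2 hθ hd) M (Or.inl rfl),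
      AddSubgroup.mem_prod]
    simp only [AddSubgroup.mem_top, and_true, AddSubgroup.mem_bot]
    constructor
    · intro hv
      apply Subtype.ext
      rw [hf₁, hv, map_zero]
      rfl
    · intro hv
      have h := hf₁ v
      rw [hv] at h
      exact resTorsion_injective_of_noTorsion W K h2 hθ hd (lvl M) hL (by rw [← h, map_zero]; rfl)
  · -- junk sign: both sides are `⊥`
    rw [PairDataM.toSplitData_eig, PairDataM.eig_of_ne he1 he2, AddSubgroup.mem_bot, pairEig, if_neg he1,
      if_neg (by rwa [show -(1 : ℤ) = -1 from rfl]), AddSubgroup.mem_bot]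
    constructor
    · rintro rfl
      exact map_zero f
    · intro h
      exact hf (by rw [h, map_zero])

/-! ## The bookkeeping compatibilities -/

/-- **`hKol`**: if `D.Kol` IS the telescope's predicate, `D.toSplitData.Kol ℓ ↔ …` by `Iff.rfl`.
[cite: McCallumLMS1991, §3] -/
theorem toSplitData_kol_iff_of_kol {V₁ V₂ : Type*} [AddCommGroup V₁] [AddCommGroup V₂] {Pl : Type*}
    (D : PairDataM V₁ V₂ Pl) (Q : ℕ → Prop) (hQ : ∀ ℓ, D.Kol ℓ ↔ Q ℓ) (ℓ : ℕ) :
    D.toSplitData.Kol ℓ ↔ Q ℓ :=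
  (D.toSplitData_kol_iff ℓ).trans (hQ ℓ)

/-- **`hJ₁ε`**: `(f (u, 0)).2 = 0`. [cite: Kolyvagin1989Izv, §3] -/
theorem snd_pairOfRat_inl_eq_zero
    (f : galH1Torsion W (lvl M) × galH1Torsion (twin W K) (lvl M) →+ PairV W (sigmaQ K h2 hθ hd) M 1)
    (hf₂ : ∀ v, ((f v).2 : galH1Torsion (W.baseChange K) ((2 ^ M : ℕ) : ℤ)) =
      hPsiKT W K hθ hd (lvl M) (resTorsion (twin W K) K (lvl M) v.2))
    (u : galH1Torsion W (lvl M)) : (f (u, 0)).2 = 0 := by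
  apply Subtype.ext
  rw [hf₂, map_zero, map_zero]
  rfl

/-- **`hJ₂ε`**: `(f (0, w)).1 = 0`. [cite: Kolyvagin1989Izv, §3] -/
theorem fst_pairOfRat_inr_eq_zero
    (f : galH1Torsion W (lvl M) × galH1Torsion (twin W K) (lvl M) →+ PairV W (sigmaQ K h2 hθ hd) M 1)
    (hf₁ : ∀ v, ((f v).1 : galH1Torsion (W.baseChange K) ((2 ^ M : ℕ) : ℤ)) = resTorsion W K (lvl M) v.1)
    (w : galH1Torsion (twin W K) (lvl M)) : (f (0, w)).1 = 0 := by
  apply Subtype.ext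
  rw [hf₁, map_zero]
  rfl

/-- **`hSel`**: `(u, 0) + (0, w) ∈ D.toSplitData.Sel` for `u ∈ D.Sel₁`, `w ∈ D.Sel₂`. [cite: McCallumLMS1991, §4] -/
theorem inl_add_inr_mem_toSplitData_sel {V₁ V₂ : Type*} [AddCommGroup V₁] [AddCommGroup V₂] {Pl : Type*}
    (D : PairDataM V₁ V₂ Pl) (u : D.Sel₁) (w : D.Sel₂) :
    ((u : V₁), (0 : V₂)) + ((0 : V₁), (w : V₂)) ∈ D.toSplitData.Sel := by
  rw [PairDataM.mem_toSplitData_sel_iff, Prod.fst_add, Prod.snd_add, add_zero, zero_add]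
  exact ⟨u.2, w.2⟩

/-- **`hxSd`**: `D.toSplitData.x = (x, 0)` is the image of `⟨D.x, D.x_mem⟩ : D.Sel₁` under `J₁ = (·, 0)`.
[cite: McCallumLMS1991, Lemma 5.1] -/
theorem toSplitData_x_eq_inl {V₁ V₂ : Type*} [AddCommGroup V₁] [AddCommGroup V₂] {Pl : Type*}
    (D : PairDataM V₁ V₂ Pl) :
    D.toSplitData.x = (((⟨D.x, D.x_mem⟩ : D.Sel₁) : V₁), (0 : V₂)) :=
  D.toSplitData_x

/-- The two injections as additive maps: `J₁ = (ι₁, 0)`, `J₂ = (0, ι₂)` are injective and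
`J₁ u + J₂ w = (u, w)`. [cite: Kolyvagin1989Izv, §3] -/
theorem inl_inr_injective {V₁ V₂ : Type*} [AddCommGroup V₁] [AddCommGroup V₂] (S₁ : AddSubgroup V₁)
    (S₂ : AddSubgroup V₂) :
    Function.Injective ((AddMonoidHom.inl V₁ V₂).comp S₁.subtype) ∧
      Function.Injective ((AddMonoidHom.inr V₁ V₂).comp S₂.subtype) ∧
      ∀ (u : S₁) (w : S₂), (AddMonoidHom.inl V₁ V₂).comp S₁.subtype u +
        (AddMonoidHom.inr V₁ V₂).comp S₂.subtype w = ((u : V₁), (w : V₂)) := by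
  refine ⟨fun a b h ↦ ?_, fun a b h ↦ ?_, fun u w ↦ ?_⟩
  · exact Subtype.ext (by simpa using congrArg Prod.fst h)
  · exact Subtype.ext (by simpa using congrArg Prod.snd h)
  · simp

end Summit.BirchSwinnertonDyer.BirchSwinnertonDyer.Theorems.KolyvaginPairDataTwo

end


-- single-conjunct summit: `Summit.BirchSwinnertonDyer.BirchSwinnertonDyer.…` repeats the name by design
set_option linter.dupNamespace false
set_option autoImplicit false

noncomputable section

open scoped Classical
open scoped AddSubgroup
open WeierstrassCurve NumberField IsDedekindDomain Field
open Literature.NumberTheory.GaloisRepresentations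
open Literature.NumberTheory.EllipticCurves Literature.NumberTheory.EllipticCurves.KolyvaginDescent
open Summit.BirchSwinnertonDyer.BirchSwinnertonDyer.Theorems.GenusExact.EigenClassesFinite
open Summit.BirchSwinnertonDyer.BirchSwinnertonDyer.Theorems.GenusExact.VisiblePairAtTwo (twin lvl loc₁ loc₂ a₁ a₂ pl Dv kolPrime)

namespace Summit.BirchSwinnertonDyer.BirchSwinnertonDyer.Theorems.KolyvaginPairDataTwo

variable {N : ℕ} (W : WeierstrassCurve ℚ) {K : Type} [Field K] [NumberField K]

set_option maxHeartbeats 1600000 in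
/-- **McCallum's inequality `#Ш(E/ℚ)[2^L] · #Sel_{2^{2L}}(E^{(d_K)}/ℚ) ≤ 2^{2M₀}` from two-member descent data on
the `ℚ`-pair carrier and the two Cassels–Tate member formulas** (path (β) of the T2 assembly; see the module
docstring for the dictionary of the displayed inputs). [cite: McCallumLMS1991, §5 Thm. 5.4 (proof, p. 307), Cor. 5.6]
[cite: Kolyvagin1989Izv, §3] -/
theorem card_mul_card_le_two_pow_two_mul_of_pairData
    (hC : Literature.NumberTheory.Automorphic.chebotarev_artinRep)
    [NeZero N] [W.IsElliptic] (hK : IsImaginaryQuadratic K) (hρ : W.HasSurjectiveModNGaloisRep 2)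
    (hΔ : W.Δ < 0) (hΔK : ¬ IsSquare (W.baseChange K).Δ)
    (h2 : Module.finrank ℚ K = 2) {θ : K} (hθ : θ ∉ Set.range (algebraMap ℚ K))
    (hd : θ ^ 2 = algebraMap ℚ K ((NumberField.discr K : ℤ) : ℚ)) {L : ℕ}
    {c₀ : absoluteGaloisGroup ℚ} (hc₀ : IsComplexConjugation (Rat.castHom ℝ) c₀)
    {z : absoluteGaloisGroup K}
    (hzfix : ∀ P : geomTorsion (W.baseChange K) ((2 : ℕ) : ℤ), z • P = P → P = 0)
    (hcomm : ∀ π ∈ torsionFixing (W.baseChange K) ((2 : ℕ) : ℤ),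
      ∀ P : geomTorsion (W.baseChange K) ((2 ^ (L + L + 1) : ℕ) : ℤ), π • z • P = z • π • P)
    {S : ℕ → Prop}
    (hS : ∀ ℓ, IsKolyvaginPrime N W K 2 ℓ → FrobEqFrobInfty W K (2 ^ (L + L + 1)) ℓ → S ℓ)
    {P₀ : (W.baseChange K).toAffine.Point} (hP₀ : IsHeegnerPoint N W K P₀)
    (hnoTors : ∀ P : (W.baseChange K).toAffine.Point, ((2 ^ (L + L) : ℕ) : ℤ) • P = 0 → P = 0)
    -- the two-member descent data on the `ℚ`-pair carrier
    (D : PairDataM (galH1Torsion W (lvl (L + L))) (galH1Torsion (twin W K) (lvl (L + L)))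
      (HeightOneSpectrum (𝓞 ℚ) ⊕ InfinitePlace ℚ))
    (hDp : D.p = 2) (hDM : D.M = L + L)
    (hDSel₁ : D.Sel₁ = selmerGroup W (lvl (L + L)))
    (hDSel₂ : D.Sel₂ = selmerGroup (twin W K) (lvl (L + L)))
    (hDA₁ : D.A₁ = a₁ W (L + L)) (hDA₂ : D.A₂ = a₂ W K (L + L))
    (hDKol : ∀ ℓ, D.Kol ℓ ↔ IsKolyvaginPrime N W K 2 ℓ ∧ FrobEqFrobInfty W K (2 ^ (L + L + 1)) ℓ ∧ S ℓ)
    (hM₀L : D.M₀ ≤ L)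
    -- the map into the eigen-pair and the local compatibility at Kolyvagin primes
    (f : galH1Torsion W (lvl (L + L)) × galH1Torsion (twin W K) (lvl (L + L)) →+
      PairV W (sigmaQ K h2 hθ hd) (L + L) 1)
    (hf : Function.Injective f)
    (hf₁ : ∀ v, ((f v).1 : galH1Torsion (W.baseChange K) ((2 ^ (L + L) : ℕ) : ℤ)) =
      resTorsion W K (lvl (L + L)) v.1)
    (hf₂ : ∀ v, ((f v).2 : galH1Torsion (W.baseChange K) ((2 ^ (L + L) : ℕ) : ℤ)) =
      hPsiKT W K hθ hd (lvl (L + L)) (resTorsion (twin W K) K (lvl (L + L)) v.2))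
    (hA : ∀ ℓ, D.Kol ℓ → ∀ v, v ∈ D.toSplitData.A ℓ ↔ f v ∈ pairA (N := N) W (sigmaQ K h2 hθ hd) (L + L) 1 ℓ)
    -- the Cassels–Tate member formulas (shape of `hV₁/hV₂_canonical_of_kol`, `Kol := D.Kol`, `M₀ := D.M₀`)
    (B₁ : (W.sha)[(2 ^ L : ℕ)] →+ (W.sha)[(2 ^ L : ℕ)] →+ AddCircle (1 : ℚ))
    (ι₁ : selmerGroup W (lvl (L + L)) →+ (W.sha)[(2 ^ L : ℕ)])
    (hV₁ : ∀ ℓ m' : ℕ, D.Kol ℓ → KolSupp D.Kol (ℓ * m') → ¬ ℓ ∣ m' → Odd m'.primeFactors.card →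
      ∀ (j N' a b : ℕ) (t : galH1Torsion W (lvl (L + L))) (ht : t ∈ selmerGroup W (lvl (L + L)))
        (hz : ((2 : ℤ) ^ j) • D.c₁ (ℓ * m') ∈ selmerGroup W (lvl (L + L))),
      ((2 : ℤ) ^ N') • t = 0 → ((2 : ℤ) ^ L) • t = 0 →
      (∀ q ∈ m'.primeFactors, t ∈ a₁ W (L + L) q) → L + L - D.M₀ ≤ j →
      N' + D.M₀ ≤ L + L → N' ≤ j → a + b + 1 = N' →
      ((2 : ℤ) ^ (a + (j - N'))) • D.c₂ m' ∉ a₂ W K (L + L) ℓ →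
      ((2 : ℤ) ^ b) • t ∉ a₁ W (L + L) ℓ →
      (B₁.comp ι₁).compl₂ ι₁ ⟨_, hz⟩ ⟨t, ht⟩ ≠ 0)
    (B₂ : ((twin W K).sha)[(2 ^ L : ℕ)] →+ ((twin W K).sha)[(2 ^ L : ℕ)] →+ AddCircle (1 : ℚ))
    (ι₂ : selmerGroup (twin W K) (lvl (L + L)) →+ ((twin W K).sha)[(2 ^ L : ℕ)])
    (hV₂ : ∀ ℓ m' : ℕ, D.Kol ℓ → KolSupp D.Kol (ℓ * m') → ¬ ℓ ∣ m' → Even m'.primeFactors.card →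
      ∀ (j N' a b : ℕ) (t : galH1Torsion (twin W K) (lvl (L + L)))
        (ht : t ∈ selmerGroup (twin W K) (lvl (L + L)))
        (hz : ((2 : ℤ) ^ j) • D.c₂ (ℓ * m') ∈ selmerGroup (twin W K) (lvl (L + L))),
      ((2 : ℤ) ^ N') • t = 0 → ((2 : ℤ) ^ L) • t = 0 →
      (∀ q ∈ m'.primeFactors, t ∈ a₂ W K (L + L) q) → L + L - D.M₀ ≤ j →
      N' + D.M₀ ≤ L + L → N' ≤ j → a + b + 1 = N' →
      ((2 : ℤ) ^ (a + (j - N'))) • D.c₁ m' ∉ a₁ W (L + L) ℓ →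
      ((2 : ℤ) ^ b) • t ∉ a₂ W K (L + L) ℓ →
      (B₂.comp ι₂).compl₂ ι₂ ⟨_, hz⟩ ⟨t, ht⟩ ≠ 0)
    -- the abstract `ℚ`-side (rank one / rank zero, finiteness, Cassels–Tate nondegeneracy)
    [Finite (selmerGroup W (lvl (L + L)))] [Finite (selmerGroup (twin W K) (lvl (L + L)))]
    (hι₁ : Function.Surjective ι₁) (x₁ : selmerGroup W (lvl (L + L)))
    (hx₁ : (x₁ : galH1Torsion W (lvl (L + L))) = D.x)
    (hker : ι₁.ker = AddSubgroup.zmultiples x₁)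
    (hxord : addOrderOf x₁ = AddMonoid.exponent (selmerGroup W (lvl (L + L))))
    (hB₁alt : ∀ a, B₁ a a = 0) (hB₁nd : ∀ a, (∀ b, B₁ a b = 0) → a = 0)
    (hB₂alt : ∀ v : selmerGroup (twin W K) (lvl (L + L)), B₂ (ι₂ v) (ι₂ v) = 0)
    (hB₂nd : ∀ v : selmerGroup (twin W K) (lvl (L + L)), (∀ w, B₂ (ι₂ v) (ι₂ w) = 0) → v = 0)
    (hkill₂ : ∀ v : selmerGroup (twin W K) (lvl (L + L)), 2 ^ L • v = 0) :
    Nat.card ((W.sha)[(2 ^ L : ℕ)]) * Nat.card (selmerGroup (twin W K) (lvl (L + L))) ≤ 2 ^ (2 * D.M₀) := by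
  -- ### abbreviations
  -- the injections `J₁ = (·, 0)`, `J₂ = (0, ·)` into the carrier
  set J₁ : (selmerGroup W (lvl (L + L))) →+ galH1Torsion W (lvl (L + L)) × galH1Torsion (twin W K) (lvl (L + L)) :=
    (AddMonoidHom.inl _ _).comp (selmerGroup W (lvl (L + L))).subtype with hJ₁def
  set J₂ : (selmerGroup (twin W K) (lvl (L + L))) →+ galH1Torsion W (lvl (L + L)) × galH1Torsion (twin W K) (lvl (L + L)) :=
    (AddMonoidHom.inr _ _).comp (selmerGroup (twin W K) (lvl (L + L))).subtype with hJ₂def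
  have hJ₁a : ∀ t : (selmerGroup W (lvl (L + L))), J₁ t = ((t : galH1Torsion W (lvl (L + L))), 0) := fun _ ↦ rfl
  have hJ₂a : ∀ t : (selmerGroup (twin W K) (lvl (L + L))), J₂ t = (0, (t : galH1Torsion (twin W K) (lvl (L + L)))) := fun _ ↦ rfl
  have hJ₁ : Function.Injective J₁ := by
    intro a b h
    have h1 := congrArg Prod.fst h
    rw [hJ₁a, hJ₁a] at h1
    exact Subtype.ext h1
  have hJ₂ : Function.Injective J₂ := by
    intro a b h
    have h1 := congrArg Prod.snd h
    rw [hJ₂a, hJ₂a] at h1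
    exact Subtype.ext h1
  have hJsum : ∀ (t₁ : (selmerGroup W (lvl (L + L)))) (t₂ : (selmerGroup (twin W K) (lvl (L + L)))), J₁ t₁ + J₂ t₂ =
      ((t₁ : galH1Torsion W (lvl (L + L))), (t₂ : galH1Torsion (twin W K) (lvl (L + L)))) := by
    intro t₁ t₂
    rw [hJ₁a, hJ₂a, Prod.mk_add_mk, add_zero, zero_add]
  -- ### unfoldings of `Sd := D.toSplitData`
  have hpZ : ((D.toSplitData.p : ℕ) : ℤ) = 2 := by rw [PairDataM.toSplitData_p, hDp, Nat.cast_ofNat]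
  have hp : D.toSplitData.p = 2 := by rw [PairDataM.toSplitData_p, hDp]
  have hM : D.toSplitData.M = L + L := by rw [PairDataM.toSplitData_M, hDM]
  have hSelmem : ∀ v, v ∈ D.toSplitData.Sel ↔ v.1 ∈ (selmerGroup W (lvl (L + L))) ∧ v.2 ∈ (selmerGroup (twin W K) (lvl (L + L))) := by
    intro v
    rw [PairDataM.mem_toSplitData_sel_iff, hDSel₁, hDSel₂]
  have hAmem : ∀ ℓ v, v ∈ D.toSplitData.A ℓ ↔ v.1 ∈ a₁ W (L + L) ℓ ∧ v.2 ∈ a₂ W K (L + L) ℓ := by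
    intro ℓ v
    rw [PairDataM.mem_toSplitData_A_iff, hDA₁, hDA₂]
  have hSel : ∀ (u : (selmerGroup W (lvl (L + L)))) (v : (selmerGroup (twin W K) (lvl (L + L)))), J₁ u + J₂ v ∈ D.toSplitData.Sel := by
    intro u v
    rw [hJsum, hSelmem]
    exact ⟨u.2, v.2⟩
  have hSelJ : ∀ s ∈ D.toSplitData.Sel, ∃ (t₁ : (selmerGroup W (lvl (L + L)))) (t₂ : (selmerGroup (twin W K) (lvl (L + L)))), s = J₁ t₁ + J₂ t₂ := by
    intro s hs
    obtain ⟨h1, h2'⟩ := (hSelmem s).mp hs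
    exact ⟨⟨s.1, h1⟩, ⟨s.2, h2'⟩, by rw [hJsum]⟩
  have hpure₁ : ∀ (t₁ : (selmerGroup W (lvl (L + L)))) (t₂ : (selmerGroup (twin W K) (lvl (L + L)))), J₁ t₁ + J₂ t₂ ∈ D.toSplitData.eig D.toSplitData.ε → J₂ t₂ = 0 := by
    intro t₁ t₂ h
    rw [PairDataM.toSplitData_ε, hJsum, PairDataM.mem_toSplitData_eig_one_iff] at h
    have h' : (t₂ : galH1Torsion (twin W K) (lvl (L + L))) = 0 := h
    rw [hJ₂a, h', Prod.mk_zero_zero]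
  have hpure₂ : ∀ (t₁ : (selmerGroup W (lvl (L + L)))) (t₂ : (selmerGroup (twin W K) (lvl (L + L)))), J₁ t₁ + J₂ t₂ ∈ D.toSplitData.eig (-D.toSplitData.ε) → J₁ t₁ = 0 := by
    intro t₁ t₂ h
    rw [PairDataM.toSplitData_ε, hJsum, PairDataM.mem_toSplitData_eig_neg_one_iff] at h
    have h' : (t₁ : galH1Torsion W (lvl (L + L))) = 0 := h
    rw [hJ₁a, h', Prod.mk_zero_zero]
  -- ### the transported pairing `P = B₁∘(ι₁×ι₁) ⊕ B₂∘(ι₂×ι₂)` on `Sd.Sel`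
  set Q₁ : (selmerGroup W (lvl (L + L))) →+ (selmerGroup W (lvl (L + L))) →+ AddCircle (1 : ℚ) := (B₁.comp ι₁).compl₂ ι₁ with hQ₁
  set Q₂ : (selmerGroup (twin W K) (lvl (L + L))) →+ (selmerGroup (twin W K) (lvl (L + L))) →+ AddCircle (1 : ℚ) := (B₂.comp ι₂).compl₂ ι₂ with hQ₂
  have hι₁inj : Function.Injective (selmerGroup W (lvl (L + L))).subtype := fun a b h ↦ Subtype.ext h
  have hι₂inj : Function.Injective (selmerGroup (twin W K) (lvl (L + L))).subtype := fun a b h ↦ Subtype.ext h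
  have hSelT : ∀ s ∈ D.toSplitData.Sel, s.1 ∈ (selmerGroup W (lvl (L + L))).subtype.range ∧ s.2 ∈ (selmerGroup (twin W K) (lvl (L + L))).subtype.range := by
    intro s hs
    rw [AddSubgroup.range_subtype, AddSubgroup.range_subtype]
    exact (hSelmem s).mp hs
  set P : D.toSplitData.Sel →+ D.toSplitData.Sel →+ AddCircle (1 : ℚ) :=
    transportPairing hι₁inj hι₂inj hSelT Q₁ Q₂ with hPdef
  have hPapply : ∀ (t₁ t₁' : (selmerGroup W (lvl (L + L)))) (t₂ t₂' : (selmerGroup (twin W K) (lvl (L + L)))) (h : J₁ t₁ + J₂ t₂ ∈ D.toSplitData.Sel)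
      (h' : J₁ t₁' + J₂ t₂' ∈ D.toSplitData.Sel),
      P ⟨J₁ t₁ + J₂ t₂, h⟩ ⟨J₁ t₁' + J₂ t₂', h'⟩ = Q₁ t₁ t₁' + Q₂ t₂ t₂' := by
    intro t₁ t₁' t₂ t₂' h h'
    have hm : (((t₁ : galH1Torsion W (lvl (L + L))), (t₂ : galH1Torsion (twin W K) (lvl (L + L)))) :
        galH1Torsion W (lvl (L + L)) × galH1Torsion (twin W K) (lvl (L + L))) ∈ D.toSplitData.Sel := by
      rw [← hJsum]; exact h
    have hm' : (((t₁' : galH1Torsion W (lvl (L + L))), (t₂' : galH1Torsion (twin W K) (lvl (L + L)))) :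
        galH1Torsion W (lvl (L + L)) × galH1Torsion (twin W K) (lvl (L + L))) ∈ D.toSplitData.Sel := by
      rw [← hJsum]; exact h'
    have e1 : (⟨J₁ t₁ + J₂ t₂, h⟩ : D.toSplitData.Sel) = ⟨((selmerGroup W (lvl (L + L))).subtype t₁, (selmerGroup (twin W K) (lvl (L + L))).subtype t₂), hm⟩ :=
      Subtype.ext (hJsum t₁ t₂)
    have e2 : (⟨J₁ t₁' + J₂ t₂', h'⟩ : D.toSplitData.Sel) = ⟨((selmerGroup W (lvl (L + L))).subtype t₁', (selmerGroup (twin W K) (lvl (L + L))).subtype t₂'), hm'⟩ :=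
      Subtype.ext (hJsum t₁' t₂')
    rw [e1, e2, hPdef, transportPairing_apply]
  -- ### the member formulas in `Sd`-currency
  have hV₁' : ∀ ℓ m : ℕ, D.toSplitData.Kol ℓ → KolSupp D.toSplitData.Kol (ℓ * m) → ¬ ℓ ∣ m →
      Even (ℓ * m).primeFactors.card →
      ∀ (j N' a b : ℕ) (t₁ z₁ : (selmerGroup W (lvl (L + L)))), J₁ t₁ ∈ D.toSplitData.Sel →
      ((D.toSplitData.p : ℤ) ^ j) • D.toSplitData.c (ℓ * m) = J₁ z₁ →
      J₁ z₁ ∈ D.toSplitData.Sel → ((D.toSplitData.p : ℤ) ^ L) • J₁ t₁ = 0 →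
      ((D.toSplitData.p : ℤ) ^ N') • J₁ t₁ = 0 →
      (∀ q ∈ m.primeFactors, J₁ t₁ ∈ D.toSplitData.A q) →
      D.toSplitData.M - D.toSplitData.M₀ ≤ j → N' + D.toSplitData.M₀ ≤ D.toSplitData.M → N' ≤ j →
      a + b + 1 = N' →
      ((D.toSplitData.p : ℤ) ^ (a + (j - N'))) • D.toSplitData.c m ∉ D.toSplitData.A ℓ →
      ((D.toSplitData.p : ℤ) ^ b) • J₁ t₁ ∉ D.toSplitData.A ℓ →
      Q₁ z₁ t₁ ≠ 0 := by
    intro ℓ m hℓ hsupp hndvd hev j N' a b t₁ z₁ _ hzeq _ hk hN hAq hj hNM hNj hab hcm hbt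
    have hℓK : D.Kol ℓ := hℓ
    have hsuppK : KolSupp D.Kol (ℓ * m) := hsupp
    obtain ⟨-, hcard⟩ := D.kolSupp_of_mul hℓK hsuppK
    have hodd : Odd m.primeFactors.card := by
      rcases Nat.even_or_odd m.primeFactors.card with h | h
      · exfalso
        rw [← hcard] at hev
        exact (Nat.not_even_iff_odd.mpr h.add_one) hev
      · exact h
    rw [hpZ] at hzeq hk hN hcm hbt
    rw [D.toSplitData_c_of_even hev, hJ₁a, Prod.smul_mk, zsmul_zero] at hzeq
    have hz1 : ((2 : ℤ) ^ j) • D.c₁ (ℓ * m) = (z₁ : galH1Torsion W (lvl (L + L))) :=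
      congrArg Prod.fst hzeq
    have hz : ((2 : ℤ) ^ j) • D.c₁ (ℓ * m) ∈ selmerGroup W (lvl (L + L)) := by rw [hz1]; exact z₁.2
    rw [hJ₁a, Prod.smul_mk, zsmul_zero, Prod.mk_eq_zero] at hk hN
    have hAq' : ∀ q ∈ m.primeFactors, (t₁ : galH1Torsion W (lvl (L + L))) ∈ a₁ W (L + L) q :=
      fun q hq ↦ ((hAmem q _).mp (hAq q hq)).1
    rw [hM] at hj hNM
    have hcm' : ((2 : ℤ) ^ (a + (j - N'))) • D.c₂ m ∉ a₂ W K (L + L) ℓ := by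
      intro hmem
      apply hcm
      rw [D.toSplitData_c_of_odd hodd, Prod.smul_mk, zsmul_zero, hAmem]
      exact ⟨zero_mem _, hmem⟩
    have hbt' : ((2 : ℤ) ^ b) • (t₁ : galH1Torsion W (lvl (L + L))) ∉ a₁ W (L + L) ℓ := by
      intro hmem
      apply hbt
      rw [hJ₁a, Prod.smul_mk, zsmul_zero, hAmem]
      exact ⟨hmem, zero_mem _⟩
    have key := hV₁ ℓ m hℓK hsuppK hndvd hodd j N' a b (t₁ : galH1Torsion W (lvl (L + L))) t₁.2 hz
      hN.1 hk.1 hAq' hj hNM hNj hab hcm' hbt'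
    have e1 : (⟨((2 : ℤ) ^ j) • D.c₁ (ℓ * m), hz⟩ : ↥(selmerGroup W (lvl (L + L)))) = z₁ :=
      Subtype.ext hz1
    rw [e1] at key
    exact key
  have hV₂' : ∀ ℓ m : ℕ, D.toSplitData.Kol ℓ → KolSupp D.toSplitData.Kol (ℓ * m) → ¬ ℓ ∣ m →
      Odd (ℓ * m).primeFactors.card →
      ∀ (j N' a b : ℕ) (t₂ z₂ : (selmerGroup (twin W K) (lvl (L + L)))), J₂ t₂ ∈ D.toSplitData.Sel →
      ((D.toSplitData.p : ℤ) ^ j) • D.toSplitData.c (ℓ * m) = J₂ z₂ →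
      J₂ z₂ ∈ D.toSplitData.Sel → ((D.toSplitData.p : ℤ) ^ L) • J₂ t₂ = 0 →
      ((D.toSplitData.p : ℤ) ^ N') • J₂ t₂ = 0 →
      (∀ q ∈ m.primeFactors, J₂ t₂ ∈ D.toSplitData.A q) →
      D.toSplitData.M - D.toSplitData.M₀ ≤ j → N' + D.toSplitData.M₀ ≤ D.toSplitData.M → N' ≤ j →
      a + b + 1 = N' →
      ((D.toSplitData.p : ℤ) ^ (a + (j - N'))) • D.toSplitData.c m ∉ D.toSplitData.A ℓ →
      ((D.toSplitData.p : ℤ) ^ b) • J₂ t₂ ∉ D.toSplitData.A ℓ →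
      Q₂ z₂ t₂ ≠ 0 := by
    intro ℓ m hℓ hsupp hndvd hoddn j N' a b t₂ z₂ _ hzeq _ hk hN hAq hj hNM hNj hab hcm hbt
    have hℓK : D.Kol ℓ := hℓ
    have hsuppK : KolSupp D.Kol (ℓ * m) := hsupp
    obtain ⟨-, hcard⟩ := D.kolSupp_of_mul hℓK hsuppK
    have hev : Even m.primeFactors.card := by
      rcases Nat.even_or_odd m.primeFactors.card with h | h
      · exact h
      · exfalso
        rw [← hcard] at hoddn
        exact (Nat.not_odd_iff_even.mpr h.add_one) hoddn
    rw [hpZ] at hzeq hk hN hcm hbt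
    rw [D.toSplitData_c_of_odd hoddn, hJ₂a, Prod.smul_mk, zsmul_zero] at hzeq
    have hz1 : ((2 : ℤ) ^ j) • D.c₂ (ℓ * m) = (z₂ : galH1Torsion (twin W K) (lvl (L + L))) :=
      congrArg Prod.snd hzeq
    have hz : ((2 : ℤ) ^ j) • D.c₂ (ℓ * m) ∈ selmerGroup (twin W K) (lvl (L + L)) := by
      rw [hz1]; exact z₂.2
    rw [hJ₂a, Prod.smul_mk, zsmul_zero, Prod.mk_eq_zero] at hk hN
    have hAq' : ∀ q ∈ m.primeFactors, (t₂ : galH1Torsion (twin W K) (lvl (L + L))) ∈ a₂ W K (L + L) q :=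
      fun q hq ↦ ((hAmem q _).mp (hAq q hq)).2
    rw [hM] at hj hNM
    have hcm' : ((2 : ℤ) ^ (a + (j - N'))) • D.c₁ m ∉ a₁ W (L + L) ℓ := by
      intro hmem
      apply hcm
      rw [D.toSplitData_c_of_even hev, Prod.smul_mk, zsmul_zero, hAmem]
      exact ⟨hmem, zero_mem _⟩
    have hbt' : ((2 : ℤ) ^ b) • (t₂ : galH1Torsion (twin W K) (lvl (L + L))) ∉ a₂ W K (L + L) ℓ := by
      intro hmem
      apply hbt
      rw [hJ₂a, Prod.smul_mk, zsmul_zero, hAmem]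
      exact ⟨zero_mem _, hmem⟩
    have key := hV₂ ℓ m hℓK hsuppK hndvd hev j N' a b (t₂ : galH1Torsion (twin W K) (lvl (L + L))) t₂.2
      hz hN.2 hk.2 hAq' hj hNM hNj hab hcm' hbt'
    have e1 : (⟨((2 : ℤ) ^ j) • D.c₂ (ℓ * m), hz⟩ : ↥(selmerGroup (twin W K) (lvl (L + L)))) = z₂ :=
      Subtype.ext hz1
    rw [e1] at key
    exact key
  have hCTV := hCTV_of_members_of_kill D.toSplitData J₁ J₂ hJ₁ hJ₂ hSelJ hpure₁ hpure₂ L P Q₁ Q₂ hPapply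
    hV₁' hV₂'
  -- ### the remaining compatibilities and the telescope
  have heig := mem_toSplitData_eig_iff_mem_pairEig W K h2 hθ hd (L + L) hnoTors D f hf hf₁ hf₂
  have hKol : ∀ ℓ, D.toSplitData.Kol ℓ ↔
      IsKolyvaginPrime N W K 2 ℓ ∧ FrobEqFrobInfty W K (2 ^ (L + L + 1)) ℓ ∧ S ℓ :=
    fun ℓ ↦ (D.toSplitData_kol_iff ℓ).trans (hDKol ℓ)
  have hA' : ∀ ℓ, D.toSplitData.Kol ℓ → ∀ v,
      v ∈ D.toSplitData.A ℓ ↔ f v ∈ pairA (N := N) W (sigmaQ K h2 hθ hd) (L + L) 1 ℓ :=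
    fun ℓ hℓ ↦ hA ℓ hℓ
  have hpA : ∀ a : (W.sha)[(2 ^ L : ℕ)], 2 ^ L • a = 0 := fun a ↦ AddSubgroup.torsionBy.nsmul a
  have hJ₁ε : ∀ u : (selmerGroup W (lvl (L + L))), (f (J₁ u)).2 = 0 := fun u ↦ snd_pairOfRat_inl_eq_zero W K h2 hθ hd (L + L) f hf₂ u
  have hJ₂ε : ∀ v : (selmerGroup (twin W K) (lvl (L + L))), (f (J₂ v)).1 = 0 := fun v ↦ fst_pairOfRat_inr_eq_zero W K h2 hθ hd (L + L) f hf₁ v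
  have hxSd : D.toSplitData.x = J₁ x₁ := by rw [PairDataM.toSplitData_x, hJ₁a, hx₁]
  have hP : ∀ (u u' : (selmerGroup W (lvl (L + L)))) (v v' : (selmerGroup (twin W K) (lvl (L + L)))), B₁ (ι₁ u) (ι₁ u') = 0 → Q₂ v v' = 0 →
      P ⟨J₁ u + J₂ v, hSel u v⟩ ⟨J₁ u' + J₂ v', hSel u' v'⟩ = 0 := by
    intro u u' v v' h₁ h₂
    rw [hPapply, h₂, add_zero]
    exact h₁
  have hkM : L + D.toSplitData.M₀ ≤ D.toSplitData.M := by
    rw [hM]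
    change L + D.M₀ ≤ L + L
    omega
  have hQ₂a : ∀ v w : (selmerGroup (twin W K) (lvl (L + L))), Q₂ v w = B₂ (ι₂ v) (ι₂ w) := fun _ _ ↦ rfl
  have hQ₁a : ∀ u u' : (selmerGroup W (lvl (L + L))), Q₁ u u' = B₁ (ι₁ u) (ι₁ u') := fun _ _ ↦ rfl
  have hBalt : ∀ v : (selmerGroup (twin W K) (lvl (L + L))), Q₂ v v = 0 := fun v ↦ by
    rw [hQ₂a]; exact hB₂alt v
  have hBnd : ∀ v : (selmerGroup (twin W K) (lvl (L + L))), (∀ w, Q₂ v w = 0) → v = 0 := fun v hv ↦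
    hB₂nd v fun w ↦ by rw [← hQ₂a]; exact hv w
  exact card_mul_card_le_two_pow_two_mul_of_injective_of_kill W (sigmaQ K h2 hθ hd) (L + L) hC hK hρ hΔ
    hΔK (sigmaQ_ne_one K h2 hθ hd) hc₀ hzfix hcomm hS hP₀ (Or.inl rfl) f hf D.toSplitData hp heig
    ((pairDelta W (sigmaQ K h2 hθ hd) (L + L) 1).comap f) (fun _ ↦ AddSubgroup.mem_comap) hA' hKol
    (PairDataM.toSplitData_ε D) L P hCTV ι₁ hι₁ x₁ hker hxord B₁ hB₁alt hB₁nd Q₂ hBalt hBnd hpA hkill₂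
    J₁ J₂ hJ₁ hJ₂ hJ₁ε hJ₂ε hxSd hSel hP hkM

end Summit.BirchSwinnertonDyer.BirchSwinnertonDyer.Theorems.KolyvaginPairDataTwo

end


set_option linter.dupNamespace false -- tree convention: `Summit.BirchSwinnertonDyer.BirchSwinnertonDyer.Theorems` (summit = sub-problem)
set_option autoImplicit false

noncomputable section

open scoped Classical
open scoped AddSubgroup

universe u

namespace Summit.BirchSwinnertonDyer.BirchSwinnertonDyer.Theorems.KolyvaginPairDataTwo

open WeierstrassCurve NumberField IsDedekindDomain Field Function Rat.HeightOneSpectrum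
open Literature.NumberTheory.EllipticCurves Literature.NumberTheory.GaloisRepresentations
open Literature.NumberTheory.GaloisCohomology
open Literature.NumberTheory.GaloisRepresentations.DiscreteGaloisModule (mu)
open Literature.NumberTheory.EllipticCurves.KolyvaginDescent
open Literature.GroupTheory.FiniteAbelian
open Summit.BirchSwinnertonDyer.BirchSwinnertonDyer.Theorems.GenusExact.VisiblePairAtTwo

section MemberOne

variable {W : WeierstrassCurve ℚ} [W.IsElliptic] [W.IsGloballyMinimal] {K : Type} [Field K] [NumberField K]
  {L : ℕ}

/-- **McCallum's Prop. 4.7 for the member `E` of the `ℚ`-pair at `2`, record-free**: the value formula `hV₁`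
for the pulled-back level-`2^L` Cassels–Tate pairing `P₁(z, t) = B₁(ι₁ z, ι₁ t)`, `B₁ = ctLevelPairing W (2^L)`,
FROM the local term at `λ` (`hloc₁`, McCallum's Lemma 5.3, displayed). Data: classes `c₁` (even depth, on `E`),
`c₂` (odd depth, on the twin), `M₀`; hypotheses: `Δ < 0`, `ρ̄_{E,2}` onto, `2M₀ ≤ L`, the annihilator
`hkill : Ш(E/ℚ)[2^{2L}] ⊆ Ш(E/ℚ)[2^L]`, Lemma 4.3 over `ℚ` for `c₁`. For a Kolyvagin prime `ℓ`,
`n = ℓm'` of even depth, `z = 2^j c₁(ℓm') ∈ Sel_{2^M}(E/ℚ)` (`M = L + L`, `M − M₀ ≤ j`), a Selmer class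
`t` with `2^{2M₀} t = 0` vanishing at the primes of `m'`: `P₁(z, t) ≠ 0`. gk2-p2 g12's
`VisiblePairAtTwo.hV₁_of_localTerm` with `I : Input` replaced by what its proof uses.
[cite: McCallumLMS1991, §4 Prop. 4.7, §5 Lemma 5.3, Thm. 5.4 (proof)] [cite: MilneADT2006, Ch. I §6, Prop. 6.9] -/
theorem hV₁_of_localTerm_of_kol {M₀ : ℕ} (c₁ : ℕ → galH1Torsion W (lvl (L + L)))
    (c₂ : ℕ → galH1Torsion (twin W K) (lvl (L + L))) (hΔ : W.Δ < 0)
    (hρ2 : W.HasSurjectiveModNGaloisRep 2) (hL : M₀ ≤ L)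
    (Kol : ℕ → Prop) (hKol : ∀ ℓ, Kol ℓ → kolPrime W K (L + L) ℓ)
    -- `Ш(E/ℚ)[2^{2L}] ⊆ Ш(E/ℚ)[2^L]` (Kolyvagin's annihilator, or FINITENESS of `Ш(E/ℚ)[2^∞]` with `L` large)
    (hkill : ∀ a ∈ W.sha, ((2 : ℤ) ^ (2 * L)) • a = 0 → ((2 : ℤ) ^ L) • a = 0)
    -- McCallum's Lemma 4.3 over `ℚ` for the classes of even depth (finite places off the depth, infinite places)
    (loc_c₁_fin : ∀ m, KolSupp Kol m → Even m.primeFactors.card →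
      ∀ v : HeightOneSpectrum (𝓞 ℚ), (m : 𝓞 ℚ) ∉ v.asIdeal → c₁ m ∈ selmerLocalKer W (v.adicCompletion ℚ) (lvl (L + L)))
    (loc_c₁_inf : ∀ m, KolSupp Kol m → Even m.primeFactors.card →
      ∀ w : InfinitePlace ℚ, c₁ m ∈ selmerLocalKer W w.Completion (lvl (L + L)))
    -- the Cassels–Tate data for `W` at level `2^L`, auxiliary level `2^L · 2^L`
    (e : geomTorsion W ((2 ^ L * 2 ^ L : ℕ) : ℤ) → geomTorsion W ((2 ^ L * 2 ^ L : ℕ) : ℤ) → AlgebraicClosure ℚ)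
    (hμ : ∀ S T, e S T ^ (2 ^ L * 2 ^ L) = 1)
    (hadd₁ : ∀ S₁ S₂ T, e (S₁ + S₂) T = e S₁ T * e S₂ T)
    (hadd₂ : ∀ S T₁ T₂, e S (T₁ + T₂) = e S T₁ * e S T₂)
    (hgal : ∀ (σ : absoluteGaloisGroup ℚ) (S T : geomTorsion W ((2 ^ L * 2 ^ L : ℕ) : ℤ)),
      σ • e S T = e (σ • S) (σ • T))
    (halt : ∀ T, e T T = 1) (inv : LocalInvariants ℚ (2 ^ L * 2 ^ L)) (hPT' : inv.SumInvLocalizationEqZero)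
    (hH3 : ∀ c : galoisCohomology (mu ℚ (2 ^ L * 2 ^ L)) 3,
      (∀ v : Place ℚ, galoisCohomology.localization (mu ℚ (2 ^ L * 2 ^ L)) v 3 c = 0) → c = 0)
    (ι₁ : selmerGroup W (lvl (L + L)) →+ (W.sha)[(2 ^ L : ℕ)])
    (hι₁ : ∀ z, shaTorsionVal W (2 ^ L) (ι₁ z) = torsionH1ToH1 W (lvl (L + L)) z)
    -- McCallum's Lemma 5.3 for the local term at `λ`, in the tree's cochain currency (displayed)
    (hloc₁ : ∀ ℓ m' : ℕ, (hℓ : Kol ℓ) → KolSupp Kol (ℓ * m') → ¬ ℓ ∣ m' →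
      Odd m'.primeFactors.card →
      ∀ (j N a b : ℕ) (t : galH1Torsion W (lvl (L + L))), t ∈ selmerGroup W (lvl (L + L)) →
      ((2 : ℤ) ^ j) • c₁ (ℓ * m') ∈ selmerGroup W (lvl (L + L)) →
      ((2 : ℤ) ^ N) • t = 0 → ((2 : ℤ) ^ L) • t = 0 →
      (∀ q ∈ m'.primeFactors, t ∈ a₁ W (L + L) q) → L + L - M₀ ≤ j → N + M₀ ≤ L + L → N ≤ j →
      a + b + 1 = N → ((2 : ℤ) ^ (a + (j - N))) • c₂ m' ∉ a₂ W K (L + L) ℓ →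
      ((2 : ℤ) ^ b) • t ∉ a₁ W (L + L) ℓ →
      ∀ D : FirstCaseData W (2 ^ L),
        D.b₁ = torsionH1OfDvd W (lvl_dvd_sq L) (((2 : ℤ) ^ (j - L)) • c₁ (ℓ * m')) →
        galoisCohomology.map (inclKD W (2 ^ L) (2 ^ L)) 1 D.b' = torsionH1OfDvd W (lvl_dvd_sq L) t →
        D.localTerm e hμ hadd₁ hadd₂ hgal inv (Sum.inr (primesEquiv.symm ⟨ℓ, (hKol ℓ hℓ).1⟩)) ≠ 0) :
    ∀ ℓ m' : ℕ, Kol ℓ → KolSupp Kol (ℓ * m') → ¬ ℓ ∣ m' →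
      Odd m'.primeFactors.card →
      ∀ (j N a b : ℕ) (t : galH1Torsion W (lvl (L + L))) (ht : t ∈ selmerGroup W (lvl (L + L)))
        (hz : ((2 : ℤ) ^ j) • c₁ (ℓ * m') ∈ selmerGroup W (lvl (L + L))),
      ((2 : ℤ) ^ N) • t = 0 → ((2 : ℤ) ^ L) • t = 0 →
      (∀ q ∈ m'.primeFactors, t ∈ a₁ W (L + L) q) → L + L - M₀ ≤ j →
      N + M₀ ≤ L + L → N ≤ j → a + b + 1 = N →
      ((2 : ℤ) ^ (a + (j - N))) • c₂ m' ∉ a₂ W K (L + L) ℓ →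
      ((2 : ℤ) ^ b) • t ∉ a₁ W (L + L) ℓ →
      ((ctLevelPairing W (2 ^ L) e hμ hadd₁ hadd₂ hgal inv halt hPT' hH3
        (localTerm_finite_support (W := W) (m := 2 ^ L) (e := e) (hμ := hμ) (hadd₁ := hadd₁) (hadd₂ := hadd₂)
          (hgal := hgal) halt inv)).comp ι₁).compl₂ ι₁ ⟨_, hz⟩ ⟨t, ht⟩ ≠ 0 := by
  intro ℓ m' hℓ hsupp hndvd hodd j N a b t ht hz hN h2 hAq hj hNM hNj hab hcm hbt
  have ht2 : t ∈ selmerGroup W (lvl (L + L)) := ht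
  have hz2 : ((2 : ℤ) ^ j) • c₁ (ℓ * m') ∈ selmerGroup W (lvl (L + L)) := hz
  have hN2 : ((2 : ℤ) ^ N) • t = 0 := hN
  have h22 : ((2 : ℤ) ^ L) • t = 0 := h2
  have hAq2 : ∀ q ∈ m'.primeFactors, t ∈ a₁ W (L + L) q := hAq
  have hj2 : L + L - M₀ ≤ j := hj
  have hNM2 : N + M₀ ≤ L + L := hNM
  have hcm2 : ((2 : ℤ) ^ (a + (j - N))) • c₂ m' ∉ a₂ W K (L + L) ℓ := hcm
  have hbt2 : ((2 : ℤ) ^ b) • t ∉ a₁ W (L + L) ℓ := hbt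
  have hℓp : ℓ.Prime := (hKol ℓ hℓ).1
  haveI : NeZero (2 ^ L) := ⟨pow_ne_zero L two_ne_zero⟩
  have hΔ : W.Δ < 0 := hΔ
  have hjL : L ≤ j := by omega
  have heven : Even (ℓ * m').primeFactors.card := by
    have hmem : ℓ ∈ (ℓ * m').primeFactors :=
      Nat.mem_primeFactors.mpr ⟨hℓp, dvd_mul_right ℓ m', hsupp.1.ne_zero⟩
    obtain ⟨-, -, -, -, -, -, -, hcard⟩ := kolSupp_div hsupp hmem
    rw [Nat.mul_div_cancel_left m' hℓp.pos] at hcard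
    rw [← hcard]; exact hodd.add_one
  set v₀ : HeightOneSpectrum (𝓞 ℚ) := primesEquiv.symm ⟨ℓ, hℓp⟩ with hv₀
  -- unfold the pulled-back pairing
  change ctLevelPairing W (2 ^ L) e hμ hadd₁ hadd₂ hgal inv halt hPT' hH3
    (localTerm_finite_support (W := W) (m := 2 ^ L) (e := e) (hμ := hμ) (hadd₁ := hadd₁) (hadd₂ := hadd₂)
      (hgal := hgal) halt inv) (ι₁ ⟨_, hz⟩) (ι₁ ⟨t, ht⟩) ≠ 0
  -- the map `ι'` at level `2^L · 2^L`
  have hsha : ∀ c ∈ W.sha, ((2 : ℤ) ^ (2 * L)) • c = 0 → ((2 : ℤ) ^ L) • c = 0 :=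
    hkill
  have hL' : ∀ c ∈ W.sha, (((2 ^ L * 2 ^ L : ℕ) : ℤ)) • c = 0 → ((2 ^ L : ℕ) : ℤ) • c = 0 := by
    intro c hc h0
    rw [Nat.cast_pow, Nat.cast_ofNat]
    refine hsha c hc ?_
    rwa [Nat.cast_mul, Nat.cast_pow, Nat.cast_ofNat, ← pow_add, ← two_mul] at h0
  obtain ⟨ι', hι'⟩ := exists_selmerToShaTorsion W (2 ^ L) hL'
  -- transport to the level `2^L · 2^L`
  have hzτ : torsionH1OfDvd W (lvl_dvd_sq L) (((2 : ℤ) ^ j) • c₁ (ℓ * m')) ∈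
      selmerGroup W ((2 ^ L * 2 ^ L : ℕ) : ℤ) := torsionH1OfDvd_mem_selmerGroup W _ hz2
  have htτ : torsionH1OfDvd W (lvl_dvd_sq L) t ∈ selmerGroup W ((2 ^ L * 2 ^ L : ℕ) : ℤ) :=
    torsionH1OfDvd_mem_selmerGroup W _ ht2
  have hιz : ι₁ ⟨_, hz⟩ = ι' ⟨torsionH1OfDvd W (lvl_dvd_sq L) (((2 : ℤ) ^ j) • c₁ (ℓ * m')), hzτ⟩ :=
    Subtype.ext (Subtype.ext (by
      change shaTorsionVal W (2 ^ L) (ι₁ ⟨_, hz⟩) = shaTorsionVal W (2 ^ L) (ι' ⟨_, hzτ⟩)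
      rw [hι₁, hι', torsionH1ToH1_torsionH1OfDvd]))
  have hιt : ι₁ ⟨t, ht⟩ = ι' ⟨torsionH1OfDvd W (lvl_dvd_sq L) t, htτ⟩ :=
    Subtype.ext (Subtype.ext (by
      change shaTorsionVal W (2 ^ L) (ι₁ ⟨t, ht⟩) = shaTorsionVal W (2 ^ L) (ι' ⟨_, htτ⟩)
      rw [hι₁, hι', torsionH1ToH1_torsionH1OfDvd]))
  rw [hιz, hιt]
  -- `z' = 2^L • b₁`
  have hz' : ((⟨torsionH1OfDvd W (lvl_dvd_sq L) (((2 : ℤ) ^ j) • c₁ (ℓ * m')), hzτ⟩ :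
      selmerGroup W ((2 ^ L * 2 ^ L : ℕ) : ℤ)) : galH1Torsion W ((2 ^ L * 2 ^ L : ℕ) : ℤ)) =
      ((2 ^ L : ℕ) : ℤ) • torsionH1OfDvd W (lvl_dvd_sq L) (((2 : ℤ) ^ (j - L)) • c₁ (ℓ * m')) := by
    change torsionH1OfDvd W (lvl_dvd_sq L) (((2 : ℤ) ^ j) • c₁ (ℓ * m')) = _
    rw [← map_zsmul, zsmul_pow_sub_eq hjL]
  -- first-case data: `[2^L]_* t' = 0` (`2^L t = 0` displayed, `E(ℚ) ∩ E[2^L] = 0`)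
  have h2W := DokchitserDokchitser2012.forall_two_nsmul_of_hasSurjectiveModNGaloisRep_two W two_ne_zero hρ2
  have hfix : ∀ P : geomTorsion W ((2 ^ L : ℕ) : ℤ), (∀ σ : absoluteGaloisGroup ℚ, σ • P = P) → P = 0 :=
    geomTorsion_fixed_eq_zero_of_forall_two_nsmul W h2W L
  have h2L : ((2 ^ L : ℕ) : ℤ) • t = 0 := by
    rw [Nat.cast_pow, Nat.cast_ofNat]
    exact h22
  have hmt : ((2 ^ L : ℕ) : ℤ) • torsionH1OfDvd W (lvl_dvd_sq L) t = 0 := by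
    rw [← map_zsmul, h2L, map_zero]
  have hb₁ : ((2 ^ L : ℕ) : ℤ) • torsionH1OfDvd W (lvl_dvd_sq L) (((2 : ℤ) ^ (j - L)) • c₁ (ℓ * m')) ∈
      selmerGroup W ((2 ^ L * 2 ^ L : ℕ) : ℤ) := by
    rw [← map_zsmul, zsmul_pow_sub_eq hjL]; exact hzτ
  obtain ⟨D, hD₁, hDt⟩ := exists_firstCaseData_of_zsmul_of_map_mulK_eq_zero W (2 ^ L) hb₁ htτ
    (map_mulK_eq_zero_of_zsmul_eq_zero W (2 ^ L) hfix hmt)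
  rw [ctLevelPairing_pullback_ne_zero_iff_localTerm e hμ hadd₁ hadd₂ hgal inv halt hPT' hH3 _ ι' hι'
    ⟨_, hzτ⟩ ⟨_, htτ⟩ hz' D hD₁ hDt (Sum.inr v₀) ?_]
  · exact hloc₁ ℓ m' hℓ hsupp hndvd hodd j N a b t ht2 hz2 hN2 h22 hAq2 hj2 hNM2 hNj hab hcm2 hbt2 D hD₁ hDt
  -- ### the places `v ≠ v_ℓ`
  intro v hv
  rcases v with w | v'
  · -- an infinite place: Lemma 4.3 at `∞`
    left
    have hc : c₁ (ℓ * m') ∈ selmerLocalKer W (Place.Completion (Sum.inl w : Place ℚ)) (lvl (L + L)) :=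
      loc_c₁_inf (ℓ * m') hsupp heven w
    have hc' := (torsionH1OfDvd_mem_selmerLocalKer_iff W (Place.Completion (Sum.inl w : Place ℚ))
      (lvl_dvd_sq L) _).mp hc
    have key := mem_kummerLocalConditionAt_res_of_mem_selmerLocalKer W _ _ hc'
    rw [map_zsmul]
    convert AddSubgroup.zsmul_mem _ key ((2 : ℤ) ^ (j - L)) using 1
    exact map_zsmul _ _ _
  · by_cases hdiv : ((ℓ * m' : ℕ) : 𝓞 ℚ) ∈ v'.asIdeal
    · -- a place of `ℓ m'` other than `v_ℓ`: a place `v_q`, `q ∣ m'`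
      right
      have hm' : ((m' : ℕ) : 𝓞 ℚ) ∈ v'.asIdeal := by
        rcases natCast_mem_or_natCast_mem_of_mul_mem hdiv with h1 | h1
        · exact absurd ((natCast_prime_mem_iff_eq hℓp v').mp h1) (fun h ↦ hv (by rw [h]))
        · exact h1
      -- a prime factor `q` of `m'` with `q ∈ v'`
      obtain ⟨hsqm', hkolm'⟩ : KolSupp Kol m' := by
        have hmem : ℓ ∈ (ℓ * m').primeFactors :=
          Nat.mem_primeFactors.mpr ⟨hℓp, dvd_mul_right ℓ m', hsupp.1.ne_zero⟩
        obtain ⟨h, -⟩ := kolSupp_div hsupp hmem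
        rwa [Nat.mul_div_cancel_left m' hℓp.pos] at h
      haveI := v'.isPrime
      have hprod : ((∏ q ∈ m'.primeFactors, q : ℕ) : 𝓞 ℚ) ∈ v'.asIdeal := by
        rwa [Nat.prod_primeFactors_of_squarefree hsqm']
      rw [Nat.cast_prod] at hprod
      obtain ⟨q, hq, hqv⟩ := Ideal.IsPrime.prod_mem_iff.mp hprod
      have hqp : q.Prime := Nat.prime_of_mem_primeFactors hq
      have hkq : kolPrime W K (L + L) q := hKol q (hkolm' q hq)
      have hv'eq : v' = primesEquiv.symm ⟨q, hqp⟩ := (natCast_prime_mem_iff_eq hqp v').mp hqv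
      subst hv'eq
      refine ⟨?_, map_inclKD_restrictField_injective_of_kolPrime hΔ hkq⟩
      -- `loc_q t' = 0`
      have htq : t ∈ W.torsionLocalKer ((primesEquiv.symm ⟨q, hqp⟩ : HeightOneSpectrum (𝓞 ℚ)).adicCompletion ℚ)
          (lvl (L + L)) := (mem_a₁_iff hqp t).mp (hAq2 q hq)
      have htq' := torsionH1OfDvd_mem_torsionLocalKer W
        (Place.Completion (Sum.inr (primesEquiv.symm ⟨q, hqp⟩) : Place ℚ)) (lvl_dvd_sq L) htq
      -- (`CharZero ℚ_q` passed explicitly: as an instance it would let `DivisionRing.toRatAlgebra` compete with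
      -- `Place.instAlgebraCompletion`)
      exact (@mem_torsionLocalKer_iff_res_eq_zero ℚ _ W
        (Place.Completion (Sum.inr (primesEquiv.symm ⟨q, hqp⟩) : Place ℚ)) _ (Place.instAlgebraCompletion _) _ _
        (charZero_placeCompletion _) (2 ^ L * 2 ^ L) (NeZero.ne (2 ^ L * 2 ^ L)) _).mp htq'
    · -- a finite place not dividing `ℓ m'`: Lemma 4.3 over `ℚ`
      left
      have hc : c₁ (ℓ * m') ∈ selmerLocalKer W (Place.Completion (Sum.inr v' : Place ℚ)) (lvl (L + L)) :=
        loc_c₁_fin (ℓ * m') hsupp heven v' hdiv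
      have hc' := (torsionH1OfDvd_mem_selmerLocalKer_iff W (Place.Completion (Sum.inr v' : Place ℚ))
        (lvl_dvd_sq L) _).mp hc
      have key := mem_kummerLocalConditionAt_res_of_mem_selmerLocalKer W _ _ hc'
      rw [map_zsmul]
      convert AddSubgroup.zsmul_mem _ key ((2 : ℤ) ^ (j - L)) using 1
      exact map_zsmul _ _ _

end MemberOne

end Summit.BirchSwinnertonDyer.BirchSwinnertonDyer.Theorems.KolyvaginPairDataTwo

end


set_option linter.dupNamespace false -- tree convention: `Summit.BirchSwinnertonDyer.BirchSwinnertonDyer.Theorems` (summit = sub-problem)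
set_option autoImplicit false

noncomputable section

open scoped Classical
open scoped AddSubgroup

universe u

namespace Summit.BirchSwinnertonDyer.BirchSwinnertonDyer.Theorems.KolyvaginPairDataTwo

open WeierstrassCurve NumberField IsDedekindDomain Field Function Rat.HeightOneSpectrum
open Literature.NumberTheory.EllipticCurves Literature.NumberTheory.GaloisRepresentations
open Literature.NumberTheory.GaloisCohomology
open Literature.NumberTheory.GaloisRepresentations.DiscreteGaloisModule (mu)
open Literature.NumberTheory.EllipticCurves.KolyvaginDescent
open Literature.GroupTheory.FiniteAbelian
open Summit.BirchSwinnertonDyer.BirchSwinnertonDyer.Theorems.GenusExact.VisiblePairAtTwo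

section MemberTwo

variable {W : WeierstrassCurve ℚ} [W.IsElliptic] [W.IsGloballyMinimal] {K : Type} [Field K] [NumberField K]
  {L : ℕ} [(twin W K).IsElliptic]

/-- **McCallum's Prop. 4.7 for the member `E^{(d_K)}` of the `ℚ`-pair at `2`, record-free**: the value
formula `hV₂` for the pulled-back level-`2^L` Cassels–Tate pairing `P₂(z, t) = B₂(ι₂ z, ι₂ t)`,
`B₂ = ctLevelPairing (twin W K) (2^L)`, FROM the local term at `λ` (`hloc₂`, displayed). Data `c₁`, `c₂`,
`M₀`; hypotheses: `K` imaginary quadratic, `d_K` odd, `Δ < 0`, `ρ̄_{E,2}` onto, `2M₀ ≤ L`, the annihilator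
`hkill : Ш(E^{(d_K)}/ℚ)[2^{2L}] ⊆ Ш(E^{(d_K)}/ℚ)[2^L]`, Lemma 4.3 over `ℚ` for `c₂`. For `n = ℓm'` of ODD
depth, `z = 2^j c₂(ℓm') ∈ Sel_{2^M}(E^{(d_K)}/ℚ)`, `t` Selmer with `2^{2M₀} t = 0` vanishing at the primes of
`m'`: `P₂(z, t) ≠ 0`. gk2-p2 g12's `VisiblePairAtTwo.hV₂_of_localTerm` with `I : Input` replaced by what its
proof uses. [cite: McCallumLMS1991, §4 Prop. 4.7, §5 Lemma 5.3, Thm. 5.4 (proof)] [cite: MilneADT2006, Ch. I §6, Prop. 6.9] -/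
theorem hV₂_of_localTerm_of_kol {M₀ : ℕ} (c₁ : ℕ → galH1Torsion W (lvl (L + L)))
    (c₂ : ℕ → galH1Torsion (twin W K) (lvl (L + L))) (hK : IsImaginaryQuadratic K)
    (hoddK : Odd (NumberField.discr K)) (hΔ : W.Δ < 0)
    (hρ2 : W.HasSurjectiveModNGaloisRep 2) (hL : M₀ ≤ L)
    (Kol : ℕ → Prop) (hKol : ∀ ℓ, Kol ℓ → kolPrime W K (L + L) ℓ)
    -- `Ш(E^{(d_K)}/ℚ)[2^{2L}] ⊆ Ш(E^{(d_K)}/ℚ)[2^L]` (Kolyvagin's annihilator, or FINITENESS with `L` large)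
    (hkill : ∀ a ∈ (twin W K).sha, ((2 : ℤ) ^ (2 * L)) • a = 0 → ((2 : ℤ) ^ L) • a = 0)
    -- McCallum's Lemma 4.3 over `ℚ` for the classes of odd depth (finite places off the depth, infinite places)
    (loc_c₂_fin : ∀ m, KolSupp Kol m → Odd m.primeFactors.card →
      ∀ v : HeightOneSpectrum (𝓞 ℚ), (m : 𝓞 ℚ) ∉ v.asIdeal →
        c₂ m ∈ selmerLocalKer (twin W K) (v.adicCompletion ℚ) (lvl (L + L)))
    (loc_c₂_inf : ∀ m, KolSupp Kol m → Odd m.primeFactors.card →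
      ∀ w : InfinitePlace ℚ, c₂ m ∈ selmerLocalKer (twin W K) w.Completion (lvl (L + L)))
    -- the Cassels–Tate data for `E^{(d_K)}` at level `2^L`, auxiliary level `2^L · 2^L`
    (e : geomTorsion (twin W K) ((2 ^ L * 2 ^ L : ℕ) : ℤ) → geomTorsion (twin W K) ((2 ^ L * 2 ^ L : ℕ) : ℤ) →
      AlgebraicClosure ℚ)
    (hμ : ∀ S T, e S T ^ (2 ^ L * 2 ^ L) = 1)
    (hadd₁ : ∀ S₁ S₂ T, e (S₁ + S₂) T = e S₁ T * e S₂ T)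
    (hadd₂ : ∀ S T₁ T₂, e S (T₁ + T₂) = e S T₁ * e S T₂)
    (hgal : ∀ (σ : absoluteGaloisGroup ℚ) (S T : geomTorsion (twin W K) ((2 ^ L * 2 ^ L : ℕ) : ℤ)),
      σ • e S T = e (σ • S) (σ • T))
    (halt : ∀ T, e T T = 1) (inv : LocalInvariants ℚ (2 ^ L * 2 ^ L)) (hPT' : inv.SumInvLocalizationEqZero)
    (hH3 : ∀ c : galoisCohomology (mu ℚ (2 ^ L * 2 ^ L)) 3,
      (∀ v : Place ℚ, galoisCohomology.localization (mu ℚ (2 ^ L * 2 ^ L)) v 3 c = 0) → c = 0)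
    (ι₂ : selmerGroup (twin W K) (lvl (L + L)) →+ ((twin W K).sha)[(2 ^ L : ℕ)])
    (hι₂ : ∀ z, shaTorsionVal (twin W K) (2 ^ L) (ι₂ z) = torsionH1ToH1 (twin W K) (lvl (L + L)) z)
    -- McCallum's Lemma 5.3 for the local term at `λ`, in the tree's cochain currency (displayed)
    (hloc₂ : ∀ ℓ m' : ℕ, (hℓ : Kol ℓ) → KolSupp Kol (ℓ * m') → ¬ ℓ ∣ m' →
      Even m'.primeFactors.card →
      ∀ (j N a b : ℕ) (t : galH1Torsion (twin W K) (lvl (L + L))), t ∈ selmerGroup (twin W K) (lvl (L + L)) →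
      ((2 : ℤ) ^ j) • c₂ (ℓ * m') ∈ selmerGroup (twin W K) (lvl (L + L)) →
      ((2 : ℤ) ^ N) • t = 0 → ((2 : ℤ) ^ L) • t = 0 →
      (∀ q ∈ m'.primeFactors, t ∈ a₂ W K (L + L) q) → L + L - M₀ ≤ j → N + M₀ ≤ L + L → N ≤ j →
      a + b + 1 = N → ((2 : ℤ) ^ (a + (j - N))) • c₁ m' ∉ a₁ W (L + L) ℓ →
      ((2 : ℤ) ^ b) • t ∉ a₂ W K (L + L) ℓ →
      ∀ D : FirstCaseData (twin W K) (2 ^ L),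
        D.b₁ = torsionH1OfDvd (twin W K) (lvl_dvd_sq L) (((2 : ℤ) ^ (j - L)) • c₂ (ℓ * m')) →
        galoisCohomology.map (inclKD (twin W K) (2 ^ L) (2 ^ L)) 1 D.b' =
          torsionH1OfDvd (twin W K) (lvl_dvd_sq L) t →
        D.localTerm e hμ hadd₁ hadd₂ hgal inv (Sum.inr (primesEquiv.symm ⟨ℓ, (hKol ℓ hℓ).1⟩)) ≠ 0) :
    ∀ ℓ m' : ℕ, Kol ℓ → KolSupp Kol (ℓ * m') → ¬ ℓ ∣ m' →
      Even m'.primeFactors.card →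
      ∀ (j N a b : ℕ) (t : galH1Torsion (twin W K) (lvl (L + L))) (ht : t ∈ selmerGroup (twin W K) (lvl (L + L)))
        (hz : ((2 : ℤ) ^ j) • c₂ (ℓ * m') ∈ selmerGroup (twin W K) (lvl (L + L))),
      ((2 : ℤ) ^ N) • t = 0 → ((2 : ℤ) ^ L) • t = 0 →
      (∀ q ∈ m'.primeFactors, t ∈ a₂ W K (L + L) q) → L + L - M₀ ≤ j →
      N + M₀ ≤ L + L → N ≤ j → a + b + 1 = N →
      ((2 : ℤ) ^ (a + (j - N))) • c₁ m' ∉ a₁ W (L + L) ℓ →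
      ((2 : ℤ) ^ b) • t ∉ a₂ W K (L + L) ℓ →
      ((ctLevelPairing (twin W K) (2 ^ L) e hμ hadd₁ hadd₂ hgal inv halt hPT' hH3
        (localTerm_finite_support (W := twin W K) (m := 2 ^ L) (e := e) (hμ := hμ) (hadd₁ := hadd₁)
          (hadd₂ := hadd₂) (hgal := hgal) halt inv)).comp ι₂).compl₂ ι₂ ⟨_, hz⟩ ⟨t, ht⟩ ≠ 0 := by
  intro ℓ m' hℓ hsupp hndvd hodd j N a b t ht hz hN h2 hAq hj hNM hNj hab hcm hbt
  have ht2 : t ∈ selmerGroup (twin W K) (lvl (L + L)) := ht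
  have hz2 : ((2 : ℤ) ^ j) • c₂ (ℓ * m') ∈ selmerGroup (twin W K) (lvl (L + L)) := hz
  have hN2 : ((2 : ℤ) ^ N) • t = 0 := hN
  have h22 : ((2 : ℤ) ^ L) • t = 0 := h2
  have hAq2 : ∀ q ∈ m'.primeFactors, t ∈ a₂ W K (L + L) q := hAq
  have hj2 : L + L - M₀ ≤ j := hj
  have hNM2 : N + M₀ ≤ L + L := hNM
  have hcm2 : ((2 : ℤ) ^ (a + (j - N))) • c₁ m' ∉ a₁ W (L + L) ℓ := hcm
  have hbt2 : ((2 : ℤ) ^ b) • t ∉ a₂ W K (L + L) ℓ := hbt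
  have hℓp : ℓ.Prime := (hKol ℓ hℓ).1
  haveI : NeZero (2 ^ L) := ⟨pow_ne_zero L two_ne_zero⟩
  have hΔ : W.Δ < 0 := hΔ
  have hjL : L ≤ j := by omega
  have hodd' : Odd (ℓ * m').primeFactors.card := by
    have hmem : ℓ ∈ (ℓ * m').primeFactors :=
      Nat.mem_primeFactors.mpr ⟨hℓp, dvd_mul_right ℓ m', hsupp.1.ne_zero⟩
    obtain ⟨-, -, -, -, -, -, -, hcard⟩ := kolSupp_div hsupp hmem
    rw [Nat.mul_div_cancel_left m' hℓp.pos] at hcard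
    rw [← hcard]; exact hodd.add_one
  set v₀ : HeightOneSpectrum (𝓞 ℚ) := primesEquiv.symm ⟨ℓ, hℓp⟩ with hv₀
  -- unfold the pulled-back pairing
  change ctLevelPairing (twin W K) (2 ^ L) e hμ hadd₁ hadd₂ hgal inv halt hPT' hH3
    (localTerm_finite_support (W := twin W K) (m := 2 ^ L) (e := e) (hμ := hμ) (hadd₁ := hadd₁) (hadd₂ := hadd₂)
      (hgal := hgal) halt inv) (ι₂ ⟨_, hz⟩) (ι₂ ⟨t, ht⟩) ≠ 0
  -- the map `ι'` at level `2^L · 2^L`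
  have hsha : ∀ c ∈ (twin W K).sha, ((2 : ℤ) ^ (2 * L)) • c = 0 → ((2 : ℤ) ^ L) • c = 0 :=
    hkill
  have hL' : ∀ c ∈ (twin W K).sha, (((2 ^ L * 2 ^ L : ℕ) : ℤ)) • c = 0 → ((2 ^ L : ℕ) : ℤ) • c = 0 := by
    intro c hc h0
    rw [Nat.cast_pow, Nat.cast_ofNat]
    refine hsha c hc ?_
    rwa [Nat.cast_mul, Nat.cast_pow, Nat.cast_ofNat, ← pow_add, ← two_mul] at h0
  obtain ⟨ι', hι'⟩ := exists_selmerToShaTorsion (twin W K) (2 ^ L) hL'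
  -- transport to the level `2^L · 2^L`
  have hzτ : torsionH1OfDvd (twin W K) (lvl_dvd_sq L) (((2 : ℤ) ^ j) • c₂ (ℓ * m')) ∈
      selmerGroup (twin W K) ((2 ^ L * 2 ^ L : ℕ) : ℤ) := torsionH1OfDvd_mem_selmerGroup (twin W K) _ hz2
  have htτ : torsionH1OfDvd (twin W K) (lvl_dvd_sq L) t ∈ selmerGroup (twin W K) ((2 ^ L * 2 ^ L : ℕ) : ℤ) :=
    torsionH1OfDvd_mem_selmerGroup (twin W K) _ ht2
  have hιz : ι₂ ⟨_, hz⟩ = ι' ⟨torsionH1OfDvd (twin W K) (lvl_dvd_sq L) (((2 : ℤ) ^ j) • c₂ (ℓ * m')), hzτ⟩ :=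
    Subtype.ext (Subtype.ext (by
      change shaTorsionVal (twin W K) (2 ^ L) (ι₂ ⟨_, hz⟩) = shaTorsionVal (twin W K) (2 ^ L) (ι' ⟨_, hzτ⟩)
      rw [hι₂, hι', torsionH1ToH1_torsionH1OfDvd]))
  have hιt : ι₂ ⟨t, ht⟩ = ι' ⟨torsionH1OfDvd (twin W K) (lvl_dvd_sq L) t, htτ⟩ :=
    Subtype.ext (Subtype.ext (by
      change shaTorsionVal (twin W K) (2 ^ L) (ι₂ ⟨t, ht⟩) = shaTorsionVal (twin W K) (2 ^ L) (ι' ⟨_, htτ⟩)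
      rw [hι₂, hι', torsionH1ToH1_torsionH1OfDvd]))
  rw [hιz, hιt]
  -- `z' = 2^L • b₁`
  have hz' : ((⟨torsionH1OfDvd (twin W K) (lvl_dvd_sq L) (((2 : ℤ) ^ j) • c₂ (ℓ * m')), hzτ⟩ :
      selmerGroup (twin W K) ((2 ^ L * 2 ^ L : ℕ) : ℤ)) : galH1Torsion (twin W K) ((2 ^ L * 2 ^ L : ℕ) : ℤ)) =
      ((2 ^ L : ℕ) : ℤ) • torsionH1OfDvd (twin W K) (lvl_dvd_sq L) (((2 : ℤ) ^ (j - L)) • c₂ (ℓ * m')) := by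
    change torsionH1OfDvd (twin W K) (lvl_dvd_sq L) (((2 : ℤ) ^ j) • c₂ (ℓ * m')) = _
    rw [← map_zsmul, zsmul_pow_sub_eq hjL]
  -- first-case data: `[2^L]_* t' = 0` (`2^L t = 0` displayed, `E(ℚ) ∩ E[2^L] = 0`)
  have hd : ((NumberField.discr K : ℤ) : ℚ) ≠ 0 := by exact_mod_cast NumberField.discr_ne_zero K
  have hρ2' : (twin W K).HasSurjectiveModNGaloisRep 2 :=
    (hasSurjectiveModNGaloisRep_two_quadraticTwist_iff W hd).mpr hρ2
  have h2W := DokchitserDokchitser2012.forall_two_nsmul_of_hasSurjectiveModNGaloisRep_two (twin W K)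
    two_ne_zero hρ2'
  have hfix : ∀ P : geomTorsion (twin W K) ((2 ^ L : ℕ) : ℤ),
      (∀ σ : absoluteGaloisGroup ℚ, σ • P = P) → P = 0 :=
    geomTorsion_fixed_eq_zero_of_forall_two_nsmul (twin W K) h2W L
  have h2L : ((2 ^ L : ℕ) : ℤ) • t = 0 := by
    rw [Nat.cast_pow, Nat.cast_ofNat]
    exact h22
  have hmt : ((2 ^ L : ℕ) : ℤ) • torsionH1OfDvd (twin W K) (lvl_dvd_sq L) t = 0 := by
    rw [← map_zsmul, h2L, map_zero]
  have hb₁ : ((2 ^ L : ℕ) : ℤ) • torsionH1OfDvd (twin W K) (lvl_dvd_sq L) (((2 : ℤ) ^ (j - L)) • c₂ (ℓ * m')) ∈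
      selmerGroup (twin W K) ((2 ^ L * 2 ^ L : ℕ) : ℤ) := by
    rw [← map_zsmul, zsmul_pow_sub_eq hjL]; exact hzτ
  obtain ⟨D, hD₁, hDt⟩ := exists_firstCaseData_of_zsmul_of_map_mulK_eq_zero (twin W K) (2 ^ L) hb₁ htτ
    (map_mulK_eq_zero_of_zsmul_eq_zero (twin W K) (2 ^ L) hfix hmt)
  rw [ctLevelPairing_pullback_ne_zero_iff_localTerm e hμ hadd₁ hadd₂ hgal inv halt hPT' hH3 _ ι' hι'
    ⟨_, hzτ⟩ ⟨_, htτ⟩ hz' D hD₁ hDt (Sum.inr v₀) ?_]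
  · exact hloc₂ ℓ m' hℓ hsupp hndvd hodd j N a b t ht2 hz2 hN2 h22 hAq2 hj2 hNM2 hNj hab hcm2 hbt2 D hD₁ hDt
  -- ### the places `v ≠ v_ℓ`
  intro v hv
  rcases v with w | v'
  · -- an infinite place: Lemma 4.3 at `∞`
    left
    have hc : c₂ (ℓ * m') ∈ selmerLocalKer (twin W K) (Place.Completion (Sum.inl w : Place ℚ)) (lvl (L + L)) :=
      loc_c₂_inf (ℓ * m') hsupp hodd' w
    have hc' := (torsionH1OfDvd_mem_selmerLocalKer_iff (twin W K) (Place.Completion (Sum.inl w : Place ℚ))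
      (lvl_dvd_sq L) _).mp hc
    have key := mem_kummerLocalConditionAt_res_of_mem_selmerLocalKer (twin W K) _ _ hc'
    rw [map_zsmul]
    convert AddSubgroup.zsmul_mem _ key ((2 : ℤ) ^ (j - L)) using 1
    exact map_zsmul _ _ _
  · by_cases hdiv : ((ℓ * m' : ℕ) : 𝓞 ℚ) ∈ v'.asIdeal
    · -- a place of `ℓ m'` other than `v_ℓ`: a place `v_q`, `q ∣ m'`
      right
      have hm' : ((m' : ℕ) : 𝓞 ℚ) ∈ v'.asIdeal := by
        rcases natCast_mem_or_natCast_mem_of_mul_mem hdiv with h1 | h1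
        · exact absurd ((natCast_prime_mem_iff_eq hℓp v').mp h1) (fun h ↦ hv (by rw [h]))
        · exact h1
      -- a prime factor `q` of `m'` with `q ∈ v'`
      obtain ⟨hsqm', hkolm'⟩ : KolSupp Kol m' := by
        have hmem : ℓ ∈ (ℓ * m').primeFactors :=
          Nat.mem_primeFactors.mpr ⟨hℓp, dvd_mul_right ℓ m', hsupp.1.ne_zero⟩
        obtain ⟨h, -⟩ := kolSupp_div hsupp hmem
        rwa [Nat.mul_div_cancel_left m' hℓp.pos] at h
      haveI := v'.isPrime
      have hprod : ((∏ q ∈ m'.primeFactors, q : ℕ) : 𝓞 ℚ) ∈ v'.asIdeal := by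
        rwa [Nat.prod_primeFactors_of_squarefree hsqm']
      rw [Nat.cast_prod] at hprod
      obtain ⟨q, hq, hqv⟩ := Ideal.IsPrime.prod_mem_iff.mp hprod
      have hqp : q.Prime := Nat.prime_of_mem_primeFactors hq
      have hkq : kolPrime W K (L + L) q := hKol q (hkolm' q hq)
      have hv'eq : v' = primesEquiv.symm ⟨q, hqp⟩ := (natCast_prime_mem_iff_eq hqp v').mp hqv
      subst hv'eq
      refine ⟨?_, map_inclKD_restrictField_injective_twin_of_kolPrime hK hoddK hΔ hkq⟩
      -- `loc_q t' = 0`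
      have htq : t ∈ (twin W K).torsionLocalKer
          ((primesEquiv.symm ⟨q, hqp⟩ : HeightOneSpectrum (𝓞 ℚ)).adicCompletion ℚ) (lvl (L + L)) :=
        (mem_a₂_iff hqp t).mp (hAq2 q hq)
      have htq' := torsionH1OfDvd_mem_torsionLocalKer (twin W K)
        (Place.Completion (Sum.inr (primesEquiv.symm ⟨q, hqp⟩) : Place ℚ)) (lvl_dvd_sq L) htq
      -- (`CharZero ℚ_q` passed explicitly: as an instance it would let `DivisionRing.toRatAlgebra` compete with
      -- `Place.instAlgebraCompletion`)
      exact (@mem_torsionLocalKer_iff_res_eq_zero ℚ _ (twin W K)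
        (Place.Completion (Sum.inr (primesEquiv.symm ⟨q, hqp⟩) : Place ℚ)) _ (Place.instAlgebraCompletion _) _ _
        (charZero_placeCompletion _) (2 ^ L * 2 ^ L) (NeZero.ne (2 ^ L * 2 ^ L)) _).mp htq'
    · -- a finite place not dividing `ℓ m'`: Lemma 4.3 over `ℚ`
      left
      have hc : c₂ (ℓ * m') ∈ selmerLocalKer (twin W K) (Place.Completion (Sum.inr v' : Place ℚ))
          (lvl (L + L)) := loc_c₂_fin (ℓ * m') hsupp hodd' v' hdiv
      have hc' := (torsionH1OfDvd_mem_selmerLocalKer_iff (twin W K) (Place.Completion (Sum.inr v' : Place ℚ))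
        (lvl_dvd_sq L) _).mp hc
      have key := mem_kummerLocalConditionAt_res_of_mem_selmerLocalKer (twin W K) _ _ hc'
      rw [map_zsmul]
      convert AddSubgroup.zsmul_mem _ key ((2 : ℤ) ^ (j - L)) using 1
      exact map_zsmul _ _ _

end MemberTwo

end Summit.BirchSwinnertonDyer.BirchSwinnertonDyer.Theorems.KolyvaginPairDataTwo

end


set_option linter.dupNamespace false -- tree convention: `Summit.BirchSwinnertonDyer.BirchSwinnertonDyer.Theorems` (summit = sub-problem)
set_option autoImplicit false

noncomputable section

open scoped Classical
open scoped AddSubgroup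

universe u

namespace Summit.BirchSwinnertonDyer.BirchSwinnertonDyer.Theorems.KolyvaginPairDataTwo

open WeierstrassCurve NumberField IsDedekindDomain Field Function Rat.HeightOneSpectrum
open Literature.NumberTheory.EllipticCurves Literature.NumberTheory.GaloisRepresentations
open Literature.NumberTheory.GaloisCohomology
open Literature.NumberTheory.EllipticCurves.KolyvaginDescent
open Summit.BirchSwinnertonDyer.BirchSwinnertonDyer.Theorems.GenusExact.ReductionCyclic
open Summit.BirchSwinnertonDyer.BirchSwinnertonDyer.Theorems.GenusExact.VisiblePairAtTwo

section Instance

variable {W : WeierstrassCurve ℚ} [W.IsElliptic] [W.IsGloballyMinimal] {K : Type} [Field K] [NumberField K]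
  {L : ℕ}

/-- **`hloc₁` discharged** — McCallum's Lemma 5.3 for the local term at `λ` of the member `E`, in the cochain
currency of `selmer_eq_and_card_selmer_twin_eq_of_localTerms`, for `inv := LocalInvariants.canonical ℚ (2^L · 2^L)`:
from `2^b t ∉ a₁(ℓ)` ⇒ `2^{b+L} β'_ℓ ≠ 0` and `2^{a+j−N} c₂(m') ∉ a₂(ℓ)` ⇒ (Prop. 4.4) `2^{a+L−N} res_ℓ b₁ ∉ 𝓛_ℓ`,
the orders multiply to more than `2^{2L}` and `localTerm_canonical_ne_zero_of_kolPrime` concludes.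
[cite: McCallumLMS1991, §4 Prop. 4.4 and Prop. 4.7, §5 Lemma 5.3, Thm. 5.4 (proof)] [cite: MilneADT2006, Ch. I §6, proof of Prop. 6.9] -/
theorem hloc₁_canonical_of_rel_of_kol [(twin W K).IsElliptic] {M₀ : ℕ} (c₁ : ℕ → galH1Torsion W (lvl (L + L)))
    (c₂ : ℕ → galH1Torsion (twin W K) (lvl (L + L))) (hΔ : W.Δ < 0) (hL : M₀ ≤ L) (hL1 : 1 ≤ L)
    (Kol : ℕ → Prop) (hKol : ∀ ℓ, Kol ℓ → kolPrime W K (L + L) ℓ)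
    -- McCallum's Prop. 4.4 ACROSS the members, odd depth `m'` to even depth `ℓm'` (Selmer at `λ` ↔ twin class vanishes at `λ`)
    (h44₂₁ : ∀ ℓ m : ℕ, Kol ℓ → KolSupp Kol (ℓ * m) →
      Odd m.primeFactors.card → ∀ a : ℕ,
        ((2 : ℤ) ^ a) • c₁ (ℓ * m) ∈ loc₁ W (L + L) (pl ℓ) ↔ ((2 : ℤ) ^ a) • c₂ m ∈ a₂ W K (L + L) ℓ)
    (e : geomTorsion W ((2 ^ L * 2 ^ L : ℕ) : ℤ) → geomTorsion W ((2 ^ L * 2 ^ L : ℕ) : ℤ) → AlgebraicClosure ℚ)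
    (hμ : ∀ S T, e S T ^ (2 ^ L * 2 ^ L) = 1)
    (hadd₁ : ∀ S₁ S₂ T, e (S₁ + S₂) T = e S₁ T * e S₂ T)
    (hadd₂ : ∀ S T₁ T₂, e S (T₁ + T₂) = e S T₁ * e S T₂)
    (hgal : ∀ (σ : absoluteGaloisGroup ℚ) (S T : geomTorsion W ((2 ^ L * 2 ^ L : ℕ) : ℤ)),
      σ • e S T = e (σ • S) (σ • T))
    (halt : ∀ T, e T T = 1) (hnondeg : ∀ T, (∀ S, e S T = 1) → T = 0) :
    ∀ ℓ m' : ℕ, (hℓ : Kol ℓ) → KolSupp Kol (ℓ * m') → ¬ ℓ ∣ m' →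
      Odd m'.primeFactors.card →
      ∀ (j N a b : ℕ) (t : galH1Torsion W (lvl (L + L))), t ∈ selmerGroup W (lvl (L + L)) →
      ((2 : ℤ) ^ j) • c₁ (ℓ * m') ∈ selmerGroup W (lvl (L + L)) →
      ((2 : ℤ) ^ N) • t = 0 → ((2 : ℤ) ^ L) • t = 0 →
      (∀ q ∈ m'.primeFactors, t ∈ a₁ W (L + L) q) → L + L - M₀ ≤ j → N + M₀ ≤ L + L → N ≤ j →
      a + b + 1 = N → ((2 : ℤ) ^ (a + (j - N))) • c₂ m' ∉ a₂ W K (L + L) ℓ →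
      ((2 : ℤ) ^ b) • t ∉ a₁ W (L + L) ℓ →
      ∀ D : FirstCaseData W (2 ^ L),
        D.b₁ = torsionH1OfDvd W (lvl_dvd_sq L) (((2 : ℤ) ^ (j - L)) • c₁ (ℓ * m')) →
        galoisCohomology.map (inclKD W (2 ^ L) (2 ^ L)) 1 D.b' = torsionH1OfDvd W (lvl_dvd_sq L) t →
        D.localTerm e hμ hadd₁ hadd₂ hgal (LocalInvariants.canonical ℚ (2 ^ L * 2 ^ L))
          (Sum.inr (primesEquiv.symm ⟨ℓ, (hKol ℓ hℓ).1⟩)) ≠ 0 := by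
  intro ℓ m' hℓ hsupp _hndvd hodd j N a b t _ht _hz _hN _h2 _hAq hj hNM hNj hab hcm hbt D hD₁ hDt
  have hℓp : ℓ.Prime := (hKol ℓ hℓ).1
  haveI : Fact ℓ.Prime := ⟨hℓp⟩
  haveI : NeZero (2 ^ L) := ⟨pow_ne_zero L two_ne_zero⟩
  haveI : NeZero (2 ^ L * 2 ^ L) := ⟨by positivity⟩
  have hjL : L ≤ j := by omega
  -- ### (Y) `2^{b+L} β'_ℓ ≠ 0`
  have hY : ((2 : ℤ) ^ (b + L)) • D.β' (Sum.inr (primesEquiv.symm ⟨ℓ, hℓp⟩)) ≠ 0 := by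
    intro h0
    apply hbt
    letI : Algebra ℚ (Place.Completion (Sum.inr (primesEquiv.symm ⟨ℓ, hℓp⟩) : Place ℚ)) :=
      Place.instAlgebraCompletion _
    -- `[m]_* (2^b β') = 0` by `ι_* ∘ [m]_* = m` and the injectivity of `ι_*` over `ℚ_ℓ`
    have h1 : galoisCohomology.map ((mulK W (2 ^ L) (2 ^ L)).restrictField
        (Place.Completion (Sum.inr (primesEquiv.symm ⟨ℓ, hℓp⟩) : Place ℚ))) 1
        (((2 : ℤ) ^ b) • D.β' (Sum.inr (primesEquiv.symm ⟨ℓ, hℓp⟩))) = 0 := by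
      apply map_inclKD_restrictField_injective_of_kolPrime hΔ (hKol ℓ hℓ)
      rw [map_zero, map_inclKD_map_mulK_restrictField, smul_smul,
        show (((2 ^ L : ℕ) : ℤ)) * (2 : ℤ) ^ b = (2 : ℤ) ^ (b + L) by push_cast; ring, h0]
    -- `res_ℓ (2^b b') = 0` at level `m`
    have h2 : galoisCohomology.res (W.torsionGaloisModule ((2 ^ L : ℕ) : ℤ))
        (Place.Completion (Sum.inr (primesEquiv.symm ⟨ℓ, hℓp⟩) : Place ℚ)) 1 (((2 : ℤ) ^ b) • D.b') = 0 := by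
      rw [map_zsmul, ← D.map_β' (Sum.inr (primesEquiv.symm ⟨ℓ, hℓp⟩)), ← map_zsmul]
      exact h1
    -- `res_ℓ (ι (2^b t)) = 0` at level `m²`
    have h3 : galoisCohomology.res (W.torsionGaloisModule ((2 ^ L * 2 ^ L : ℕ) : ℤ))
        (Place.Completion (Sum.inr (primesEquiv.symm ⟨ℓ, hℓp⟩) : Place ℚ)) 1
        (torsionH1OfDvd W (lvl_dvd_sq L) (((2 : ℤ) ^ b) • t)) = 0 := by
      have e3 : torsionH1OfDvd W (lvl_dvd_sq L) (((2 : ℤ) ^ b) • t) =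
          galoisCohomology.map (inclKD W (2 ^ L) (2 ^ L)) 1 (((2 : ℤ) ^ b) • D.b') := by
        refine (map_zsmul _ _ _).trans (Eq.trans ?_ (map_zsmul _ _ _).symm)
        exact congrArg (fun z => ((2 : ℤ) ^ b) • z) hDt.symm
      rw [e3, galoisCohomology.res_map_one, h2, map_zero]
    have h4 : torsionH1OfDvd W (lvl_dvd_sq L) (((2 : ℤ) ^ b) • t) ∈
        W.torsionLocalKer (Place.Completion (Sum.inr (primesEquiv.symm ⟨ℓ, hℓp⟩) : Place ℚ))
          ((2 ^ L * 2 ^ L : ℕ) : ℤ) :=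
      (@mem_torsionLocalKer_iff_res_eq_zero ℚ _ W
        (Place.Completion (Sum.inr (primesEquiv.symm ⟨ℓ, hℓp⟩) : Place ℚ)) _ (Place.instAlgebraCompletion _) _ _
        (charZero_placeCompletion _) (2 ^ L * 2 ^ L) (NeZero.ne (2 ^ L * 2 ^ L)) _).mpr h3
    have h5 : ((2 : ℤ) ^ b) • t ∈
        W.torsionLocalKer (Place.Completion (Sum.inr (primesEquiv.symm ⟨ℓ, hℓp⟩) : Place ℚ)) (lvl (L + L)) :=
      (torsionH1OfDvd_mem_torsionLocalKer_iff_of_eq W _ (lvl_dvd_sq L) (lvl_add_eq_sq L) _).mp h4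
    exact (mem_a₁_iff hℓp _).mpr h5
  -- ### the exponents: `b + 1 ≤ L`, else (Y) contradicts `2^{2L} β' = 0`
  by_cases hbL : b + 1 ≤ L
  swap
  · exfalso
    apply hY
    have hkill : (2 ^ L * 2 ^ L) • D.β' (Sum.inr (primesEquiv.symm ⟨ℓ, hℓp⟩)) = 0 :=
      nsmul_continuousCohomology_one_eq_zero _ (2 ^ L * 2 ^ L)
        (fun P : geomTorsion W ((2 ^ L * 2 ^ L : ℕ) : ℤ) => AddSubgroup.torsionBy.nsmul P) _
    have e1 : (2 : ℤ) ^ (b + L) = (2 : ℤ) ^ (b + L - (L + L)) * ((2 ^ L * 2 ^ L : ℕ) : ℤ) := by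
      rw [Nat.cast_mul, Nat.cast_pow, Nat.cast_ofNat, ← pow_add, ← pow_add]
      congr 1
      omega
    rw [e1, mul_smul, natCast_zsmul, hkill, smul_zero]
  -- ### (X) `2^{a+L-N} res_ℓ b₁ ∉ 𝓛_ℓ`, and the generic lemma
  refine localTerm_canonical_ne_zero_of_kolPrime hΔ (hKol ℓ hℓ) (by omega) e hμ hadd₁ hadd₂ hgal halt hnondeg D
    (a := a + L - N) (b := b + L) ?_ hY (by omega)
  intro hmem
  apply hcm
  have epow : ((2 : ℤ) ^ (a + (j - N))) • c₁ (ℓ * m') =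
      ((2 : ℤ) ^ (a + L - N)) • (((2 : ℤ) ^ (j - L)) • c₁ (ℓ * m')) := by
    rw [smul_smul, ← pow_add (2 : ℤ) (a + L - N) (j - L), show a + L - N + (j - L) = a + (j - N) by omega]
  have h6 : torsionH1OfDvd W (lvl_dvd_sq L) (((2 : ℤ) ^ (a + (j - N))) • c₁ (ℓ * m')) ∈
      selmerLocalKer W ((primesEquiv.symm ⟨ℓ, hℓp⟩ : HeightOneSpectrum (𝓞 ℚ)).adicCompletion ℚ)
        ((2 ^ L * 2 ^ L : ℕ) : ℤ) := by
    refine mem_selmerLocalKer_of_mem_kummerLocalConditionAt_res W _ _ ?_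
    rw [epow, map_zsmul (torsionH1OfDvd W (lvl_dvd_sq L)) ((2 : ℤ) ^ (a + L - N)), ← hD₁]
    convert hmem using 1
    exact map_zsmul _ _ _
  have h7 : ((2 : ℤ) ^ (a + (j - N))) • c₁ (ℓ * m') ∈
      selmerLocalKer W ((primesEquiv.symm ⟨ℓ, hℓp⟩ : HeightOneSpectrum (𝓞 ℚ)).adicCompletion ℚ) (lvl (L + L)) :=
    (torsionH1OfDvd_mem_selmerLocalKer_iff W _ (lvl_dvd_sq L) _).mpr h6
  have h8 : ((2 : ℤ) ^ (a + (j - N))) • c₁ (ℓ * m') ∈ loc₁ W (L + L) (pl ℓ) := by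
    rw [pl_of_prime hℓp]; exact h7
  exact (h44₂₁ ℓ m' hℓ hsupp hodd (a + (j - N))).mp h8

/-- **`hloc₂` discharged** — McCallum's Lemma 5.3 for the local term at `λ` of the member `E^{(d_K)}` (the twin), in the cochain
currency of `selmer_eq_and_card_selmer_twin_eq_of_localTerms`, for `inv := LocalInvariants.canonical ℚ (2^L · 2^L)`:
from `2^b t ∉ a₂(ℓ)` ⇒ `2^{b+L} β'_ℓ ≠ 0` and `2^{a+j−N} c₁(m') ∉ a₁(ℓ)` ⇒ (Prop. 4.4) `2^{a+L−N} res_ℓ b₁ ∉ 𝓛_ℓ`,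
the orders multiply to more than `2^{2L}` and `localTerm_canonical_ne_zero_twin_of_kolPrime` concludes.
[cite: McCallumLMS1991, §4 Prop. 4.4 and Prop. 4.7, §5 Lemma 5.3, Thm. 5.4 (proof)] [cite: MilneADT2006, Ch. I §6, proof of Prop. 6.9] -/
theorem hloc₂_canonical_of_rel_of_kol [(twin W K).IsElliptic] {M₀ : ℕ} (c₁ : ℕ → galH1Torsion W (lvl (L + L)))
    (c₂ : ℕ → galH1Torsion (twin W K) (lvl (L + L))) (hK : IsImaginaryQuadratic K)
    (hoddK : Odd (NumberField.discr K)) (hΔ : W.Δ < 0) (hL : M₀ ≤ L) (hL1 : 1 ≤ L)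
    (Kol : ℕ → Prop) (hKol : ∀ ℓ, Kol ℓ → kolPrime W K (L + L) ℓ)
    -- McCallum's Prop. 4.4 ACROSS the members, even depth `m'` to odd depth `ℓm'`
    (h44₁₂ : ∀ ℓ m : ℕ, Kol ℓ → KolSupp Kol (ℓ * m) →
      Even m.primeFactors.card → ∀ a : ℕ,
        ((2 : ℤ) ^ a) • c₂ (ℓ * m) ∈ loc₂ W K (L + L) (pl ℓ) ↔ ((2 : ℤ) ^ a) • c₁ m ∈ a₁ W (L + L) ℓ)
    (e : geomTorsion (twin W K) ((2 ^ L * 2 ^ L : ℕ) : ℤ) → geomTorsion (twin W K) ((2 ^ L * 2 ^ L : ℕ) : ℤ) →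
      AlgebraicClosure ℚ)
    (hμ : ∀ S T, e S T ^ (2 ^ L * 2 ^ L) = 1)
    (hadd₁ : ∀ S₁ S₂ T, e (S₁ + S₂) T = e S₁ T * e S₂ T)
    (hadd₂ : ∀ S T₁ T₂, e S (T₁ + T₂) = e S T₁ * e S T₂)
    (hgal : ∀ (σ : absoluteGaloisGroup ℚ) (S T : geomTorsion (twin W K) ((2 ^ L * 2 ^ L : ℕ) : ℤ)),
      σ • e S T = e (σ • S) (σ • T))
    (halt : ∀ T, e T T = 1) (hnondeg : ∀ T, (∀ S, e S T = 1) → T = 0) :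
    ∀ ℓ m' : ℕ, (hℓ : Kol ℓ) → KolSupp Kol (ℓ * m') → ¬ ℓ ∣ m' →
      Even m'.primeFactors.card →
      ∀ (j N a b : ℕ) (t : galH1Torsion (twin W K) (lvl (L + L))), t ∈ selmerGroup (twin W K) (lvl (L + L)) →
      ((2 : ℤ) ^ j) • c₂ (ℓ * m') ∈ selmerGroup (twin W K) (lvl (L + L)) →
      ((2 : ℤ) ^ N) • t = 0 → ((2 : ℤ) ^ L) • t = 0 →
      (∀ q ∈ m'.primeFactors, t ∈ a₂ W K (L + L) q) → L + L - M₀ ≤ j → N + M₀ ≤ L + L → N ≤ j →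
      a + b + 1 = N → ((2 : ℤ) ^ (a + (j - N))) • c₁ m' ∉ a₁ W (L + L) ℓ →
      ((2 : ℤ) ^ b) • t ∉ a₂ W K (L + L) ℓ →
      ∀ D : FirstCaseData (twin W K) (2 ^ L),
        D.b₁ = torsionH1OfDvd (twin W K) (lvl_dvd_sq L) (((2 : ℤ) ^ (j - L)) • c₂ (ℓ * m')) →
        galoisCohomology.map (inclKD (twin W K) (2 ^ L) (2 ^ L)) 1 D.b' =
          torsionH1OfDvd (twin W K) (lvl_dvd_sq L) t →
        D.localTerm e hμ hadd₁ hadd₂ hgal (LocalInvariants.canonical ℚ (2 ^ L * 2 ^ L))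
          (Sum.inr (primesEquiv.symm ⟨ℓ, (hKol ℓ hℓ).1⟩)) ≠ 0 := by
  intro ℓ m' hℓ hsupp _hndvd heven j N a b t _ht _hz _hN _h2 _hAq hj hNM hNj hab hcm hbt D hD₁ hDt
  have hℓp : ℓ.Prime := (hKol ℓ hℓ).1
  haveI : Fact ℓ.Prime := ⟨hℓp⟩
  haveI : NeZero (2 ^ L) := ⟨pow_ne_zero L two_ne_zero⟩
  haveI : NeZero (2 ^ L * 2 ^ L) := ⟨by positivity⟩
  have hjL : L ≤ j := by omega
  -- ### (Y) `2^{b+L} β'_ℓ ≠ 0`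
  have hY : ((2 : ℤ) ^ (b + L)) • D.β' (Sum.inr (primesEquiv.symm ⟨ℓ, hℓp⟩)) ≠ 0 := by
    intro h0
    apply hbt
    letI : Algebra ℚ (Place.Completion (Sum.inr (primesEquiv.symm ⟨ℓ, hℓp⟩) : Place ℚ)) :=
      Place.instAlgebraCompletion _
    -- `[m]_* (2^b β') = 0` by `ι_* ∘ [m]_* = m` and the injectivity of `ι_*` over `ℚ_ℓ`
    have h1 : galoisCohomology.map ((mulK (twin W K) (2 ^ L) (2 ^ L)).restrictField
        (Place.Completion (Sum.inr (primesEquiv.symm ⟨ℓ, hℓp⟩) : Place ℚ))) 1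
        (((2 : ℤ) ^ b) • D.β' (Sum.inr (primesEquiv.symm ⟨ℓ, hℓp⟩))) = 0 := by
      apply map_inclKD_restrictField_injective_twin_of_kolPrime hK hoddK hΔ (hKol ℓ hℓ)
      rw [map_zero, map_inclKD_map_mulK_restrictField, smul_smul,
        show (((2 ^ L : ℕ) : ℤ)) * (2 : ℤ) ^ b = (2 : ℤ) ^ (b + L) by push_cast; ring, h0]
    -- `res_ℓ (2^b b') = 0` at level `m`
    have h2 : galoisCohomology.res ((twin W K).torsionGaloisModule ((2 ^ L : ℕ) : ℤ))
        (Place.Completion (Sum.inr (primesEquiv.symm ⟨ℓ, hℓp⟩) : Place ℚ)) 1 (((2 : ℤ) ^ b) • D.b') = 0 := by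
      rw [map_zsmul, ← D.map_β' (Sum.inr (primesEquiv.symm ⟨ℓ, hℓp⟩)), ← map_zsmul]
      exact h1
    -- `res_ℓ (ι (2^b t)) = 0` at level `m²`
    have h3 : galoisCohomology.res ((twin W K).torsionGaloisModule ((2 ^ L * 2 ^ L : ℕ) : ℤ))
        (Place.Completion (Sum.inr (primesEquiv.symm ⟨ℓ, hℓp⟩) : Place ℚ)) 1
        (torsionH1OfDvd (twin W K) (lvl_dvd_sq L) (((2 : ℤ) ^ b) • t)) = 0 := by
      have e3 : torsionH1OfDvd (twin W K) (lvl_dvd_sq L) (((2 : ℤ) ^ b) • t) =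
          galoisCohomology.map (inclKD (twin W K) (2 ^ L) (2 ^ L)) 1 (((2 : ℤ) ^ b) • D.b') := by
        refine (map_zsmul _ _ _).trans (Eq.trans ?_ (map_zsmul _ _ _).symm)
        exact congrArg (fun z => ((2 : ℤ) ^ b) • z) hDt.symm
      rw [e3, galoisCohomology.res_map_one, h2, map_zero]
    have h4 : torsionH1OfDvd (twin W K) (lvl_dvd_sq L) (((2 : ℤ) ^ b) • t) ∈
        (twin W K).torsionLocalKer (Place.Completion (Sum.inr (primesEquiv.symm ⟨ℓ, hℓp⟩) : Place ℚ))
          ((2 ^ L * 2 ^ L : ℕ) : ℤ) :=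
      (@mem_torsionLocalKer_iff_res_eq_zero ℚ _ (twin W K)
        (Place.Completion (Sum.inr (primesEquiv.symm ⟨ℓ, hℓp⟩) : Place ℚ)) _ (Place.instAlgebraCompletion _) _ _
        (charZero_placeCompletion _) (2 ^ L * 2 ^ L) (NeZero.ne (2 ^ L * 2 ^ L)) _).mpr h3
    have h5 : ((2 : ℤ) ^ b) • t ∈
        (twin W K).torsionLocalKer (Place.Completion (Sum.inr (primesEquiv.symm ⟨ℓ, hℓp⟩) : Place ℚ))
          (lvl (L + L)) :=
      (torsionH1OfDvd_mem_torsionLocalKer_iff_of_eq (twin W K) _ (lvl_dvd_sq L) (lvl_add_eq_sq L) _).mp h4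
    exact (mem_a₂_iff hℓp _).mpr h5
  -- ### the exponents: `b + 1 ≤ L`, else (Y) contradicts `2^{2L} β' = 0`
  by_cases hbL : b + 1 ≤ L
  swap
  · exfalso
    apply hY
    have hkill : (2 ^ L * 2 ^ L) • D.β' (Sum.inr (primesEquiv.symm ⟨ℓ, hℓp⟩)) = 0 :=
      nsmul_continuousCohomology_one_eq_zero _ (2 ^ L * 2 ^ L)
        (fun P : geomTorsion (twin W K) ((2 ^ L * 2 ^ L : ℕ) : ℤ) => AddSubgroup.torsionBy.nsmul P) _
    have e1 : (2 : ℤ) ^ (b + L) = (2 : ℤ) ^ (b + L - (L + L)) * ((2 ^ L * 2 ^ L : ℕ) : ℤ) := by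
      rw [Nat.cast_mul, Nat.cast_pow, Nat.cast_ofNat, ← pow_add, ← pow_add]
      congr 1
      omega
    rw [e1, mul_smul, natCast_zsmul, hkill, smul_zero]
  -- ### (X) `2^{a+L-N} res_ℓ b₁ ∉ 𝓛_ℓ`, and the generic lemma
  refine localTerm_canonical_ne_zero_twin_of_kolPrime hK hoddK hΔ (hKol ℓ hℓ) (by omega) e hμ hadd₁ hadd₂ hgal halt
    hnondeg D
    (a := a + L - N) (b := b + L) ?_ hY (by omega)
  intro hmem
  apply hcm
  have epow : ((2 : ℤ) ^ (a + (j - N))) • c₂ (ℓ * m') =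
      ((2 : ℤ) ^ (a + L - N)) • (((2 : ℤ) ^ (j - L)) • c₂ (ℓ * m')) := by
    rw [smul_smul, ← pow_add (2 : ℤ) (a + L - N) (j - L), show a + L - N + (j - L) = a + (j - N) by omega]
  have h6 : torsionH1OfDvd (twin W K) (lvl_dvd_sq L) (((2 : ℤ) ^ (a + (j - N))) • c₂ (ℓ * m')) ∈
      selmerLocalKer (twin W K) ((primesEquiv.symm ⟨ℓ, hℓp⟩ : HeightOneSpectrum (𝓞 ℚ)).adicCompletion ℚ)
        ((2 ^ L * 2 ^ L : ℕ) : ℤ) := by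
    refine mem_selmerLocalKer_of_mem_kummerLocalConditionAt_res (twin W K) _ _ ?_
    rw [epow, map_zsmul (torsionH1OfDvd (twin W K) (lvl_dvd_sq L)) ((2 : ℤ) ^ (a + L - N)), ← hD₁]
    convert hmem using 1
    exact map_zsmul _ _ _
  have h7 : ((2 : ℤ) ^ (a + (j - N))) • c₂ (ℓ * m') ∈
      selmerLocalKer (twin W K) ((primesEquiv.symm ⟨ℓ, hℓp⟩ : HeightOneSpectrum (𝓞 ℚ)).adicCompletion ℚ)
        (lvl (L + L)) :=
    (torsionH1OfDvd_mem_selmerLocalKer_iff (twin W K) _ (lvl_dvd_sq L) _).mpr h6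
  have h8 : ((2 : ℤ) ^ (a + (j - N))) • c₂ (ℓ * m') ∈ loc₂ W K (L + L) (pl ℓ) := by
    rw [pl_of_prime hℓp]; exact h7
  exact (h44₁₂ ℓ m' hℓ hsupp heven (a + (j - N))).mp h8

end Instance

end Summit.BirchSwinnertonDyer.BirchSwinnertonDyer.Theorems.KolyvaginPairDataTwo

end


set_option linter.dupNamespace false -- tree convention: `Summit.BirchSwinnertonDyer.BirchSwinnertonDyer.Theorems` (summit = sub-problem)
set_option autoImplicit false

noncomputable section

open scoped Classical
open scoped AddSubgroup

universe u

namespace Summit.BirchSwinnertonDyer.BirchSwinnertonDyer.Theorems.KolyvaginPairDataTwo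

open WeierstrassCurve NumberField IsDedekindDomain Field Function Rat.HeightOneSpectrum
open Literature.NumberTheory.EllipticCurves Literature.NumberTheory.GaloisRepresentations
open Literature.NumberTheory.GaloisCohomology
open Literature.NumberTheory.GaloisRepresentations.DiscreteGaloisModule (mu)
open Literature.NumberTheory.EllipticCurves.KolyvaginDescent
open Literature.GroupTheory.FiniteAbelian
open Summit.BirchSwinnertonDyer.BirchSwinnertonDyer.Theorems.GenusExact.VisiblePairAtTwo

section Canonical

variable {W : WeierstrassCurve ℚ} [W.IsElliptic] [W.IsGloballyMinimal] {K : Type} [Field K] [NumberField K]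
  {L : ℕ} [(twin W K).IsElliptic] [NeZero (2 ^ L * 2 ^ L)]

/-- **The member formula `hV₁` for THE Cassels–Tate pairing of `E` at level `2^L`, record-free, for an
arbitrary support predicate `Kol ≤ kolPrime W K (2L)` and with the kill clause `2^L • t = 0`** (McCallum
Prop. 4.7 + Lemma 5.3 over `ℚ` at `2`): `hV₁_of_localTerm_of_kol` ∘ `hloc₁_canonical_of_rel_of_kol` with Tate's
reciprocity and `Ш³(ℚ, μ) = 0` supplied. [cite: McCallumLMS1991, §4 Prop. 4.7, §5 Lemma 5.3, Thm. 5.4 (proof)]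
[cite: MilneADT2006, Ch. I Thm. 4.10 and §6 Prop. 6.9] -/
theorem hV₁_canonical_of_kol {M₀ : ℕ} (c₁ : ℕ → galH1Torsion W (lvl (L + L)))
    (c₂ : ℕ → galH1Torsion (twin W K) (lvl (L + L))) (hΔ : W.Δ < 0)
    (hρ2 : W.HasSurjectiveModNGaloisRep 2) (hL : M₀ ≤ L) (hL1 : 1 ≤ L)
    (Kol : ℕ → Prop) (hKol : ∀ ℓ, Kol ℓ → kolPrime W K (L + L) ℓ)
    (hkill : ∀ a ∈ W.sha, ((2 : ℤ) ^ (2 * L)) • a = 0 → ((2 : ℤ) ^ L) • a = 0)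
    (loc_c₁_fin : ∀ m, KolSupp Kol m → Even m.primeFactors.card →
      ∀ v : HeightOneSpectrum (𝓞 ℚ), (m : 𝓞 ℚ) ∉ v.asIdeal → c₁ m ∈ selmerLocalKer W (v.adicCompletion ℚ) (lvl (L + L)))
    (loc_c₁_inf : ∀ m, KolSupp Kol m → Even m.primeFactors.card →
      ∀ w : InfinitePlace ℚ, c₁ m ∈ selmerLocalKer W w.Completion (lvl (L + L)))
    (h44₂₁ : ∀ ℓ m : ℕ, Kol ℓ → KolSupp Kol (ℓ * m) →
      Odd m.primeFactors.card → ∀ a : ℕ,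
        ((2 : ℤ) ^ a) • c₁ (ℓ * m) ∈ loc₁ W (L + L) (pl ℓ) ↔ ((2 : ℤ) ^ a) • c₂ m ∈ a₂ W K (L + L) ℓ)
    (e : geomTorsion W ((2 ^ L * 2 ^ L : ℕ) : ℤ) → geomTorsion W ((2 ^ L * 2 ^ L : ℕ) : ℤ) → AlgebraicClosure ℚ)
    (hμ : ∀ S T, e S T ^ (2 ^ L * 2 ^ L) = 1)
    (hadd₁ : ∀ S₁ S₂ T, e (S₁ + S₂) T = e S₁ T * e S₂ T)
    (hadd₂ : ∀ S T₁ T₂, e S (T₁ + T₂) = e S T₁ * e S T₂)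
    (hgal : ∀ (σ : absoluteGaloisGroup ℚ) (S T : geomTorsion W ((2 ^ L * 2 ^ L : ℕ) : ℤ)),
      σ • e S T = e (σ • S) (σ • T))
    (halt : ∀ T, e T T = 1) (hnondeg : ∀ T, (∀ S, e S T = 1) → T = 0)
    (ι₁ : selmerGroup W (lvl (L + L)) →+ (W.sha)[(2 ^ L : ℕ)])
    (hι₁ : ∀ z, shaTorsionVal W (2 ^ L) (ι₁ z) = torsionH1ToH1 W (lvl (L + L)) z) :
    ∀ ℓ m' : ℕ, Kol ℓ → KolSupp Kol (ℓ * m') → ¬ ℓ ∣ m' →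
      Odd m'.primeFactors.card →
      ∀ (j N a b : ℕ) (t : galH1Torsion W (lvl (L + L))) (ht : t ∈ selmerGroup W (lvl (L + L)))
        (hz : ((2 : ℤ) ^ j) • c₁ (ℓ * m') ∈ selmerGroup W (lvl (L + L))),
      ((2 : ℤ) ^ N) • t = 0 → ((2 : ℤ) ^ L) • t = 0 →
      (∀ q ∈ m'.primeFactors, t ∈ a₁ W (L + L) q) → L + L - M₀ ≤ j →
      N + M₀ ≤ L + L → N ≤ j → a + b + 1 = N →
      ((2 : ℤ) ^ (a + (j - N))) • c₂ m' ∉ a₂ W K (L + L) ℓ →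
      ((2 : ℤ) ^ b) • t ∉ a₁ W (L + L) ℓ →
      ((ctLevelPairing W (2 ^ L) e hμ hadd₁ hadd₂ hgal (LocalInvariants.canonical ℚ (2 ^ L * 2 ^ L)) halt
        (sumInvLocalizationEqZero_canonical_of_numberField ℚ (2 ^ L * 2 ^ L)) (shaThree_mu_eq_zero ℚ (2 ^ L * 2 ^ L))
        (localTerm_finite_support (W := W) (m := 2 ^ L) (e := e) (hμ := hμ) (hadd₁ := hadd₁) (hadd₂ := hadd₂)
          (hgal := hgal) halt (LocalInvariants.canonical ℚ (2 ^ L * 2 ^ L)))).comp ι₁).compl₂ ι₁ ⟨_, hz⟩ ⟨t, ht⟩ ≠ 0 := by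
  exact hV₁_of_localTerm_of_kol c₁ c₂ hΔ hρ2 hL Kol hKol hkill loc_c₁_fin loc_c₁_inf e hμ hadd₁ hadd₂
    hgal halt
    (LocalInvariants.canonical ℚ (2 ^ L * 2 ^ L))
    (sumInvLocalizationEqZero_canonical_of_numberField ℚ (2 ^ L * 2 ^ L))
    (shaThree_mu_eq_zero ℚ (2 ^ L * 2 ^ L)) ι₁ hι₁
    (hloc₁_canonical_of_rel_of_kol c₁ c₂ hΔ hL hL1 Kol hKol h44₂₁ e hμ hadd₁ hadd₂ hgal halt hnondeg)

/-- **The member formula `hV₂` for THE Cassels–Tate pairing of `E^{(d_K)}` at level `2^L`, record-free, for an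
arbitrary support predicate `Kol` and with the kill clause `2^L • t = 0`**:
`hV₂_of_localTerm_of_kol` ∘ `hloc₂_canonical_of_rel_of_kol` with Tate's reciprocity and `Ш³(ℚ, μ) = 0` supplied.
[cite: McCallumLMS1991, §4 Prop. 4.7, §5 Lemma 5.3, Thm. 5.4 (proof)] [cite: MilneADT2006, Ch. I Thm. 4.10 and §6 Prop. 6.9] -/
theorem hV₂_canonical_of_kol {M₀ : ℕ} (c₁ : ℕ → galH1Torsion W (lvl (L + L)))
    (c₂ : ℕ → galH1Torsion (twin W K) (lvl (L + L))) (hK : IsImaginaryQuadratic K)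
    (hoddK : Odd (NumberField.discr K)) (hΔ : W.Δ < 0)
    (hρ2 : W.HasSurjectiveModNGaloisRep 2) (hL : M₀ ≤ L) (hL1 : 1 ≤ L)
    (Kol : ℕ → Prop) (hKol : ∀ ℓ, Kol ℓ → kolPrime W K (L + L) ℓ)
    (hkill : ∀ a ∈ (twin W K).sha, ((2 : ℤ) ^ (2 * L)) • a = 0 → ((2 : ℤ) ^ L) • a = 0)
    (loc_c₂_fin : ∀ m, KolSupp Kol m → Odd m.primeFactors.card →
      ∀ v : HeightOneSpectrum (𝓞 ℚ), (m : 𝓞 ℚ) ∉ v.asIdeal →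
        c₂ m ∈ selmerLocalKer (twin W K) (v.adicCompletion ℚ) (lvl (L + L)))
    (loc_c₂_inf : ∀ m, KolSupp Kol m → Odd m.primeFactors.card →
      ∀ w : InfinitePlace ℚ, c₂ m ∈ selmerLocalKer (twin W K) w.Completion (lvl (L + L)))
    (h44₁₂ : ∀ ℓ m : ℕ, Kol ℓ → KolSupp Kol (ℓ * m) →
      Even m.primeFactors.card → ∀ a : ℕ,
        ((2 : ℤ) ^ a) • c₂ (ℓ * m) ∈ loc₂ W K (L + L) (pl ℓ) ↔ ((2 : ℤ) ^ a) • c₁ m ∈ a₁ W (L + L) ℓ)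
    (e : geomTorsion (twin W K) ((2 ^ L * 2 ^ L : ℕ) : ℤ) → geomTorsion (twin W K) ((2 ^ L * 2 ^ L : ℕ) : ℤ) →
      AlgebraicClosure ℚ)
    (hμ : ∀ S T, e S T ^ (2 ^ L * 2 ^ L) = 1)
    (hadd₁ : ∀ S₁ S₂ T, e (S₁ + S₂) T = e S₁ T * e S₂ T)
    (hadd₂ : ∀ S T₁ T₂, e S (T₁ + T₂) = e S T₁ * e S T₂)
    (hgal : ∀ (σ : absoluteGaloisGroup ℚ) (S T : geomTorsion (twin W K) ((2 ^ L * 2 ^ L : ℕ) : ℤ)),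
      σ • e S T = e (σ • S) (σ • T))
    (halt : ∀ T, e T T = 1) (hnondeg : ∀ T, (∀ S, e S T = 1) → T = 0)
    (ι₂ : selmerGroup (twin W K) (lvl (L + L)) →+ ((twin W K).sha)[(2 ^ L : ℕ)])
    (hι₂ : ∀ z, shaTorsionVal (twin W K) (2 ^ L) (ι₂ z) = torsionH1ToH1 (twin W K) (lvl (L + L)) z) :
    ∀ ℓ m' : ℕ, Kol ℓ → KolSupp Kol (ℓ * m') → ¬ ℓ ∣ m' →
      Even m'.primeFactors.card →
      ∀ (j N a b : ℕ) (t : galH1Torsion (twin W K) (lvl (L + L))) (ht : t ∈ selmerGroup (twin W K) (lvl (L + L)))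
        (hz : ((2 : ℤ) ^ j) • c₂ (ℓ * m') ∈ selmerGroup (twin W K) (lvl (L + L))),
      ((2 : ℤ) ^ N) • t = 0 → ((2 : ℤ) ^ L) • t = 0 →
      (∀ q ∈ m'.primeFactors, t ∈ a₂ W K (L + L) q) → L + L - M₀ ≤ j →
      N + M₀ ≤ L + L → N ≤ j → a + b + 1 = N →
      ((2 : ℤ) ^ (a + (j - N))) • c₁ m' ∉ a₁ W (L + L) ℓ →
      ((2 : ℤ) ^ b) • t ∉ a₂ W K (L + L) ℓ →
      ((ctLevelPairing (twin W K) (2 ^ L) e hμ hadd₁ hadd₂ hgal (LocalInvariants.canonical ℚ (2 ^ L * 2 ^ L)) halt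
        (sumInvLocalizationEqZero_canonical_of_numberField ℚ (2 ^ L * 2 ^ L)) (shaThree_mu_eq_zero ℚ (2 ^ L * 2 ^ L))
        (localTerm_finite_support (W := twin W K) (m := 2 ^ L) (e := e) (hμ := hμ) (hadd₁ := hadd₁)
          (hadd₂ := hadd₂) (hgal := hgal) halt (LocalInvariants.canonical ℚ (2 ^ L * 2 ^ L)))).comp ι₂).compl₂ ι₂ ⟨_, hz⟩ ⟨t, ht⟩ ≠ 0 := by
  exact hV₂_of_localTerm_of_kol c₁ c₂ hK hoddK hΔ hρ2 hL Kol hKol hkill loc_c₂_fin loc_c₂_inf e hμ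
    hadd₁ hadd₂ hgal halt
    (LocalInvariants.canonical ℚ (2 ^ L * 2 ^ L))
    (sumInvLocalizationEqZero_canonical_of_numberField ℚ (2 ^ L * 2 ^ L))
    (shaThree_mu_eq_zero ℚ (2 ^ L * 2 ^ L)) ι₂ hι₂
    (hloc₂_canonical_of_rel_of_kol c₁ c₂ hK hoddK hΔ hL hL1 Kol hKol h44₁₂ e hμ hadd₁ hadd₂ hgal halt
      hnondeg)

end Canonical

end Summit.BirchSwinnertonDyer.BirchSwinnertonDyer.Theorems.KolyvaginPairDataTwo

end


noncomputable section

open scoped Classical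
open scoped AddSubgroup

universe u

namespace Literature.NumberTheory.EllipticCurves

open _root_.WeierstrassCurve Field Function NumberField
open Literature.NumberTheory.GaloisRepresentations Literature.NumberTheory.GaloisCohomology
open Literature.NumberTheory.GaloisRepresentations.DiscreteGaloisModule (mu)

variable {K : Type u} [Field K] [NumberField K] (W : WeierstrassCurve K) [W.IsElliptic] (m : ℕ) [NeZero m]
variable (e : geomTorsion W ((m * m : ℕ) : ℤ) → geomTorsion W ((m * m : ℕ) : ℤ) → AlgebraicClosure K)
  (hμ : ∀ S T, e S T ^ (m * m) = 1)
  (hadd₁ : ∀ S₁ S₂ T, e (S₁ + S₂) T = e S₁ T * e S₂ T)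
  (hadd₂ : ∀ S T₁ T₂, e S (T₁ + T₂) = e S T₁ * e S T₂)
  (hgal : ∀ (σ : absoluteGaloisGroup K) (S T : geomTorsion W ((m * m : ℕ) : ℤ)), σ • e S T = e (σ • S) (σ • T))
  (inv : LocalInvariants K (m * m)) (halt : ∀ T, e T T = 1) (hPT' : inv.SumInvLocalizationEqZero)
  (hH3 : ∀ c : galoisCohomology (mu K (m * m)) 3,
    (∀ v : Place K, galoisCohomology.localization (mu K (m * m)) v 3 c = 0) → c = 0)
  (hfin : ∀ D : GeneralCaseData W m e hμ hadd₁ hadd₂ hgal, ∃ S : Finset (Place K), ∀ v ∉ S, D.localTerm inv v = 0)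

/-- **The level-`m` Cassels–Tate pairing is alternating**: `B_m(x, x) = 0` for `x ∈ Ш(E/K)[m]` — Cassels'
theorem `ctGeneralFun_self_eq_zero` read through `B_m = zmodToCircle ∘ ctGeneralFun` (`ctLevelPairing_apply`).
[cite: Cassels1962ArithmeticIV, §1 (the pairing on Ш of an elliptic curve is alternating)] [cite: MilneADT2006, Ch. I §6, Prop. 6.9] -/
theorem ctLevelPairing_self_eq_zero (x : (W.sha)[m]) :
    ctLevelPairing W m e hμ hadd₁ hadd₂ hgal inv halt hPT' hH3 hfin x x = 0 := by
  rw [ctLevelPairing_apply, ctGeneralFun_self_eq_zero halt inv hPT' hH3 (shaTorsionVal_mem W m x)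
    (zsmul_shaTorsionVal W m x), map_zero]

end Literature.NumberTheory.EllipticCurves

end


-- single-conjunct summit: `Summit.BirchSwinnertonDyer.BirchSwinnertonDyer.…` repeats the name by design
set_option linter.dupNamespace false
set_option autoImplicit false

noncomputable section

open scoped Classical
open WeierstrassCurve NumberField IsDedekindDomain Field Rat.HeightOneSpectrum
open Literature.NumberTheory.GaloisRepresentations
open Literature.NumberTheory.EllipticCurves Literature.NumberTheory.EllipticCurves.KolyvaginDescent
open Summit.BirchSwinnertonDyer.BirchSwinnertonDyer.Theorems.GenusExact.EigenClassesFinite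
open Summit.BirchSwinnertonDyer.BirchSwinnertonDyer.Theorems.GenusExact.VisiblePairAtTwo
open Summit.BirchSwinnertonDyer.BirchSwinnertonDyer.Theorems.GenusExact.TwinGrossPrimes
open Summit.BirchSwinnertonDyer.Rank1Residual.X11b.Three.Koly.Method2 (LocalFrob.inertiaDeg_eq_two_of_isPrime_span)

namespace Summit.BirchSwinnertonDyer.BirchSwinnertonDyer.Theorems.KolyvaginPairDataTwo

variable {N : ℕ} (W : WeierstrassCurve ℚ) {K : Type} [Field K] [NumberField K]

/-! ## The place `λ` of a Kolyvagin prime lies over `v_ℓ` with residue degree `2` -/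

/-- For a Gross-form Kolyvagin prime `ℓ`: `(ℓ) ∈ v_ℓ`, `λ = IsKolyvaginPrime.place` lies over `v_ℓ`, and its
residue degree is `2` (`K` quadratic, `(ℓ)` prime in `𝓞_K`). [cite: GrossLMS1991, §3 (3.1)–(3.2)] -/
theorem place_liesOver_and_inertiaDeg {ℓ : ℕ} (h2 : Module.finrank ℚ K = 2)
    (hℓ : IsKolyvaginPrime N W K 2 ℓ) :
    (ℓ : 𝓞 ℚ) ∈ (primesEquiv.symm ⟨ℓ, hℓ.prime⟩ : HeightOneSpectrum (𝓞 ℚ)).asIdeal ∧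
      hℓ.place.asIdeal.LiesOver (primesEquiv.symm ⟨ℓ, hℓ.prime⟩ : HeightOneSpectrum (𝓞 ℚ)).asIdeal ∧
      hℓ.place.asIdeal.inertiaDeg (𝓞 ℚ) = 2 := by
  have hℓp : ℓ.Prime := hℓ.prime
  set vℓ : HeightOneSpectrum (𝓞 ℚ) := hℓ.place.under (𝓞 ℚ) with hvℓ
  have hℓvℓ : (ℓ : 𝓞 ℚ) ∈ vℓ.asIdeal := by
    change (ℓ : 𝓞 ℚ) ∈ (hℓ.place.asIdeal.comap (algebraMap (𝓞 ℚ) (𝓞 K)))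
    rw [Ideal.mem_comap, map_natCast]
    exact hℓ.mem_place
  have hvℓeq : vℓ = primesEquiv.symm ⟨ℓ, hℓp⟩ := (natCast_prime_mem_iff_eq hℓp vℓ).mp hℓvℓ
  have hLO : hℓ.place.asIdeal.LiesOver vℓ.asIdeal := ⟨rfl⟩
  rw [hvℓeq] at hℓvℓ hLO
  exact ⟨hℓvℓ, hLO, LocalFrob.inertiaDeg_eq_two_of_isPrime_span K h2 hℓp hℓ.2.2.2.2.1 hℓ.place hℓ.mem_place⟩

/-! ## Member `E`: the dictionary at `λ` -/

/-- **Member `E` at a Kolyvagin prime**: `x ∈ torsionLocalKer_ℓ(E/ℚ) ⟺ res x ∈ torsionLocalKer_λ(E/K)`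
(`Δ < 0`, good reduction at `ℓ`, `Frob_ℓ ∼ τ` on `E[2^M]`, `1 ≤ M`; no image hypothesis).
[cite: McCallumLMS1991, §4 Prop. 4.4] [cite: GrossLMS1991, Prop. 9.6] -/
theorem mem_torsionLocalKer_iff_resTorsion_mem_place [NeZero N] [W.IsElliptic] (hΔ : W.Δ < 0)
    (h2 : Module.finrank ℚ K = 2) {θ : K} (hθ : θ ∉ Set.range (algebraMap ℚ K))
    (hd : θ ^ 2 = algebraMap ℚ K ((NumberField.discr K : ℤ) : ℚ)) {M : ℕ} (hM : 1 ≤ M)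
    {ℓ : ℕ} (hℓ : IsKolyvaginPrime N W K 2 ℓ) (hgood : (haveI : Fact ℓ.Prime := ⟨hℓ.prime⟩;
      W.HasGoodReductionAtPrime ℓ)) (hℓM : FrobEqFrobInfty W K (2 ^ M) ℓ)
    (x : galH1Torsion W (lvl M)) :
    x ∈ W.torsionLocalKer ((primesEquiv.symm ⟨ℓ, hℓ.prime⟩ : HeightOneSpectrum (𝓞 ℚ)).adicCompletion ℚ)
        (lvl M) ↔
      resTorsion W K (lvl M) x ∈ (W.baseChange K).torsionLocalKer (hℓ.place.adicCompletion K) (lvl M) := by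
  have hℓp : ℓ.Prime := hℓ.prime
  obtain ⟨hℓv, hLO, hf2⟩ := place_liesOver_and_inertiaDeg W h2 hℓ
  haveI := hLO
  haveI : Fact ℓ.Prime := ⟨hℓp⟩
  have hgoodv : W.HasGoodReductionAt (primesEquiv.symm ⟨ℓ, hℓp⟩ : HeightOneSpectrum (𝓞 ℚ)) :=
    (hasGoodReductionAtPrime_primesEquiv_iff_holds W _ ℓ (primesEquiv_eq_of_natCast_mem hℓp hℓv)).mp hgood
  have hcv : ((NumberField.discr K : ℤ) : 𝓞 ℚ) ∉
      (primesEquiv.symm ⟨ℓ, hℓp⟩ : HeightOneSpectrum (𝓞 ℚ)).asIdeal :=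
    intCast_notMem_of_not_dvd hℓp hℓv hℓ.2.2.1
  have h := GenusExact.SelmerDescent.zsmul_mem_torsionLocalKer_iff_resTorsion_of_notMem W hΔ hM rfl hℓp hℓ.2.2.2.1 hℓv
    hgoodv h2 (not_mem_range hθ) hd hcv hℓM hℓ.place hf2 x 1
  rwa [one_zsmul, one_zsmul] at h

/-! ## Member `E^{(d_K)}`: the dictionary for the twin, then `ψ` -/

/-- **Member `E^{(d_K)}` at a Kolyvagin prime**: `y ∈ torsionLocalKer_ℓ(E^{(d_K)}/ℚ) ⟺ ψ(res y) ∈ torsionLocalKer_λ(E/K)`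
(the twin inherits `Δ < 0`, good reduction at `ℓ ∤ d_K` and `Frob_ℓ ∼ τ`; then `hPsiKT` respects the strict
kernels). [cite: McCallumLMS1991, §4 Prop. 4.4] [cite: Kolyvagin1989Izv, §3] [cite: SilvermanAEC2009, X.5 Cor. 5.4] -/
theorem mem_torsionLocalKer_twin_iff_hPsiKT_mem_place [NeZero N] [W.IsElliptic] [(twin W K).IsElliptic]
    (hK : IsImaginaryQuadratic K) (hodd : Odd (NumberField.discr K)) (hΔ : W.Δ < 0)
    (h2 : Module.finrank ℚ K = 2) {θ : K} (hθ : θ ∉ Set.range (algebraMap ℚ K))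
    (hd : θ ^ 2 = algebraMap ℚ K ((NumberField.discr K : ℤ) : ℚ)) {M : ℕ} (hM : 1 ≤ M)
    {ℓ : ℕ} (hℓ : IsKolyvaginPrime N W K 2 ℓ) (hgood : (haveI : Fact ℓ.Prime := ⟨hℓ.prime⟩;
      W.HasGoodReductionAtPrime ℓ)) (hℓM : FrobEqFrobInfty W K (2 ^ M) ℓ)
    (y : galH1Torsion (twin W K) (lvl M)) :
    y ∈ (twin W K).torsionLocalKer
        ((primesEquiv.symm ⟨ℓ, hℓ.prime⟩ : HeightOneSpectrum (𝓞 ℚ)).adicCompletion ℚ) (lvl M) ↔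
      hPsiKT W K hθ hd (lvl M) (resTorsion (twin W K) K (lvl M) y) ∈
        (W.baseChange K).torsionLocalKer (hℓ.place.adicCompletion K) (lvl M) := by
  have hℓp : ℓ.Prime := hℓ.prime
  haveI : Fact ℓ.Prime := ⟨hℓp⟩
  obtain ⟨hℓv, hLO, hf2⟩ := place_liesOver_and_inertiaDeg W h2 hℓ
  haveI := hLO
  have hdQ : ((NumberField.discr K : ℤ) : ℚ) ≠ 0 := by exact_mod_cast NumberField.discr_ne_zero K
  have hC1 : (1 : VariableChange ℚ) • W.quadraticTwist ((NumberField.discr K : ℤ) : ℚ) = twin W K :=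
    one_smul _ _
  have hΔ' : (twin W K).Δ < 0 := Δ_neg_of_smul_quadraticTwist_eq W hdQ (twin W K) hC1 hΔ
  have hgood' : (twin W K).HasGoodReductionAtPrime ℓ :=
    hasGoodReductionAtPrime_of_smul_quadraticTwist_eq W h2 hodd (twin W K) hC1 hℓ.2.2.1 hgood
  have hgoodv : (twin W K).HasGoodReductionAt (primesEquiv.symm ⟨ℓ, hℓp⟩ : HeightOneSpectrum (𝓞 ℚ)) :=
    (hasGoodReductionAtPrime_primesEquiv_iff_holds (twin W K) _ ℓ (primesEquiv_eq_of_natCast_mem hℓp hℓv)).mp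
      hgood'
  have hℓM' : FrobEqFrobInfty (twin W K) K (2 ^ M) ℓ :=
    frobEqFrobInfty_of_smul_quadraticTwist_eq W hK (twin W K) hC1 hℓM
  have hcv : ((NumberField.discr K : ℤ) : 𝓞 ℚ) ∉
      (primesEquiv.symm ⟨ℓ, hℓp⟩ : HeightOneSpectrum (𝓞 ℚ)).asIdeal :=
    intCast_notMem_of_not_dvd hℓp hℓv hℓ.2.2.1
  have h := GenusExact.SelmerDescent.zsmul_mem_torsionLocalKer_iff_resTorsion_of_notMem (twin W K) hΔ' hM rfl hℓp
    hℓ.2.2.2.1 hℓv hgoodv h2 (not_mem_range hθ) hd hcv hℓM' hℓ.place hf2 y 1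
  rw [one_zsmul, one_zsmul] at h
  rw [h]
  exact mem_torsionLocalKer_iff_hPsiKT_mem W K hθ hd (lvl M) (hℓ.place.adicCompletion K)
    (resTorsion (twin W K) K (lvl M) y)

/-! ## `hA` -/

/-- **`hA` for the `ℚ`-pair carrier**: for two-member data `D` with `D.A₁ = a₁ W M`, `D.A₂ = a₂ W K M` and
`f` with `(f v).1 = res v.1`, `(f v).2 = ψ (res v.2)`, at every Gross-form Kolyvagin prime `ℓ` of good
reduction with `Frob_ℓ ∼ τ` on `E[2^M]`: `v ∈ D.toSplitData.A ℓ ⟺ f v ∈ pairA ℓ`.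
[cite: McCallumLMS1991, §3 (3), §4 Prop. 4.4] [cite: Kolyvagin1989Izv, §3] -/
theorem mem_toSplitData_A_iff_mem_pairA [NeZero N] [W.IsElliptic] [(twin W K).IsElliptic]
    (hK : IsImaginaryQuadratic K) (hodd : Odd (NumberField.discr K)) (hΔ : W.Δ < 0)
    (h2 : Module.finrank ℚ K = 2) {θ : K} (hθ : θ ∉ Set.range (algebraMap ℚ K))
    (hd : θ ^ 2 = algebraMap ℚ K ((NumberField.discr K : ℤ) : ℚ)) {M : ℕ} (hM : 1 ≤ M)
    {Pl : Type*} (D : PairDataM (galH1Torsion W (lvl M)) (galH1Torsion (twin W K) (lvl M)) Pl)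
    (hDA₁ : D.A₁ = a₁ W M) (hDA₂ : D.A₂ = a₂ W K M)
    (f : galH1Torsion W (lvl M) × galH1Torsion (twin W K) (lvl M) →+ PairV W (sigmaQ K h2 hθ hd) M 1)
    (hf₁ : ∀ v, ((f v).1 : galH1Torsion (W.baseChange K) ((2 ^ M : ℕ) : ℤ)) = resTorsion W K (lvl M) v.1)
    (hf₂ : ∀ v, ((f v).2 : galH1Torsion (W.baseChange K) ((2 ^ M : ℕ) : ℤ)) =
      hPsiKT W K hθ hd (lvl M) (resTorsion (twin W K) K (lvl M) v.2))
    {ℓ : ℕ} (hℓ : IsKolyvaginPrime N W K 2 ℓ) (hgood : (haveI : Fact ℓ.Prime := ⟨hℓ.prime⟩;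
      W.HasGoodReductionAtPrime ℓ)) (hℓM : FrobEqFrobInfty W K (2 ^ M) ℓ)
    (v : galH1Torsion W (lvl M) × galH1Torsion (twin W K) (lvl M)) :
    v ∈ D.toSplitData.A ℓ ↔ f v ∈ pairA (N := N) W (sigmaQ K h2 hθ hd) M 1 ℓ := by
  rw [PairDataM.mem_toSplitData_A_iff, hDA₁, hDA₂, mem_a₁_iff hℓ.prime, mem_a₂_iff hℓ.prime,
    mem_pairA_iff W (sigmaQ K h2 hθ hd) M hℓ, hf₁, hf₂,
    mem_torsionLocalKer_iff_resTorsion_mem_place W hΔ h2 hθ hd hM hℓ hgood hℓM,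
    mem_torsionLocalKer_twin_iff_hPsiKT_mem_place W hK hodd hΔ h2 hθ hd hM hℓ hgood hℓM]

end Summit.BirchSwinnertonDyer.BirchSwinnertonDyer.Theorems.KolyvaginPairDataTwo

end


-- single-conjunct summit: `Summit.BirchSwinnertonDyer.BirchSwinnertonDyer.…` repeats the name by design
set_option linter.dupNamespace false
set_option autoImplicit false

noncomputable section

open scoped Classical
open scoped AddSubgroup

universe u

namespace Summit.BirchSwinnertonDyer.BirchSwinnertonDyer.Theorems.KolyvaginPairDataTwo

open WeierstrassCurve NumberField Field
open Literature.NumberTheory.EllipticCurves Literature.NumberTheory.GaloisRepresentations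

variable {K : Type u} [Field K] [NumberField K] (W : WeierstrassCurve K) {L : ℕ}

/-- **`ι : Sel_{2^{2L}}(E/K) → Ш(E/K)[2^L]` is surjective** for every `ι` lifting `H¹(K, E[2^{2L}]) → H¹(K, E)`:
an element of `Ш[2^L]` is killed by `2^{2L}`, hence is the image of a `2^{2L}`-Selmer class (Kummer exactness).
[cite: SilvermanAEC2009, Thm. X.4.2 (a)] -/
theorem selmerToSha_surjective
    (ι : selmerGroup W ((2 ^ (L + L) : ℕ) : ℤ) →+ (W.sha)[(2 ^ L : ℕ)])
    (hι : ∀ z, shaTorsionVal W (2 ^ L) (ι z) = torsionH1ToH1 W ((2 ^ (L + L) : ℕ) : ℤ) z) :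
    Function.Surjective ι := by
  intro a
  have hn : ((2 ^ (L + L) : ℕ) : ℤ) ≠ 0 := by positivity
  -- `a ∈ Ш ∩ H¹(K, E)[2^{2L}]`
  have h2 : shaTorsionVal W (2 ^ L) a ∈ (W.galH1)[((2 ^ (L + L) : ℕ) : ℤ)] := by
    rw [AddSubgroup.torsionBy.nsmul_iff, pow_add, mul_nsmul]
    have h0 : (2 ^ L) • shaTorsionVal W (2 ^ L) a = 0 := by
      rw [← natCast_zsmul]
      exact zsmul_shaTorsionVal W (2 ^ L) a
    rw [h0, nsmul_zero]
  have ha : shaTorsionVal W (2 ^ L) a ∈ W.sha ⊓ (W.galH1)[((2 ^ (L + L) : ℕ) : ℤ)] :=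
    AddSubgroup.mem_inf.mpr ⟨shaTorsionVal_mem W (2 ^ L) a, h2⟩
  rw [← Literature.NumberTheory.EllipticCurves.map_torsionH1ToH1_selmerGroup_holds W hn, AddSubgroup.mem_map] at ha
  obtain ⟨z, hz, hza⟩ := ha
  refine ⟨⟨z, hz⟩, ?_⟩
  apply Subtype.ext
  apply Subtype.ext
  change shaTorsionVal W (2 ^ L) (ι ⟨z, hz⟩) = shaTorsionVal W (2 ^ L) a
  rw [hι]
  exact hza

/-- **If `ι` is injective then `2^L · Sel_{2^{2L}}(E/K) = 0`** (`Ш[2^L]` is killed by `2^L`).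
[cite: MilneADT2006, Ch. I §6 Prop. 6.9] -/
theorem two_pow_smul_eq_zero_of_selmerToSha_injective
    (ι : selmerGroup W ((2 ^ (L + L) : ℕ) : ℤ) →+ (W.sha)[(2 ^ L : ℕ)]) (hinj : Function.Injective ι) :
    ∀ v : selmerGroup W ((2 ^ (L + L) : ℕ) : ℤ), 2 ^ L • v = 0 := by
  intro v
  apply hinj
  rw [map_nsmul, map_zero]
  exact AddSubgroup.torsionBy.nsmul (ι v)

/-- **If `ι` is bijective and `B` is nondegenerate on `Ш[2^L]`, then `B ∘ (ι × ι)` is nondegenerate on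
`Sel_{2^{2L}}`.** [cite: MilneADT2006, Ch. I §6 Prop. 6.9, Thm. 6.13 (a)] -/
theorem nondegenerate_pullback_of_selmerToSha_bijective {R : Type*} [AddCommGroup R]
    (ι : selmerGroup W ((2 ^ (L + L) : ℕ) : ℤ) →+ (W.sha)[(2 ^ L : ℕ)]) (hinj : Function.Injective ι)
    (hsurj : Function.Surjective ι) (B : (W.sha)[(2 ^ L : ℕ)] →+ (W.sha)[(2 ^ L : ℕ)] →+ R)
    (hBnd : ∀ a, (∀ b, B a b = 0) → a = 0) :
    ∀ v : selmerGroup W ((2 ^ (L + L) : ℕ) : ℤ), (∀ w, B (ι v) (ι w) = 0) → v = 0 := by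
  intro v hv
  apply hinj
  rw [map_zero]
  refine hBnd (ι v) fun b ↦ ?_
  obtain ⟨w, rfl⟩ := hsurj b
  exact hv w

end Summit.BirchSwinnertonDyer.BirchSwinnertonDyer.Theorems.KolyvaginPairDataTwo

end



-- single-conjunct summit: `Summit.BirchSwinnertonDyer.BirchSwinnertonDyer.…` repeats the name by design
set_option linter.dupNamespace false
set_option autoImplicit false

noncomputable section

open scoped Classical
open scoped AddSubgroup
open WeierstrassCurve NumberField IsDedekindDomain Field Function Rat.HeightOneSpectrum
open Literature.NumberTheory.GaloisRepresentations
open Literature.NumberTheory.GaloisCohomology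
open Literature.NumberTheory.EllipticCurves Literature.NumberTheory.EllipticCurves.KolyvaginDescent
open Summit.BirchSwinnertonDyer.BirchSwinnertonDyer.Theorems.GenusExact.EigenClassesFinite
open Summit.BirchSwinnertonDyer.BirchSwinnertonDyer.Theorems.GenusExact.VisiblePairAtTwo
open Summit.BirchSwinnertonDyer.Rank1Residual.X11b.Three.Koly.Method2
  (LocalFrob.inertiaDeg_eq_two_of_isPrime_span LocalFrob.hasGoodReductionAt_rat_of_not_dvd_conductorNorm)

namespace Summit.BirchSwinnertonDyer.BirchSwinnertonDyer.Theorems.KolyvaginPairDataTwo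

variable {N : ℕ} (W : WeierstrassCurve ℚ) {K : Type} [Field K] [NumberField K]

/-! ## The member formulas' inputs read off the two-member data -/

/-- Lemma 4.3 over `ℚ` and Prop. 4.4 across, in gk2's currency, FROM the fields of two-member data `D`
whose local conditions, divisibility, places and strict conditions are `loc₁/loc₂`, `Dv`, `pl`, `a₁/a₂` and
whose prime is `2`. [cite: McCallumLMS1991, §4 Lemma 4.3, Prop. 4.4] -/
theorem memberInputs_of_pairData {M : ℕ}
    (D : PairDataM (galH1Torsion W (lvl M)) (galH1Torsion (twin W K) (lvl M))
      (HeightOneSpectrum (𝓞 ℚ) ⊕ InfinitePlace ℚ))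
    (hDp : D.p = 2) (hDLoc₁ : D.Loc₁ = loc₁ W M) (hDLoc₂ : D.Loc₂ = loc₂ W K M)
    (hDA₁ : D.A₁ = a₁ W M) (hDA₂ : D.A₂ = a₂ W K M) (hDpl : D.pl = pl) (hDDv : D.Dv = Dv) :
    (∀ m, KolSupp D.Kol m → Even m.primeFactors.card → ∀ v : HeightOneSpectrum (𝓞 ℚ),
        (m : 𝓞 ℚ) ∉ v.asIdeal → D.c₁ m ∈ selmerLocalKer W (v.adicCompletion ℚ) (lvl M)) ∧
      (∀ m, KolSupp D.Kol m → Even m.primeFactors.card →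
        ∀ w : InfinitePlace ℚ, D.c₁ m ∈ selmerLocalKer W w.Completion (lvl M)) ∧
      (∀ m, KolSupp D.Kol m → Odd m.primeFactors.card → ∀ v : HeightOneSpectrum (𝓞 ℚ),
        (m : 𝓞 ℚ) ∉ v.asIdeal → D.c₂ m ∈ selmerLocalKer (twin W K) (v.adicCompletion ℚ) (lvl M)) ∧
      (∀ m, KolSupp D.Kol m → Odd m.primeFactors.card →
        ∀ w : InfinitePlace ℚ, D.c₂ m ∈ selmerLocalKer (twin W K) w.Completion (lvl M)) ∧
      (∀ ℓ m : ℕ, D.Kol ℓ → KolSupp D.Kol (ℓ * m) → Odd m.primeFactors.card → ∀ a : ℕ,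
        ((2 : ℤ) ^ a) • D.c₁ (ℓ * m) ∈ loc₁ W M (pl ℓ) ↔ ((2 : ℤ) ^ a) • D.c₂ m ∈ a₂ W K M ℓ) ∧
      (∀ ℓ m : ℕ, D.Kol ℓ → KolSupp D.Kol (ℓ * m) → Even m.primeFactors.card → ∀ a : ℕ,
        ((2 : ℤ) ^ a) • D.c₂ (ℓ * m) ∈ loc₂ W K M (pl ℓ) ↔ ((2 : ℤ) ^ a) • D.c₁ m ∈ a₁ W M ℓ) := by
  have hpZ : ((D.p : ℕ) : ℤ) = 2 := by rw [hDp, Nat.cast_ofNat]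
  refine ⟨fun m hm hev v hv ↦ ?_, fun m hm hev w ↦ ?_, fun m hm hodd v hv ↦ ?_, fun m hm hodd w ↦ ?_,
    fun ℓ m hℓ hs hodd a ↦ ?_, fun ℓ m hℓ hs hev a ↦ ?_⟩
  · have h := D.c_mem_loc₁ m hm hev (Sum.inl v) (by rw [hDDv]; exact hv)
    rw [hDLoc₁] at h
    exact h
  · have h := D.c_mem_loc₁ m hm hev (Sum.inr w) (by rw [hDDv]; exact not_false)
    rw [hDLoc₁] at h
    exact h
  · have h := D.c_mem_loc₂ m hm hodd (Sum.inl v) (by rw [hDDv]; exact hv)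
    rw [hDLoc₂] at h
    exact h
  · have h := D.c_mem_loc₂ m hm hodd (Sum.inr w) (by rw [hDDv]; exact not_false)
    rw [hDLoc₂] at h
    exact h
  · have h := D.c_mem_loc_iff₂₁ ℓ m hℓ hs hodd a
    rw [hpZ, hDLoc₁, hDpl, hDA₂] at h
    exact h
  · have h := D.c_mem_loc_iff₁₂ ℓ m hℓ hs hev a
    rw [hpZ, hDLoc₂, hDpl, hDA₁] at h
    exact h

/-! ## The assembly with the canonical member formulas -/

set_option maxHeartbeats 1600000 in
/-- **McCallum's inequality `#Ш(E/ℚ)[2^L] · #Sel_{2^{2L}}(E^{(d_K)}/ℚ) ≤ 2^{2M₀}` on the `ℚ`-pair carrier, with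
the canonical Cassels–Tate member formulas plugged in** — from the two-member descent data `D`, the map `f`
with `hA`, the habitat, the Cassels–Tate data of `E` and `E^{(d_K)}` at level `2^L`, and the rank / finiteness /
nondegeneracy facts of the abstract side (alternation is discharged: Cassels' theorem `ctLevelPairing_self_eq_zero`). [cite: McCallumLMS1991, §5 Thm. 5.4 (proof, p. 307), Cor. 5.6]
[cite: Kolyvagin1989Izv, §3] [cite: MilneADT2006, Ch. I §6 Prop. 6.9] -/
theorem card_mul_card_le_two_pow_two_mul_of_pairData_canonical
    (hC : Literature.NumberTheory.Automorphic.chebotarev_artinRep)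
    [NeZero N] [W.IsElliptic] [W.IsGloballyMinimal] [(twin W K).IsElliptic]
    (hK : IsImaginaryQuadratic K) (hoddK : Odd (NumberField.discr K))
    (hρ : W.HasSurjectiveModNGaloisRep 2) (hΔ : W.Δ < 0) (hΔK : ¬ IsSquare (W.baseChange K).Δ)
    (h2 : Module.finrank ℚ K = 2) {θ : K} (hθ : θ ∉ Set.range (algebraMap ℚ K))
    (hd : θ ^ 2 = algebraMap ℚ K ((NumberField.discr K : ℤ) : ℚ)) {L : ℕ} (hL1 : 1 ≤ L)
    [NeZero (2 ^ L * 2 ^ L)]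
    {c₀ : absoluteGaloisGroup ℚ} (hc₀ : IsComplexConjugation (Rat.castHom ℝ) c₀)
    {z : absoluteGaloisGroup K}
    (hzfix : ∀ P : geomTorsion (W.baseChange K) ((2 : ℕ) : ℤ), z • P = P → P = 0)
    (hcomm : ∀ π ∈ torsionFixing (W.baseChange K) ((2 : ℕ) : ℤ),
      ∀ P : geomTorsion (W.baseChange K) ((2 ^ (L + L + 1) : ℕ) : ℤ), π • z • P = z • π • P)
    {S : ℕ → Prop}
    (hS : ∀ ℓ, IsKolyvaginPrime N W K 2 ℓ → FrobEqFrobInfty W K (2 ^ (L + L + 1)) ℓ → S ℓ)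
    {P₀ : (W.baseChange K).toAffine.Point} (hP₀ : IsHeegnerPoint N W K P₀)
    (hnoTors : ∀ P : (W.baseChange K).toAffine.Point, ((2 ^ (L + L) : ℕ) : ℤ) • P = 0 → P = 0)
    -- the two-member descent data on the `ℚ`-pair carrier
    (D : PairDataM (galH1Torsion W (lvl (L + L))) (galH1Torsion (twin W K) (lvl (L + L)))
      (HeightOneSpectrum (𝓞 ℚ) ⊕ InfinitePlace ℚ))
    (hDp : D.p = 2) (hDM : D.M = L + L)
    (hDSel₁ : D.Sel₁ = selmerGroup W (lvl (L + L)))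
    (hDSel₂ : D.Sel₂ = selmerGroup (twin W K) (lvl (L + L)))
    (hDLoc₁ : D.Loc₁ = loc₁ W (L + L)) (hDLoc₂ : D.Loc₂ = loc₂ W K (L + L))
    (hDA₁ : D.A₁ = a₁ W (L + L)) (hDA₂ : D.A₂ = a₂ W K (L + L))
    (hDpl : D.pl = pl) (hDDv : D.Dv = Dv)
    (hDKol : ∀ ℓ, D.Kol ℓ ↔ IsKolyvaginPrime N W K 2 ℓ ∧ FrobEqFrobInfty W K (2 ^ (L + L + 1)) ℓ ∧ S ℓ)
    (hKolk : ∀ ℓ, D.Kol ℓ → kolPrime W K (L + L) ℓ)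
    (hM₀L : D.M₀ ≤ L)
    -- the map into the eigen-pair and the local compatibility at Kolyvagin primes
    (f : galH1Torsion W (lvl (L + L)) × galH1Torsion (twin W K) (lvl (L + L)) →+
      PairV W (sigmaQ K h2 hθ hd) (L + L) 1)
    (hf : Function.Injective f)
    (hf₁ : ∀ v, ((f v).1 : galH1Torsion (W.baseChange K) ((2 ^ (L + L) : ℕ) : ℤ)) =
      resTorsion W K (lvl (L + L)) v.1)
    (hf₂ : ∀ v, ((f v).2 : galH1Torsion (W.baseChange K) ((2 ^ (L + L) : ℕ) : ℤ)) =
      hPsiKT W K hθ hd (lvl (L + L)) (resTorsion (twin W K) K (lvl (L + L)) v.2))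
    (hA : ∀ ℓ, D.Kol ℓ → ∀ v, v ∈ D.toSplitData.A ℓ ↔ f v ∈ pairA (N := N) W (sigmaQ K h2 hθ hd) (L + L) 1 ℓ)
    -- the Cassels–Tate data of `E` at level `2^L`
    (hkill₁ : ∀ a ∈ W.sha, ((2 : ℤ) ^ (2 * L)) • a = 0 → ((2 : ℤ) ^ L) • a = 0)
    (e₁ : geomTorsion W ((2 ^ L * 2 ^ L : ℕ) : ℤ) → geomTorsion W ((2 ^ L * 2 ^ L : ℕ) : ℤ) → AlgebraicClosure ℚ)
    (hμ₁ : ∀ S T, e₁ S T ^ (2 ^ L * 2 ^ L) = 1)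
    (hadd₁₁ : ∀ S₁ S₂ T, e₁ (S₁ + S₂) T = e₁ S₁ T * e₁ S₂ T)
    (hadd₂₁ : ∀ S T₁ T₂, e₁ S (T₁ + T₂) = e₁ S T₁ * e₁ S T₂)
    (hgal₁ : ∀ (σ : absoluteGaloisGroup ℚ) (S T : geomTorsion W ((2 ^ L * 2 ^ L : ℕ) : ℤ)),
      σ • e₁ S T = e₁ (σ • S) (σ • T))
    (halt₁ : ∀ T, e₁ T T = 1) (hnondeg₁ : ∀ T, (∀ S, e₁ S T = 1) → T = 0)
    (ι₁ : selmerGroup W (lvl (L + L)) →+ (W.sha)[(2 ^ L : ℕ)])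
    (hι₁ : ∀ z, shaTorsionVal W (2 ^ L) (ι₁ z) = torsionH1ToH1 W (lvl (L + L)) z)
    -- the Cassels–Tate data of `E^{(d_K)}` at level `2^L`
    (hkill₂ : ∀ a ∈ (twin W K).sha, ((2 : ℤ) ^ (2 * L)) • a = 0 → ((2 : ℤ) ^ L) • a = 0)
    (e₂ : geomTorsion (twin W K) ((2 ^ L * 2 ^ L : ℕ) : ℤ) → geomTorsion (twin W K) ((2 ^ L * 2 ^ L : ℕ) : ℤ) →
      AlgebraicClosure ℚ)
    (hμ₂ : ∀ S T, e₂ S T ^ (2 ^ L * 2 ^ L) = 1)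
    (hadd₁₂ : ∀ S₁ S₂ T, e₂ (S₁ + S₂) T = e₂ S₁ T * e₂ S₂ T)
    (hadd₂₂ : ∀ S T₁ T₂, e₂ S (T₁ + T₂) = e₂ S T₁ * e₂ S T₂)
    (hgal₂ : ∀ (σ : absoluteGaloisGroup ℚ) (S T : geomTorsion (twin W K) ((2 ^ L * 2 ^ L : ℕ) : ℤ)),
      σ • e₂ S T = e₂ (σ • S) (σ • T))
    (halt₂ : ∀ T, e₂ T T = 1) (hnondeg₂ : ∀ T, (∀ S, e₂ S T = 1) → T = 0)
    (ι₂ : selmerGroup (twin W K) (lvl (L + L)) →+ ((twin W K).sha)[(2 ^ L : ℕ)])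
    (hι₂ : ∀ z, shaTorsionVal (twin W K) (2 ^ L) (ι₂ z) = torsionH1ToH1 (twin W K) (lvl (L + L)) z)
    -- the abstract `ℚ`-side
    [Finite (selmerGroup W (lvl (L + L)))] [Finite (selmerGroup (twin W K) (lvl (L + L)))]
    (hι₁surj : Function.Surjective ι₁) (x₁ : selmerGroup W (lvl (L + L)))
    (hx₁ : (x₁ : galH1Torsion W (lvl (L + L))) = D.x)
    (hker : ι₁.ker = AddSubgroup.zmultiples x₁)
    (hxord : addOrderOf x₁ = AddMonoid.exponent (selmerGroup W (lvl (L + L))))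
    (hB₁nd : ∀ a : (W.sha)[(2 ^ L : ℕ)], (∀ b,
      ctLevelPairing W (2 ^ L) e₁ hμ₁ hadd₁₁ hadd₂₁ hgal₁ (LocalInvariants.canonical ℚ (2 ^ L * 2 ^ L)) halt₁
        (sumInvLocalizationEqZero_canonical_of_numberField ℚ (2 ^ L * 2 ^ L)) (shaThree_mu_eq_zero ℚ (2 ^ L * 2 ^ L))
        (localTerm_finite_support (W := W) (m := 2 ^ L) (e := e₁) (hμ := hμ₁) (hadd₁ := hadd₁₁) (hadd₂ := hadd₂₁)
          (hgal := hgal₁) halt₁ (LocalInvariants.canonical ℚ (2 ^ L * 2 ^ L))) a b = 0) → a = 0)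
    (hB₂nd : ∀ v : selmerGroup (twin W K) (lvl (L + L)), (∀ w,
      ctLevelPairing (twin W K) (2 ^ L) e₂ hμ₂ hadd₁₂ hadd₂₂ hgal₂ (LocalInvariants.canonical ℚ (2 ^ L * 2 ^ L))
        halt₂ (sumInvLocalizationEqZero_canonical_of_numberField ℚ (2 ^ L * 2 ^ L))
        (shaThree_mu_eq_zero ℚ (2 ^ L * 2 ^ L))
        (localTerm_finite_support (W := twin W K) (m := 2 ^ L) (e := e₂) (hμ := hμ₂) (hadd₁ := hadd₁₂)
          (hadd₂ := hadd₂₂) (hgal := hgal₂) halt₂ (LocalInvariants.canonical ℚ (2 ^ L * 2 ^ L)))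
        (ι₂ v) (ι₂ w) = 0) → v = 0)
    (hpB : ∀ v : selmerGroup (twin W K) (lvl (L + L)), 2 ^ L • v = 0) :
    Nat.card ((W.sha)[(2 ^ L : ℕ)]) * Nat.card (selmerGroup (twin W K) (lvl (L + L))) ≤ 2 ^ (2 * D.M₀) := by
  obtain ⟨loc_c₁_fin, loc_c₁_inf, loc_c₂_fin, loc_c₂_inf, h44₂₁, h44₁₂⟩ :=
    memberInputs_of_pairData W D hDp hDLoc₁ hDLoc₂ hDA₁ hDA₂ hDpl hDDv
  -- the two canonical member formulas (support `D.Kol`, kill clause `2^L • t = 0`, `M₀ := D.M₀`)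
  have hV₁ := hV₁_canonical_of_kol (W := W) (K := K) D.c₁ D.c₂ hΔ hρ hM₀L hL1 D.Kol hKolk hkill₁ loc_c₁_fin
    loc_c₁_inf h44₂₁ e₁ hμ₁ hadd₁₁ hadd₂₁ hgal₁ halt₁ hnondeg₁ ι₁ hι₁
  have hV₂ := hV₂_canonical_of_kol (W := W) (K := K) D.c₁ D.c₂ hK hoddK hΔ hρ hM₀L hL1 D.Kol hKolk hkill₂
    loc_c₂_fin loc_c₂_inf h44₁₂ e₂ hμ₂ hadd₁₂ hadd₂₂ hgal₂ halt₂ hnondeg₂ ι₂ hι₂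
  -- the two pairings are alternating (Cassels' theorem, `ctLevelPairing_self_eq_zero`)
  have hB₁alt : ∀ a : (W.sha)[(2 ^ L : ℕ)],
      ctLevelPairing W (2 ^ L) e₁ hμ₁ hadd₁₁ hadd₂₁ hgal₁ (LocalInvariants.canonical ℚ (2 ^ L * 2 ^ L)) halt₁
        (sumInvLocalizationEqZero_canonical_of_numberField ℚ (2 ^ L * 2 ^ L)) (shaThree_mu_eq_zero ℚ (2 ^ L * 2 ^ L))
        (localTerm_finite_support (W := W) (m := 2 ^ L) (e := e₁) (hμ := hμ₁) (hadd₁ := hadd₁₁) (hadd₂ := hadd₂₁)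
          (hgal := hgal₁) halt₁ (LocalInvariants.canonical ℚ (2 ^ L * 2 ^ L))) a a = 0 :=
    fun a ↦ ctLevelPairing_self_eq_zero W (2 ^ L) e₁ hμ₁ hadd₁₁ hadd₂₁ hgal₁ _ halt₁ _ _ _ a
  have hB₂alt : ∀ v : selmerGroup (twin W K) (lvl (L + L)),
      ctLevelPairing (twin W K) (2 ^ L) e₂ hμ₂ hadd₁₂ hadd₂₂ hgal₂ (LocalInvariants.canonical ℚ (2 ^ L * 2 ^ L))
        halt₂ (sumInvLocalizationEqZero_canonical_of_numberField ℚ (2 ^ L * 2 ^ L))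
        (shaThree_mu_eq_zero ℚ (2 ^ L * 2 ^ L))
        (localTerm_finite_support (W := twin W K) (m := 2 ^ L) (e := e₂) (hμ := hμ₂) (hadd₁ := hadd₁₂)
          (hadd₂ := hadd₂₂) (hgal := hgal₂) halt₂ (LocalInvariants.canonical ℚ (2 ^ L * 2 ^ L)))
        (ι₂ v) (ι₂ v) = 0 :=
    fun v ↦ ctLevelPairing_self_eq_zero (twin W K) (2 ^ L) e₂ hμ₂ hadd₁₂ hadd₂₂ hgal₂ _ halt₂ _ _ _ (ι₂ v)
  exact card_mul_card_le_two_pow_two_mul_of_pairData W hC hK hρ hΔ hΔK h2 hθ hd hc₀ hzfix hcomm hS hP₀ hnoTors D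
    hDp hDM hDSel₁ hDSel₂ hDA₁ hDA₂ hDKol hM₀L f hf hf₁ hf₂ hA _ ι₁ hV₁ _ ι₂ hV₂ hι₁surj x₁ hx₁ hker hxord
    hB₁alt hB₁nd hB₂alt hB₂nd hpB

/-! ## The support bookkeeping: deep Gross-form Kolyvagin primes are `kolPrime` of the carrier depth -/

/-- **Every Gross-form Kolyvagin prime `ℓ` of `(E, K, 2)` for `N_E` with `Frob_ℓ ∼ τ` on `E[2^{M+1}]` is a
`kolPrime W K M ℓ`** (`K` quadratic, `E` globally minimal, `1 ≤ M`): `ℓ` odd, `ℓ ∤ d_K`, good reduction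
(`ℓ ∤ N_E`), `Frob_ℓ ∼ τ` on `E[2^M]` and on `E[2]`, Kolyvagin index `≥ M`, and `ℓ` inert in `K`.
[cite: GrossLMS1991, §3 (3.1)–(3.3)] [cite: McCallumLMS1991, §3] -/
theorem kolPrime_of_isKolyvaginPrime_of_frobEqFrobInfty_succ [W.IsElliptic] [W.IsGloballyMinimal]
    [NeZero (W.conductorNorm ℤ)] (h2 : Module.finrank ℚ K = 2) {M : ℕ} (hM : 1 ≤ M) {ℓ : ℕ}
    (hℓ : IsKolyvaginPrime (W.conductorNorm ℤ) W K 2 ℓ) (hfrob : FrobEqFrobInfty W K (2 ^ (M + 1)) ℓ) :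
    kolPrime W K M ℓ := by
  obtain ⟨hℓp, hℓN, hℓD, hℓ2, hℓP, hfrob2⟩ := hℓ
  haveI : Fact ℓ.Prime := ⟨hℓp⟩
  set v : HeightOneSpectrum (𝓞 ℚ) := primesEquiv.symm ⟨ℓ, hℓp⟩ with hv
  have hℓv : (ℓ : 𝓞 ℚ) ∈ v.asIdeal := natCast_mem_primesEquiv_symm hℓp
  have hvℓ : (primesEquiv v : ℕ) = ℓ := primesEquiv_eq_of_natCast_mem hℓp hℓv
  have hgood₁ : W.HasGoodReductionAt v := LocalFrob.hasGoodReductionAt_rat_of_not_dvd_conductorNorm W hℓp hℓN v hℓv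
  have hgood : W.HasGoodReductionAtPrime ℓ := (hasGoodReductionAtPrime_primesEquiv_iff_holds W v ℓ hvℓ).mpr hgood₁
  have hfrobM : FrobEqFrobInfty W K (2 ^ M) ℓ :=
    FrobEqFrobInfty.of_dvd (W := W) (K := K) (pow_dvd_pow 2 (Nat.le_succ M)) hfrob
  have hidx : M ≤ Zhang2014.kolyvaginIndex W 2 ℓ :=
    McCallum1991.le_kolyvaginIndex_of_frobEqFrobInfty W K Nat.prime_two hM hℓp hℓ2 hℓN hfrobM
  exact ⟨hℓp, hℓ2, hℓD, hgood, hfrobM, hfrob2, hidx,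
    fun w hw ↦ LocalFrob.inertiaDeg_eq_two_of_isPrime_span K h2 hℓp hℓP w hw⟩

/-! ## The assembly on H₂ -/

set_option maxHeartbeats 1600000 in
/-- **McCallum's inequality `#Ш(E/ℚ)[2^L] · #Sel_{2^{2L}}(E^{(d_K)}/ℚ) ≤ 2^{2M₀}` on H₂**, path (β), every habitat
binder, the map `f`, `hA` and the Kolyvagin-prime bookkeeping discharged (module docstring); displayed: the
two-member data `D` with its rfl-compatibilities (`D.Kol` = Gross-form Kolyvagin primes of depth `2L+1` that are
`kolPrime` of depth `2L`), a Heegner point, the Cassels–Tate data at level `2^L` for both members, and the abstract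
rank / finiteness / nondegeneracy facts. [cite: McCallumLMS1991, §5 Thm. 5.4 (proof, p. 307), Cor. 5.6]
[cite: Kolyvagin1989Izv, §3] [cite: GrossLMS1991, §5 (5.1)] -/
theorem card_mul_card_le_two_pow_two_mul_of_pairData_cmInert
    [W.IsElliptic] [W.IsGloballyMinimal] [NeZero (W.conductorNorm ℤ)] [(twin W K).IsElliptic]
    (hCM : W.HasCM) (hin : Literature.NumberTheory.EllipticCurves.Rank1Residual.CMInert W 2)
    (hρ : W.HasSurjectiveModNGaloisRep 2) (hK : IsImaginaryQuadratic K) (hoddK : Odd (NumberField.discr K))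
    (hH : SatisfiesHeegnerHypothesis (W.conductorNorm ℤ) K)
    {P₀ : (W.baseChange K).toAffine.Point} (hP₀ : IsHeegnerPoint (W.conductorNorm ℤ) W K P₀)
    {L : ℕ} (hL1 : 1 ≤ L)
    -- the two-member descent data on the `ℚ`-pair carrier
    (D : PairDataM (galH1Torsion W (lvl (L + L))) (galH1Torsion (twin W K) (lvl (L + L)))
      (HeightOneSpectrum (𝓞 ℚ) ⊕ InfinitePlace ℚ))
    (hDp : D.p = 2) (hDM : D.M = L + L)
    (hDSel₁ : D.Sel₁ = selmerGroup W (lvl (L + L)))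
    (hDSel₂ : D.Sel₂ = selmerGroup (twin W K) (lvl (L + L)))
    (hDLoc₁ : D.Loc₁ = loc₁ W (L + L)) (hDLoc₂ : D.Loc₂ = loc₂ W K (L + L))
    (hDA₁ : D.A₁ = a₁ W (L + L)) (hDA₂ : D.A₂ = a₂ W K (L + L))
    (hDpl : D.pl = pl) (hDDv : D.Dv = Dv)
    (hDKol : ∀ ℓ, D.Kol ℓ ↔ IsKolyvaginPrime (W.conductorNorm ℤ) W K 2 ℓ ∧
      FrobEqFrobInfty W K (2 ^ (L + L + 1)) ℓ ∧ kolPrime W K (L + L) ℓ)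
    (hM₀L : D.M₀ ≤ L)
    -- the Cassels–Tate data of `E` at level `2^L`
    (hkill₁ : ∀ a ∈ W.sha, ((2 : ℤ) ^ (2 * L)) • a = 0 → ((2 : ℤ) ^ L) • a = 0)
    (e₁ : geomTorsion W ((2 ^ L * 2 ^ L : ℕ) : ℤ) → geomTorsion W ((2 ^ L * 2 ^ L : ℕ) : ℤ) → AlgebraicClosure ℚ)
    (hμ₁ : ∀ S T, e₁ S T ^ (2 ^ L * 2 ^ L) = 1)
    (hadd₁₁ : ∀ S₁ S₂ T, e₁ (S₁ + S₂) T = e₁ S₁ T * e₁ S₂ T)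
    (hadd₂₁ : ∀ S T₁ T₂, e₁ S (T₁ + T₂) = e₁ S T₁ * e₁ S T₂)
    (hgal₁ : ∀ (σ : absoluteGaloisGroup ℚ) (S T : geomTorsion W ((2 ^ L * 2 ^ L : ℕ) : ℤ)),
      σ • e₁ S T = e₁ (σ • S) (σ • T))
    (halt₁ : ∀ T, e₁ T T = 1) (hnondeg₁ : ∀ T, (∀ S, e₁ S T = 1) → T = 0)
    (ι₁ : selmerGroup W (lvl (L + L)) →+ (W.sha)[(2 ^ L : ℕ)])
    (hι₁ : ∀ z, shaTorsionVal W (2 ^ L) (ι₁ z) = torsionH1ToH1 W (lvl (L + L)) z)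
    -- the Cassels–Tate data of `E^{(d_K)}` at level `2^L`
    (hkill₂ : ∀ a ∈ (twin W K).sha, ((2 : ℤ) ^ (2 * L)) • a = 0 → ((2 : ℤ) ^ L) • a = 0)
    (e₂ : geomTorsion (twin W K) ((2 ^ L * 2 ^ L : ℕ) : ℤ) → geomTorsion (twin W K) ((2 ^ L * 2 ^ L : ℕ) : ℤ) →
      AlgebraicClosure ℚ)
    (hμ₂ : ∀ S T, e₂ S T ^ (2 ^ L * 2 ^ L) = 1)
    (hadd₁₂ : ∀ S₁ S₂ T, e₂ (S₁ + S₂) T = e₂ S₁ T * e₂ S₂ T)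
    (hadd₂₂ : ∀ S T₁ T₂, e₂ S (T₁ + T₂) = e₂ S T₁ * e₂ S T₂)
    (hgal₂ : ∀ (σ : absoluteGaloisGroup ℚ) (S T : geomTorsion (twin W K) ((2 ^ L * 2 ^ L : ℕ) : ℤ)),
      σ • e₂ S T = e₂ (σ • S) (σ • T))
    (halt₂ : ∀ T, e₂ T T = 1) (hnondeg₂ : ∀ T, (∀ S, e₂ S T = 1) → T = 0)
    (ι₂ : selmerGroup (twin W K) (lvl (L + L)) →+ ((twin W K).sha)[(2 ^ L : ℕ)])
    (hι₂ : ∀ z, shaTorsionVal (twin W K) (2 ^ L) (ι₂ z) = torsionH1ToH1 (twin W K) (lvl (L + L)) z)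
    -- the abstract `ℚ`-side (the two Selmer groups are finite: `finite_selmerGroup_holds`)
    -- the rank-one member: the kernel of `ι₁` is `ℤ · D.x` (Mordell–Weil rank one, `E(ℚ)[2] = 0`, `D.x = δ(x₀)` with
    -- `x₀` an odd multiple of the generator modulo torsion: `…PairAssemblyRankOneSideAtTwo`)
    (hker : ∀ z : selmerGroup W (lvl (L + L)),
      ι₁ z = 0 ↔ (z : galH1Torsion W (lvl (L + L))) ∈ AddSubgroup.zmultiples D.x)
    -- the rank-zero member: `ι₂` injective (`E^{(d_K)}(ℚ)` finite without `2`-torsion, `Ш(E^{(d_K)})[2^{2L}] = Ш[2^L]`)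
    (hι₂inj : Function.Injective ι₂)
    (hB₁nd : haveI : NeZero (2 ^ L * 2 ^ L) := ⟨by positivity⟩
      ∀ a : (W.sha)[(2 ^ L : ℕ)], (∀ b,
      ctLevelPairing W (2 ^ L) e₁ hμ₁ hadd₁₁ hadd₂₁ hgal₁ (LocalInvariants.canonical ℚ (2 ^ L * 2 ^ L)) halt₁
        (sumInvLocalizationEqZero_canonical_of_numberField ℚ (2 ^ L * 2 ^ L)) (shaThree_mu_eq_zero ℚ (2 ^ L * 2 ^ L))
        (localTerm_finite_support (W := W) (m := 2 ^ L) (e := e₁) (hμ := hμ₁) (hadd₁ := hadd₁₁) (hadd₂ := hadd₂₁)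
          (hgal := hgal₁) halt₁ (LocalInvariants.canonical ℚ (2 ^ L * 2 ^ L))) a b = 0) → a = 0)
    (hCT₂nd : haveI : NeZero (2 ^ L * 2 ^ L) := ⟨by positivity⟩
      ∀ a : ((twin W K).sha)[(2 ^ L : ℕ)], (∀ b,
      ctLevelPairing (twin W K) (2 ^ L) e₂ hμ₂ hadd₁₂ hadd₂₂ hgal₂ (LocalInvariants.canonical ℚ (2 ^ L * 2 ^ L))
        halt₂ (sumInvLocalizationEqZero_canonical_of_numberField ℚ (2 ^ L * 2 ^ L))
        (shaThree_mu_eq_zero ℚ (2 ^ L * 2 ^ L))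
        (localTerm_finite_support (W := twin W K) (m := 2 ^ L) (e := e₂) (hμ := hμ₂) (hadd₁ := hadd₁₂)
          (hadd₂ := hadd₂₂) (hgal := hgal₂) halt₂ (LocalInvariants.canonical ℚ (2 ^ L * 2 ^ L))) a b = 0) → a = 0) :
    Nat.card ((W.sha)[(2 ^ L : ℕ)]) * Nat.card (selmerGroup (twin W K) (lvl (L + L))) ≤ 2 ^ (2 * D.M₀) := by
  haveI : NeZero (2 ^ L * 2 ^ L) := ⟨by positivity⟩
  haveI : Fact (Nat.Prime 2) := ⟨Nat.prime_two⟩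
  -- ### the habitat inputs
  have h2 : Module.finrank ℚ K = 2 := hK.1
  have hΔ : W.Δ < 0 := KolyvaginEigenTwo.Δ_neg_of_cmInert_two W hCM hin hρ
  have hΔK : ¬ IsSquare (W.baseChange K).Δ := by
    have h : (W.baseChange K).Δ = algebraMap ℚ K W.Δ := by rw [baseChange, map_Δ]
    rw [h]
    exact KolyvaginImageTwo.not_isSquare_algebraMap_Δ_of_cmInert_two_of_heegner W hCM hin hρ K hK hH
  obtain ⟨z, -, hzfix⟩ := KolyvaginImageTwo.exists_smul_three_of_hasSurjectiveModNGaloisRep W K h2 hρ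
  have hcomm : ∀ π ∈ torsionFixing (W.baseChange K) ((2 : ℕ) : ℤ),
      ∀ P : geomTorsion (W.baseChange K) ((2 ^ (L + L + 1) : ℕ) : ℤ), π • z • P = z • π • P :=
    Summit.BirchSwinnertonDyer.Rank1Residual.P2.CartanAtTwo.hcomm_of_habitat W K hCM hin hρ hzfix
  obtain ⟨c₀, hc₀⟩ := exists_isComplexConjugation (Rat.castHom ℝ)
  obtain ⟨θ, hθ, hd⟩ := Literature.NumberTheory.EllipticCurves.exists_sq_eq_discr_not_mem_range K h2
  have h2tors : ∀ P : (W.baseChange K).toAffine.Point, (2 : ℤ) • P = 0 → P = 0 := by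
    intro P hP
    refine forall_two_nsmul_baseChange_of_hasSurjectiveModNGaloisRep_two_of_isImaginaryQuadratic W hρ K hK P ?_
    rw [← natCast_zsmul]
    exact hP
  have hnoTors : ∀ P : (W.baseChange K).toAffine.Point, ((2 ^ (L + L) : ℕ) : ℤ) • P = 0 → P = 0 := by
    intro P hP
    refine eq_zero_of_two_pow_zsmul_eq_zero h2tors (L + L) P ?_
    rw [← Nat.cast_ofNat, ← Nat.cast_pow]
    exact hP
  -- ### the support bookkeeping `S := kolPrime W K (2L)`
  have hS : ∀ ℓ, IsKolyvaginPrime (W.conductorNorm ℤ) W K 2 ℓ → FrobEqFrobInfty W K (2 ^ (L + L + 1)) ℓ →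
      kolPrime W K (L + L) ℓ :=
    fun ℓ hℓ hfrob ↦ kolPrime_of_isKolyvaginPrime_of_frobEqFrobInfty_succ W h2 (by omega) hℓ hfrob
  have hKolk : ∀ ℓ, D.Kol ℓ → kolPrime W K (L + L) ℓ := fun ℓ hℓ ↦ ((hDKol ℓ).mp hℓ).2.2
  -- ### the map `f` and the local compatibility `hA`
  obtain ⟨f, hf, hf₁, hf₂⟩ := exists_pairOfRat W K h2 hθ hd (L + L) hnoTors
  have hA : ∀ ℓ, D.Kol ℓ → ∀ v, v ∈ D.toSplitData.A ℓ ↔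
      f v ∈ pairA (N := W.conductorNorm ℤ) W (sigmaQ K h2 hθ hd) (L + L) 1 ℓ := by
    intro ℓ hℓ v
    obtain ⟨hG, -, hk⟩ := (hDKol ℓ).mp hℓ
    obtain ⟨hℓp, -, -, hgood, hfrobM, -⟩ := hk
    exact mem_toSplitData_A_iff_mem_pairA W hK hoddK hΔ h2 hθ hd (by omega) D hDA₁ hDA₂ f hf₁ hf₂ hG hgood
      hfrobM v
  -- ### finiteness of the two Selmer groups (Silverman X.4.2 (b))
  haveI : Finite (selmerGroup W (lvl (L + L))) := W.finite_selmerGroup_holds (lvl_ne_zero (L + L))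
  haveI : Finite (selmerGroup (twin W K) (lvl (L + L))) := (twin W K).finite_selmerGroup_holds (lvl_ne_zero (L + L))
  -- ### the abstract side, rank-one member: `x₁ = D.x`, `ker ι₁ = ℤ x₁`, `ord x₁ = exp Sel` (from `D.x_ord`)
  have hxSel : D.x ∈ selmerGroup W (lvl (L + L)) := by rw [← hDSel₁]; exact D.x_mem
  set x₁ : selmerGroup W (lvl (L + L)) := ⟨D.x, hxSel⟩ with hx₁def
  have hx₁ : (x₁ : galH1Torsion W (lvl (L + L))) = D.x := rfl
  have hker' : ι₁.ker = AddSubgroup.zmultiples x₁ := by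
    ext z
    rw [AddMonoidHom.mem_ker, hker, AddSubgroup.mem_zmultiples_iff, AddSubgroup.mem_zmultiples_iff]
    constructor
    · rintro ⟨a, ha⟩
      exact ⟨a, Subtype.ext (by rw [AddSubgroupClass.coe_zsmul, hx₁, ha])⟩
    · rintro ⟨a, ha⟩
      exact ⟨a, by rw [← ha, AddSubgroupClass.coe_zsmul, hx₁]⟩
  have hxord : addOrderOf x₁ = AddMonoid.exponent (selmerGroup W (lvl (L + L))) := by
    have hordx : addOrderOf D.x = 2 ^ (L + L) := by
      have h := D.toSplitData.addOrderOf_eq_pow_expo D.toSplitData.x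
      rw [D.toSplitData.expo_x_and_zsmul_x_eq_zero_iff.1, PairDataM.toSplitData_p, hDp, PairDataM.toSplitData_M, hDM,
        PairDataM.toSplitData_x, Prod.addOrderOf_mk, addOrderOf_zero, Nat.lcm_one_right] at h
      exact h
    have hord₁ : addOrderOf x₁ = 2 ^ (L + L) := by rw [← AddSubgroup.addOrderOf_coe x₁, hx₁, hordx]
    have h1 : AddMonoid.exponent (selmerGroup W (lvl (L + L))) ∣ 2 ^ (L + L) := by
      refine AddMonoid.exponent_dvd_of_forall_nsmul_eq_zero fun s ↦ Subtype.ext ?_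
      rw [AddSubgroupClass.coe_nsmul, ZeroMemClass.coe_zero, ← natCast_zsmul]
      exact zsmul_galH1Torsion_eq_zero W (lvl (L + L)) _
    have h2' : addOrderOf x₁ ∣ AddMonoid.exponent (selmerGroup W (lvl (L + L))) :=
      AddMonoid.addOrder_dvd_exponent x₁
    rw [hord₁] at h2' ⊢
    exact Nat.dvd_antisymm h2' h1
  -- ### the abstract side: `ι₁` onto (Kummer exactness), `2^L · Sel(E^{(d_K)}) = 0` and nondegeneracy from `ι₂`
  have hι₁surj : Function.Surjective ι₁ := selmerToSha_surjective W ι₁ hι₁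
  have hpB : ∀ v : selmerGroup (twin W K) (lvl (L + L)), 2 ^ L • v = 0 :=
    two_pow_smul_eq_zero_of_selmerToSha_injective (twin W K) ι₂ hι₂inj
  have hB₂nd := nondegenerate_pullback_of_selmerToSha_bijective (twin W K) ι₂ hι₂inj
    (selmerToSha_surjective (twin W K) ι₂ hι₂) _ hCT₂nd
  exact card_mul_card_le_two_pow_two_mul_of_pairData_canonical W
    Literature.NumberTheory.Automorphic.chebotarev_artinRep_holds hK hoddK hρ hΔ hΔK h2 hθ hd hL1 hc₀ hzfix hcomm
    hS hP₀ hnoTors D hDp hDM hDSel₁ hDSel₂ hDLoc₁ hDLoc₂ hDA₁ hDA₂ hDpl hDDv hDKol hKolk hM₀L f hf hf₁ hf₂ hA hkill₁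
    e₁ hμ₁ hadd₁₁ hadd₂₁ hgal₁ halt₁ hnondeg₁ ι₁ hι₁ hkill₂ e₂ hμ₂ hadd₁₂ hadd₂₂ hgal₂ halt₂ hnondeg₂ ι₂ hι₂ hι₁surj
    x₁ hx₁ hker' hxord hB₁nd hB₂nd hpB

end Summit.BirchSwinnertonDyer.BirchSwinnertonDyer.Theorems.KolyvaginPairDataTwo

end


-- single-conjunct summit: `Summit.BirchSwinnertonDyer.BirchSwinnertonDyer.…` repeats the name by design
set_option linter.dupNamespace false
set_option autoImplicit false

noncomputable section

open scoped Classical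
open scoped AddSubgroup

namespace Summit.BirchSwinnertonDyer.BirchSwinnertonDyer.Theorems.KolyvaginPairDataTwo

open WeierstrassCurve NumberField Field
open Literature.NumberTheory.EllipticCurves Literature.NumberTheory.GaloisRepresentations
open Literature.NumberTheory.GaloisCohomology
open Literature.GroupTheory.FiniteAbelian (IsLevelPairing)
open Summit.BirchSwinnertonDyer.BirchSwinnertonDyer.Theorems.GenusExact
open Summit.BirchSwinnertonDyer.BirchSwinnertonDyer.Theorems.GenusExact.VisiblePairAtTwo (shaThree_mu_eq_zero)

variable {K : Type} [Field K] [NumberField K] (W : WeierstrassCurve K) [W.IsElliptic] {L : ℕ}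
  (e : geomTorsion W ((2 ^ L * 2 ^ L : ℕ) : ℤ) → geomTorsion W ((2 ^ L * 2 ^ L : ℕ) : ℤ) → AlgebraicClosure K)
  (hμ : ∀ S T, e S T ^ (2 ^ L * 2 ^ L) = 1)
  (hadd₁ : ∀ S₁ S₂ T, e (S₁ + S₂) T = e S₁ T * e S₂ T)
  (hadd₂ : ∀ S T₁ T₂, e S (T₁ + T₂) = e S T₁ * e S T₂)
  (hgal : ∀ (σ : absoluteGaloisGroup K) (S T : geomTorsion W ((2 ^ L * 2 ^ L : ℕ) : ℤ)), σ • e S T = e (σ • S) (σ • T))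
  (halt : ∀ T, e T T = 1) (hnd : ∀ T, (∀ S, e S T = 1) → T = 0)

include hnd in
/-- **The canonical Cassels–Tate pairing on `Ш(E/K)[2^L]` is a LEVEL pairing** (alternating; kernel `Ш[2^L] ∩ 2^L·Ш`), for
every number field `K`, every elliptic curve, every `L ≥ 1` — gk2-p2's `isLevelPairing_ctLevelPairing_canonical_of_alt` with
Cassels' alternation `ctGeneralFun_self_eq_zero` supplied. [cite: MilneADT2006, Ch. I §6 Thm. 6.13 (a)] [cite: Cassels1962ArithmeticIV, §1] -/
theorem isLevelPairing_ctLevelPairing_canonical_two_pow [NeZero (2 ^ L)] [NeZero (2 ^ L * 2 ^ L)] (hL : 0 < L) :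
    IsLevelPairing (2 ^ L)
      (ctLevelPairing W (2 ^ L) e hμ hadd₁ hadd₂ hgal (LocalInvariants.canonical K (2 ^ L * 2 ^ L)) halt
        (sumInvLocalizationEqZero_canonical_of_numberField K (2 ^ L * 2 ^ L)) (shaThree_mu_eq_zero K (2 ^ L * 2 ^ L))
        (localTerm_finite_support W (2 ^ L) e hμ hadd₁ hadd₂ hgal halt (LocalInvariants.canonical K (2 ^ L * 2 ^ L)))) := by
  haveI : Fact (Nat.Prime 2) := ⟨Nat.prime_two⟩
  exact CasselsTatePTcReal.isLevelPairing_ctLevelPairing_canonical_of_alt W 2 L e hμ hadd₁ hadd₂ hgal halt hnd hL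
    fun a ha hma ↦ ctGeneralFun_self_eq_zero halt _ (sumInvLocalizationEqZero_canonical_of_numberField K (2 ^ L * 2 ^ L))
      (shaThree_mu_eq_zero K (2 ^ L * 2 ^ L)) ha hma

omit [W.IsElliptic] in
/-- **A level pairing at `2^L` is nondegenerate when `Ш[2^{2L}] ⊆ Ш[2^L]`** (pure): a class in the kernel is `2^L z` with
`z ∈ Ш`, `2^{2L} z = 0`, hence `2^L z = 0`. [cite: MilneADT2006, Ch. I §6 Thm. 6.13 (a)] -/
theorem nondegenerate_of_isLevelPairing_of_kill {T : Type*} [AddCommGroup T]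
    (B : (W.sha)[(2 ^ L : ℕ)] →+ (W.sha)[(2 ^ L : ℕ)] →+ T) (hB : IsLevelPairing (2 ^ L) B)
    (hkill : ∀ a ∈ W.sha, ((2 : ℤ) ^ (2 * L)) • a = 0 → ((2 : ℤ) ^ L) • a = 0) :
    ∀ a : (W.sha)[(2 ^ L : ℕ)], (∀ b, B a b = 0) → a = 0 := by
  intro a ha
  obtain ⟨z, hz⟩ := (hB.2 a).mp ha
  -- `2^L • (a : Ш) = 0`
  have ha0 : (2 ^ L) • ((a : W.sha)) = 0 := by
    rw [← AddSubgroupClass.coe_nsmul, AddSubgroup.torsionBy.nsmul, ZeroMemClass.coe_zero]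
  -- `2^{2L} • z = 0` in `Ш`, read in `H¹(K, E)`
  have hz2 : ((2 : ℤ) ^ (2 * L)) • (z : W.galH1) = 0 := by
    have h1 : (2 ^ L * 2 ^ L) • z = 0 := by rw [mul_comm, mul_nsmul, hz, ha0]
    have h2 := congrArg (fun x : W.sha ↦ (x : W.galH1)) h1
    simp only [AddSubgroupClass.coe_nsmul, ZeroMemClass.coe_zero] at h2
    rw [← natCast_zsmul] at h2
    rw [two_mul, pow_add]
    exact_mod_cast h2
  have hzL : ((2 : ℤ) ^ L) • (z : W.galH1) = 0 := hkill _ z.2 hz2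
  have hzL' : (2 ^ L) • z = 0 := by
    apply Subtype.ext
    rw [AddSubgroupClass.coe_nsmul, ZeroMemClass.coe_zero, ← natCast_zsmul]
    exact_mod_cast hzL
  apply Subtype.ext
  rw [← hz, hzL', ZeroMemClass.coe_zero]

include hnd in
/-- **`hB₁nd` / `hCT₂nd` of the T2 assembly from `hkill`**: the canonical Cassels–Tate pairing on `Ш(E/K)[2^L]` is nondegenerate
as soon as `Ш[2^{2L}] ⊆ Ш[2^L]` (`L ≥ 1`; every number field, every curve). [cite: MilneADT2006, Ch. I §6 Thm. 6.13 (a)]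
[cite: Cassels1962ArithmeticIV, §1] -/
theorem ctLevelPairing_canonical_nondegenerate_of_kill [NeZero (2 ^ L)] [NeZero (2 ^ L * 2 ^ L)] (hL : 0 < L)
    (hkill : ∀ a ∈ W.sha, ((2 : ℤ) ^ (2 * L)) • a = 0 → ((2 : ℤ) ^ L) • a = 0) :
    ∀ a : (W.sha)[(2 ^ L : ℕ)], (∀ b,
      ctLevelPairing W (2 ^ L) e hμ hadd₁ hadd₂ hgal (LocalInvariants.canonical K (2 ^ L * 2 ^ L)) halt
        (sumInvLocalizationEqZero_canonical_of_numberField K (2 ^ L * 2 ^ L)) (shaThree_mu_eq_zero K (2 ^ L * 2 ^ L))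
        (localTerm_finite_support W (2 ^ L) e hμ hadd₁ hadd₂ hgal halt (LocalInvariants.canonical K (2 ^ L * 2 ^ L)))
        a b = 0) → a = 0 :=
  nondegenerate_of_isLevelPairing_of_kill W _
    (isLevelPairing_ctLevelPairing_canonical_two_pow W e hμ hadd₁ hadd₂ hgal halt hnd hL) hkill

end Summit.BirchSwinnertonDyer.BirchSwinnertonDyer.Theorems.KolyvaginPairDataTwo

end


-- single-conjunct summit: `Summit.BirchSwinnertonDyer.BirchSwinnertonDyer.…` repeats the name by design
set_option linter.dupNamespace false
set_option autoImplicit false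

noncomputable section

open scoped Classical
open scoped AddSubgroup
open WeierstrassCurve NumberField IsDedekindDomain Field Function Rat.HeightOneSpectrum
open Literature.NumberTheory.GaloisRepresentations
open Literature.NumberTheory.GaloisCohomology
open Literature.NumberTheory.EllipticCurves Literature.NumberTheory.EllipticCurves.KolyvaginDescent
open Summit.BirchSwinnertonDyer.BirchSwinnertonDyer.Theorems.GenusExact.EigenClassesFinite
open Summit.BirchSwinnertonDyer.BirchSwinnertonDyer.Theorems.GenusExact.VisiblePairAtTwo

namespace Summit.BirchSwinnertonDyer.BirchSwinnertonDyer.Theorems.KolyvaginPairDataTwo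

variable (W : WeierstrassCurve ℚ) {K : Type} [Field K] [NumberField K]

set_option maxHeartbeats 1600000 in
/-- **McCallum's inequality `#Ш(E/ℚ)[2^L] · #Sel_{2^{2L}}(E^{(d_K)}/ℚ) ≤ 2^{2M₀}` on H₂, Cassels–Tate nondegeneracy discharged**
(see the module docstring for the displayed inputs). [cite: McCallumLMS1991, §5 Thm. 5.4 (proof, p. 307), Cor. 5.6]
[cite: Kolyvagin1989Izv, §3] [cite: MilneADT2006, Ch. I §6 Thm. 6.13 (a)] -/
theorem card_mul_card_le_two_pow_two_mul_of_pairData_cmInert_of_kill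
    [W.IsElliptic] [W.IsGloballyMinimal] [NeZero (W.conductorNorm ℤ)] [(twin W K).IsElliptic]
    (hCM : W.HasCM) (hin : Literature.NumberTheory.EllipticCurves.Rank1Residual.CMInert W 2)
    (hρ : W.HasSurjectiveModNGaloisRep 2) (hK : IsImaginaryQuadratic K) (hoddK : Odd (NumberField.discr K))
    (hH : SatisfiesHeegnerHypothesis (W.conductorNorm ℤ) K)
    {P₀ : (W.baseChange K).toAffine.Point} (hP₀ : IsHeegnerPoint (W.conductorNorm ℤ) W K P₀)
    {L : ℕ} (hL1 : 1 ≤ L)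
    -- the two-member descent data on the `ℚ`-pair carrier
    (D : PairDataM (galH1Torsion W (lvl (L + L))) (galH1Torsion (twin W K) (lvl (L + L)))
      (HeightOneSpectrum (𝓞 ℚ) ⊕ InfinitePlace ℚ))
    (hDp : D.p = 2) (hDM : D.M = L + L)
    (hDSel₁ : D.Sel₁ = selmerGroup W (lvl (L + L)))
    (hDSel₂ : D.Sel₂ = selmerGroup (twin W K) (lvl (L + L)))
    (hDLoc₁ : D.Loc₁ = loc₁ W (L + L)) (hDLoc₂ : D.Loc₂ = loc₂ W K (L + L))
    (hDA₁ : D.A₁ = a₁ W (L + L)) (hDA₂ : D.A₂ = a₂ W K (L + L))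
    (hDpl : D.pl = pl) (hDDv : D.Dv = Dv)
    (hDKol : ∀ ℓ, D.Kol ℓ ↔ IsKolyvaginPrime (W.conductorNorm ℤ) W K 2 ℓ ∧
      FrobEqFrobInfty W K (2 ^ (L + L + 1)) ℓ ∧ kolPrime W K (L + L) ℓ)
    (hM₀L : D.M₀ ≤ L)
    -- the Cassels–Tate data of `E` at level `2^L`
    (hkill₁ : ∀ a ∈ W.sha, ((2 : ℤ) ^ (2 * L)) • a = 0 → ((2 : ℤ) ^ L) • a = 0)
    (e₁ : geomTorsion W ((2 ^ L * 2 ^ L : ℕ) : ℤ) → geomTorsion W ((2 ^ L * 2 ^ L : ℕ) : ℤ) → AlgebraicClosure ℚ)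
    (hμ₁ : ∀ S T, e₁ S T ^ (2 ^ L * 2 ^ L) = 1)
    (hadd₁₁ : ∀ S₁ S₂ T, e₁ (S₁ + S₂) T = e₁ S₁ T * e₁ S₂ T)
    (hadd₂₁ : ∀ S T₁ T₂, e₁ S (T₁ + T₂) = e₁ S T₁ * e₁ S T₂)
    (hgal₁ : ∀ (σ : absoluteGaloisGroup ℚ) (S T : geomTorsion W ((2 ^ L * 2 ^ L : ℕ) : ℤ)),
      σ • e₁ S T = e₁ (σ • S) (σ • T))
    (halt₁ : ∀ T, e₁ T T = 1) (hnondeg₁ : ∀ T, (∀ S, e₁ S T = 1) → T = 0)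
    (ι₁ : selmerGroup W (lvl (L + L)) →+ (W.sha)[(2 ^ L : ℕ)])
    (hι₁ : ∀ z, shaTorsionVal W (2 ^ L) (ι₁ z) = torsionH1ToH1 W (lvl (L + L)) z)
    -- the Cassels–Tate data of `E^{(d_K)}` at level `2^L`
    (hkill₂ : ∀ a ∈ (twin W K).sha, ((2 : ℤ) ^ (2 * L)) • a = 0 → ((2 : ℤ) ^ L) • a = 0)
    (e₂ : geomTorsion (twin W K) ((2 ^ L * 2 ^ L : ℕ) : ℤ) → geomTorsion (twin W K) ((2 ^ L * 2 ^ L : ℕ) : ℤ) →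
      AlgebraicClosure ℚ)
    (hμ₂ : ∀ S T, e₂ S T ^ (2 ^ L * 2 ^ L) = 1)
    (hadd₁₂ : ∀ S₁ S₂ T, e₂ (S₁ + S₂) T = e₂ S₁ T * e₂ S₂ T)
    (hadd₂₂ : ∀ S T₁ T₂, e₂ S (T₁ + T₂) = e₂ S T₁ * e₂ S T₂)
    (hgal₂ : ∀ (σ : absoluteGaloisGroup ℚ) (S T : geomTorsion (twin W K) ((2 ^ L * 2 ^ L : ℕ) : ℤ)),
      σ • e₂ S T = e₂ (σ • S) (σ • T))
    (halt₂ : ∀ T, e₂ T T = 1) (hnondeg₂ : ∀ T, (∀ S, e₂ S T = 1) → T = 0)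
    (ι₂ : selmerGroup (twin W K) (lvl (L + L)) →+ ((twin W K).sha)[(2 ^ L : ℕ)])
    (hι₂ : ∀ z, shaTorsionVal (twin W K) (2 ^ L) (ι₂ z) = torsionH1ToH1 (twin W K) (lvl (L + L)) z)
    -- the abstract `ℚ`-side (the two Selmer groups are finite: `finite_selmerGroup_holds`)
    -- the rank-one member: the kernel of `ι₁` is `ℤ · D.x` (Mordell–Weil rank one, `E(ℚ)[2] = 0`, `D.x = δ(x₀)` with
    -- `x₀` an odd multiple of the generator modulo torsion: `…PairAssemblyRankOneSideAtTwo`)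
    (hker : ∀ z : selmerGroup W (lvl (L + L)),
      ι₁ z = 0 ↔ (z : galH1Torsion W (lvl (L + L))) ∈ AddSubgroup.zmultiples D.x)
    -- the rank-zero member: `ι₂` injective (`E^{(d_K)}(ℚ)` finite without `2`-torsion, `Ш(E^{(d_K)})[2^{2L}] = Ш[2^L]`)
    (hι₂inj : Function.Injective ι₂) :
    Nat.card ((W.sha)[(2 ^ L : ℕ)]) * Nat.card (selmerGroup (twin W K) (lvl (L + L))) ≤ 2 ^ (2 * D.M₀) := by
  haveI : NeZero (2 ^ L * 2 ^ L) := ⟨by positivity⟩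
  have hB₁nd := ctLevelPairing_canonical_nondegenerate_of_kill W e₁ hμ₁ hadd₁₁ hadd₂₁ hgal₁ halt₁ hnondeg₁ hL1 hkill₁
  have hCT₂nd := ctLevelPairing_canonical_nondegenerate_of_kill (twin W K) e₂ hμ₂ hadd₁₂ hadd₂₂ hgal₂ halt₂ hnondeg₂ hL1
    hkill₂
  exact card_mul_card_le_two_pow_two_mul_of_pairData_cmInert W hCM hin hρ hK hoddK hH hP₀ hL1 D hDp hDM hDSel₁ hDSel₂
    hDLoc₁ hDLoc₂ hDA₁ hDA₂ hDpl hDDv hDKol hM₀L hkill₁ e₁ hμ₁ hadd₁₁ hadd₂₁ hgal₁ halt₁ hnondeg₁ ι₁ hι₁ hkill₂ e₂ hμ₂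
    hadd₁₂ hadd₂₂ hgal₂ halt₂ hnondeg₂ ι₂ hι₂ hker hι₂inj hB₁nd hCT₂nd

set_option maxHeartbeats 1600000 in
/-- **McCallum's inequality on H₂ with the Cassels–Tate package internalised** (Weil pairings, `ι`, `hkill` from the finiteness of
the two `Ш` with `v₂ #Ш ≤ L`); the rank inputs are point-free statements on the Selmer groups. [cite: McCallumLMS1991, §5 Thm. 5.4, Cor. 5.6]
[cite: MilneADT2006, Ch. I §6 Prop. 6.9, Thm. 6.13 (a)] [cite: SilvermanAEC2009, III.8.1, X.4.2] -/
theorem card_mul_card_le_two_pow_two_mul_of_pairData_cmInert_of_finite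
    [W.IsElliptic] [W.IsGloballyMinimal] [NeZero (W.conductorNorm ℤ)] [(twin W K).IsElliptic]
    (hCM : W.HasCM) (hin : Literature.NumberTheory.EllipticCurves.Rank1Residual.CMInert W 2)
    (hρ : W.HasSurjectiveModNGaloisRep 2) (hK : IsImaginaryQuadratic K) (hoddK : Odd (NumberField.discr K))
    (hH : SatisfiesHeegnerHypothesis (W.conductorNorm ℤ) K)
    {P₀ : (W.baseChange K).toAffine.Point} (hP₀ : IsHeegnerPoint (W.conductorNorm ℤ) W K P₀)
    {L : ℕ} (hL1 : 1 ≤ L)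
    -- the two-member descent data on the `ℚ`-pair carrier
    (D : PairDataM (galH1Torsion W (lvl (L + L))) (galH1Torsion (twin W K) (lvl (L + L)))
      (HeightOneSpectrum (𝓞 ℚ) ⊕ InfinitePlace ℚ))
    (hDp : D.p = 2) (hDM : D.M = L + L)
    (hDSel₁ : D.Sel₁ = selmerGroup W (lvl (L + L)))
    (hDSel₂ : D.Sel₂ = selmerGroup (twin W K) (lvl (L + L)))
    (hDLoc₁ : D.Loc₁ = loc₁ W (L + L)) (hDLoc₂ : D.Loc₂ = loc₂ W K (L + L))
    (hDA₁ : D.A₁ = a₁ W (L + L)) (hDA₂ : D.A₂ = a₂ W K (L + L))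
    (hDpl : D.pl = pl) (hDDv : D.Dv = Dv)
    (hDKol : ∀ ℓ, D.Kol ℓ ↔ IsKolyvaginPrime (W.conductorNorm ℤ) W K 2 ℓ ∧
      FrobEqFrobInfty W K (2 ^ (L + L + 1)) ℓ ∧ kolPrime W K (L + L) ℓ)
    (hM₀L : D.M₀ ≤ L)
    -- finiteness of the two Tate–Shafarevich groups, `L` beyond their `2`-adic size
    [Finite W.sha] [Finite (twin W K).sha]
    (hLsha₁ : padicValNat 2 (Nat.card W.sha) ≤ L) (hLsha₂ : padicValNat 2 (Nat.card (twin W K).sha) ≤ L)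
    -- rank one on `E`: the kernel of `Sel_{2^{2L}}(E) → H¹(ℚ, E)` is `ℤ · D.x`; rank zero on `E^{(d_K)}`: that kernel vanishes
    (hkerT : ∀ z : selmerGroup W (lvl (L + L)),
      torsionH1ToH1 W (lvl (L + L)) z = 0 ↔ (z : galH1Torsion W (lvl (L + L))) ∈ AddSubgroup.zmultiples D.x)
    (hinjT : ∀ z : selmerGroup (twin W K) (lvl (L + L)), torsionH1ToH1 (twin W K) (lvl (L + L)) z = 0 → z = 0) :
    Nat.card ((W.sha)[(2 ^ L : ℕ)]) * Nat.card (selmerGroup (twin W K) (lvl (L + L))) ≤ 2 ^ (2 * D.M₀) := by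
  haveI : NeZero (2 ^ L * 2 ^ L) := ⟨by positivity⟩
  have hL2 : 2 ≤ 2 ^ L * 2 ^ L := by
    have h := Nat.one_lt_two_pow (show L ≠ 0 by omega)
    nlinarith
  have hmQ : ((2 ^ L * 2 ^ L : ℕ) : ℚ) ≠ 0 := by positivity
  -- ### the Cassels–Tate package of `E` and of `E^{(d_K)}`
  obtain ⟨e₁, hμ₁, hadd₁₁, hadd₂₁, halt₁, hnondeg₁, hgal₁⟩ := exists_weilPairing_holds W (2 ^ L * 2 ^ L) hL2 hmQ
  obtain ⟨e₂, hμ₂, hadd₁₂, hadd₂₂, halt₂, hnondeg₂, hgal₂⟩ := exists_weilPairing_holds (twin W K) (2 ^ L * 2 ^ L) hL2 hmQ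
  have hkill₁ := zsmul_pow_eq_zero_of_finite_of_padicValNat_le W.sha hLsha₁
  have hkill₂ := zsmul_pow_eq_zero_of_finite_of_padicValNat_le (twin W K).sha hLsha₂
  obtain ⟨ι₁, hι₁⟩ := exists_selmerToSha_of_finite W hLsha₁
  obtain ⟨ι₂, hι₂⟩ := exists_selmerToSha_of_finite (twin W K) hLsha₂
  -- ### the rank inputs through `ι`
  have hker : ∀ z : selmerGroup W (lvl (L + L)),
      ι₁ z = 0 ↔ (z : galH1Torsion W (lvl (L + L))) ∈ AddSubgroup.zmultiples D.x := by
    intro z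
    rw [← hkerT z, ← hι₁ z]
    constructor
    · intro h
      rw [h]
      rfl
    · intro h
      exact Subtype.ext (Subtype.ext h)
  have hι₂inj : Function.Injective ι₂ := by
    refine (injective_iff_map_eq_zero ι₂).mpr fun z hz ↦ hinjT z ?_
    rw [← hι₂ z, hz]
    rfl
  exact card_mul_card_le_two_pow_two_mul_of_pairData_cmInert_of_kill W hCM hin hρ hK hoddK hH hP₀ hL1 D hDp hDM hDSel₁
    hDSel₂ hDLoc₁ hDLoc₂ hDA₁ hDA₂ hDpl hDDv hDKol hM₀L hkill₁ e₁ hμ₁ hadd₁₁ hadd₂₁ hgal₁ halt₁ hnondeg₁ ι₁ hι₁ hkill₂ e₂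
    hμ₂ hadd₁₂ hadd₂₂ hgal₂ halt₂ hnondeg₂ ι₂ hι₂ hker hι₂inj

end Summit.BirchSwinnertonDyer.BirchSwinnertonDyer.Theorems.KolyvaginPairDataTwo

end
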